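import Mathlib.MeasureTheory.Measure.Lebesgue.Basic
import Mathlib.MeasureTheory.Measure.Prod
import Mathlib.MeasureTheory.Measure.Hausdorff
import Mathlib.MeasureTheory.Integral.IntervalIntegral.Basic
import Mathlib.MeasureTheory.Integral.Bochner.Set
import Mathlib.MeasureTheory.Function.Jacobian
import Mathlib.Analysis.SpecialFunctions.Integrals.Basic
import Mathlib.Analysis.SpecialFunctions.PolarCoord
import Mathlib.Analysis.Complex.ExponentialBounds
import Mathlib.Analysis.Calculus.InverseFunctionTheorem.FDeriv
import Literature.MathematicalPhysics.QuantumLattice.FermiRG.FST2Regularity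
import Literature.MathematicalPhysics.QuantumLattice.FermiRG.FST2MorseLemma
import HarnessLib

/-!
# Feldman–Salmhofer–Trubowitz II, Appendix B: the volume lemmas behind Theorem 1.1 (`d = 2`)

Topic `Literature/MathematicalPhysics/QuantumLattice/FermiRG`; a THEOREM-ONLY companion of
`FST2Regularity.lean` (where [II] Theorem 1.1 is the named fact `VolumeBound`) and of
`FST2MorseLemma.lean` (Appendix A, the `C²` Morse lemmas). Source:

* [II] J. Feldman, M. Salmhofer, E. Trubowitz, *Perturbation theory around non-nested Fermi
  surfaces II. Regularity of the moving Fermi surface: RPA contributions*, Comm. Pure Appl.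
  Math. **51** (1998) 1133–1246, arXiv:cond-mat/9701073 (`FeldmanSalmhoferTrubowitz1998`),
  **Appendix B "The proof of the volume bound"** (`d = 2` part: p.32 L1–p.35 L112 of the
  `lit read arxiv:cond-mat/9701073` render; locators `p.N Lm` = chunk/line of the arXiv TeX, NOT
  journal pages), with §1 eq. (cWdef) (p.2 L107–113) for the object `𝓦(ε)`.

[II] Theorem 1.1 (`\bestvol`): `𝓦(ε) ≤ Q_V ε |log ε|` for `d = 2`. Appendix B proves it by
splitting the `dθ₁ dθ₂` integral into (1) a REGULAR region where `|∂η/∂θᵢ| ≥ δ₁` and one changes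
variables `θ₁ → η` (p.33 L80–96), and (2) small neighbourhoods of the finitely many critical
points of `η = e(v₁ p(0,θ₁) + v₂ p(0,θ₂) + q)`, which are non-degenerate (`|det D₀| ≥ ⅜ w₀²`,
p.34 L60–p.35 L45) and are brought by a linear change of variables to the normal forms
`D²ν(0) = diag(±1, 1)` (p.35 L47–80); there the `C²` Morse lemmas of Appendix A reduce the
integral to the two MODEL INTEGRALS `∫ dR dα 𝟙(|f₀ + R| ≤ ε) ≤ 4π ε` (elliptic, p.35 L99–104)
and `∫ dx dy 𝟙(|f₀ + xy| ≤ ε) ≤ Const ε |log ε|` (hyperbolic, p.35 L108–112 — the origin of the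
logarithm). This file PROVES those analytic building blocks, uniformly in the level `f₀` as
App. B requires ("uniformly in `f₀` (here `f₀ = η(ϑ^{cr}(q), q)`)", p.35 L84), and the bridge
from the tree's typed object `volW` to [II]'s angular integrals. What is NOT here is the
GLOBAL part of Appendix B (the tubular coordinates `(ρ, θ)` of [I, Lemma 2.1], the solution
curves `ϑ^{(k)}`, the set `𝒫_κ` of critical `q`, the invertibility and compactness arguments
p.32 L60–p.34 L58, and the `d ≥ 3` section): `VolumeBound` stays a named fact.

## What is proved (all sorry-free theorems; no definitions, no named facts)

* `volume_hyperbolicModel_le` — the hyperbolic model integral with an explicit constant: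
  `vol{(x,y) ∈ [-σ,σ]² : |f₀ + xy| ≤ ε} ≤ 4ε (1 + log(σ²/ε))` for `0 < ε ≤ σ²`, all `f₀`
  (sections are intervals of length `≤ min(2σ, 2ε/|x|)`; `∫ dx/x` gives the logarithm).
* `morseC2_hyperbolic_volume_le` — **the singular region at a hyperbolic critical point**:
  `ν ∈ C²(ℝ²)`, `ν(0) = 0`, `Dν(0) = 0`, `D²ν(0) = diag(-1, 1)` (the hypotheses of
  `FST2MorseLemma`) ⇒ `∃ r > 0, C ≥ 0, ∀ f₀, ∀ 0 < ε ≤ ½: vol{φ ∈ B_r(0) : |f₀ + ν(φ)| ≤ ε} ≤ C ε |log ε|`.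
  Proof as printed: Theorem A.2 (`morseC2_hyperbolic_factorisation`) writes `ν = x·y` with
  `Φ = (x, y)` a local `C¹` change of variables; the inverse function theorem
  (`HasStrictFDerivAt.toOpenPartialHomeomorph`) makes `Φ` injective near `0` with Jacobian
  determinant bounded below, so Mathlib's change-of-variables formula
  (`lintegral_abs_det_fderiv_eq_addHaar_image`) bounds the volume by a constant times the model
  integral at `σ = 1`.
* `morseC2_elliptic_volume_le` — **the singular region at an elliptic critical point**:
  `D²ν(0) = 1` ⇒ `∃ r > 0, ∀ f₀, ∀ ε > 0: vol{φ ∈ B_r(0) : |f₀ + ν(φ)| ≤ ε} ≤ 8π ε` (the printed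
  constant). Proof: polar coordinates (`lintegral_comp_polarCoord_symm`); on each ray the radial
  derivative of `ν` is `≥ ρ/2` near `0` (from `morseC2_elliptic_jacobian`, the printed
  "Jacobian `= 1 + o(1)`"), so the weighted length `∫ 𝟙(|f₀ + ν| ≤ ε) ρ dρ` is `≤ 4ε`
  (`setLIntegral_radial_le_of_sq_sub_sq_le`: the substitution `s = ρ²/2` and `vol ≤ diam`),
  and the angular integration contributes `2π`.
* `morseC2_hyperbolic_volume_le_at`, `morseC2_elliptic_volume_le_at` — the same at a general
  base point `p₀` with NO hypothesis on the critical value `ν(p₀)` (the form App. B uses: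
  `ν = η - η(ϑ^{cr})`, `f₀ = η(ϑ^{cr})`), by recentring and translation invariance.
* `morseC2_nondegenerate_volume_le_at` — **the singular region at an ARBITRARY non-degenerate
  critical point**, the linear normalisation of p.35 L47–80 folded in: `Dν(p₀) = 0` and
  `∂₁²ν ∂₂²ν - (∂₁∂₂ν)² ≠ 0` at `p₀` ⇒ `∃ r > 0, C ≥ 0, ∀ f₀, ∀ 0 < ε ≤ ½:
  vol{p ∈ B_r(p₀) : |f₀ + ν p| ≤ ε} ≤ C ε |log ε|`. An explicit `2 × 2` congruence
  (`exists_normalForm`: complete the square / the `xy` case, rescale, swap) brings the Hessian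
  to `diag(-1,1)`, `diag(1,1)` or `-diag(1,1)`; the Jacobian of the linear map enters through
  `Measure.addHaar_image_continuousLinearEquiv` (the print's "`|det D₀|^{-½} ≤ 2/|w₀|`"); the
  elliptic `8π ε` is weakened to `16π ε |log ε|` on `ε ≤ ½`.
* `volume_band_le_of_hessian_lower_bound` (+ `_at`) — **a QUANTITATIVE elliptic bound**:
  `Dν(p₀) = 0` and `D²ν(p)(v,v) ≥ λ|v|²` on `B_{r₀}(p₀)` ⇒ `vol{p ∈ B_{r₀/2}(p₀) : |f₀ + ν p| ≤ ε}
  ≤ 4π ε/λ` for ALL `f₀` and `ε > 0`, constants from `(r₀, λ)` only — hence uniform over any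
  family of functions sharing these bounds (the uniformity in `q` that App. B takes from
  compactness, p.34 L40–58). No Morse lemma: radial derivative `≥ λρ` and polar coordinates.
* `volume_band_le_of_posDef_hessian_at` / `volume_band_le_of_negDef_hessian_at` — the same
  with the Hessian lower bound DERIVED from the entries at the critical point: `a = ∂₁²ν(p₀) > 0`
  (resp. `< 0`), `ac - b² ≥ w > 0`, `|a + c| ≤ 2K` and `‖D²ν(p) - D²ν(p₀)‖ ≤ w/4K` on
  `B_{r₀}(p₀)` ⇒ `vol{p ∈ B_{r₀/2}(p₀) : |f₀ + ν p| ≤ ε} ≤ 16Kπε/w` (the form is `≥ (w/2K)|v|²`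
  by `(a+c)·D²ν(p₀)(v,v) - (ac-b²)|v|² = (av₁+bv₂)² + (bv₁+cv₂)²`): constants from
  `(|det D₀|, |e|₂, a modulus of continuity of D)` — what "by continuity of `D`" (p.35 L45–47)
  quantifies.
* ONE-DIMENSIONAL TOOLBOX for uniformly convex slices (the ingredients of a quantitative
  hyperbolic bound by slicing, and of the fold points of the regular region):
  `volume_band_le_of_deriv_uniformMono` (`h'` `λ`-increasing ⇒
  `vol{t₁ ≤ h ≤ t₂} ≤ 2√(2(t₂-t₁)/λ)`), `volume_band_le_of_deriv_uniformMono_of_gap`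
  (`vol{|h - c| ≤ ε} ≤ 4ε/√(2λ(c - ε - h x₀))` away from the bottom — the `ε/√u` regime),
  `strongConvex_chord_of_deriv_uniformMono` (chord inequality), `chord_sSup_of_forall` (the chord
  inequality is stable under pointwise suprema — the marginal `c - min_{φ₂} ν(φ₁,φ₂)`),
  `volume_band_le_of_chord` / `volume_sublevel_le_of_chord` (DERIVATIVE-FREE band lemmas for
  continuous functions with the chord inequality: `≤ 4(t₂-t₁)/√(λ(t₂-m₀))`, `≤ 4√((t₂-m₀)/λ)`).
* `volume_band_le_of_saddle` — **a QUANTITATIVE hyperbolic (saddle) bound**, constants from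
  quantitative data only: if `∂₂²ν ≥ λ` and `∂₁²ν ≤ -λ` on the box `[-σ,σ]²` and `ν` oscillates
  by at most `Ω` there, then `vol{p ∈ [-σ,σ]² : |f₀ + ν p| ≤ ε} ≤ (32 + 48K) ε/λ` for every
  `f₀`, every `ε > 0` and every `K ∈ ℕ` with `Ω + ε ≤ 2ε·4^K` (`K ≈ log₄((Ω+ε)/2ε)`: the
  `ε|log ε|` law); `volume_band_le_of_saddle_log` is the same bound in the `Q·ε(1+|log ε|)`
  shape of Theorem 1.1, `Q = (80 + 35 log(Ω+1))/λ`, for `0 < ε ≤ 1/2`, with that `K` chosen.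
  No critical point, no Morse lemma, no inverse function theorem: slicing
  (Tonelli), the one-dimensional toolbox above on each uniformly convex slice, and the
  derivative-free band lemma for the uniformly convex marginal `u(φ₁) = -f₀ - min_{φ₂} ν`,
  summed over dyadic shells of `u`. Together with `volume_band_le_of_hessian_lower_bound` this
  makes the local half of App. B uniform over compactly parametrised families (the `q ∈ 𝒫_κ`
  of p.34 L40–58) once the Hessian bounds hold uniformly — which continuity of `D` in `q` gives.
  `volume_band_le_of_saddle_dir` (+ `_log`, + `volume_ball_band_le_of_saddle_dir_log` on a
  sup-norm ball inside the parallelogram) is the same bound in two ARBITRARY directions `u, v`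
  (`D²ν(p)(v,v) ≥ λ`, `D²ν(p)(u,u) ≤ -λ` on the parallelogram `p₀ + [-σ,σ]u + [-σ,σ]v` ⇒
  `vol ≤ |u₁v₂ - u₂v₁|·(32+48K)ε/λ`), obtained through the affine change-of-variables identity
  `volume_affine_image_inter_band`
  (`vol((p₀+L·)''S ∩ {|f₀+ν| ≤ ε}) = |det L|·vol(S ∩ {|f₀+ν(p₀+L·)| ≤ ε})`, any linear `L`:
  the measure-theoretic content of the linear normalisation p.35 L47–80).
* `volume_slice_le_of_deriv_ge` / `_le`, `volume_rect_le_of_partialDeriv_ge` — **the regular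
  region**: `g' ≥ δ > 0` on `(a,b)` ⇒ `vol{t ∈ [a,b] : |f₀ + g t| ≤ ε} ≤ 2ε/δ` (mean value
  inequality and `vol ≤ diam`), and the rectangle version `≤ (d-c)·2ε/δ` by Tonelli ("the factor
  `2π` coming from the `θ₂` integration").
* `volume_regular_le_of_tiling` (+ `_of_hessian_bound` for `C²` data) — **the regular region
  `R_δ(ε) ≤ Const·ε/φ(δ)` (p.32 L88–96) in quantitative form**: `η ∈ C¹` with `M`-Lipschitz
  partial derivatives on a box tiled into `n·m` squares of side `s`, `M s ≤ δ₁`, and a region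
  `A` of the box in which, wherever `|f₀ + η| ≤ ε`, `|∂₁η| ≥ 2δ₁` or `|∂₂η| ≥ 2δ₁` ⇒
  `vol(A ∩ {|f₀ + η| ≤ ε}) ≤ n·m·s·2ε/δ₁`; on each tile meeting the set one partial derivative
  keeps sign and size `≥ δ₁`, and the rectangle lemma (with its reflections `θ₁ ↔ θ₂`,
  `η ↔ -η`, Lebesgue measure being swap-invariant) applies. [II] takes this step from the
  Jacobian estimate of [I, App. A]; slicing per tile gives the same `ε`-linear bound with a
  constant from `(|B|, M, δ₁)` only.
* `volW_le_of_lipschitz_param` — **the bridge to the typed object** (`d = 2`): for any Lipschitz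
  `γ : ℝ → E` with `S ∩ F ⊆ γ([a,b])`, `volW cr e ε ≤ L² · sup_{q,v₁,v₂} vol{(θ₁,θ₂) ∈ [a,b]² :
  |e(v₁ γ θ₁ + v₂ γ θ₂ + q)| ≤ ε}` (`μH[1]` of a Lipschitz image, `μH[1] = vol` on `ℝ`
  (`hausdorffMeasure_real`), finiteness of `μH[1]⌊(S ∩ F)`, Tonelli); with
  `surfaceDim_eq_one_of_finrank`; and the crude consequence `volW_le_sq_of_lipschitz_param`
  (`volW cr e ε ≤ L²(b-a)²` for every `ε`), which carries a small-`ε` estimate ("we may assume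
  `ε < κ/2`", p.33 L60–62) to the whole typed range `0 < ε ≤ 1/2`.

## Faithfulness notes (for the referee)

* The model bounds are stated on balls of the sup norm of `ℝ × ℝ` (Mathlib's product norm) and
  with explicit but non-optimal constants (`C = 12/c`, `c` = half the Jacobian determinant of the
  Morse change of variables at `0`; `8π` in the elliptic case as printed; the print's hyperbolic
  constant is "`Const |log σ̃| ε |log ε|`"). [II] needs only existence of the constants.
* The hyperbolic bound is typed on `0 < ε ≤ ½` (as `VolumeBound` is: `|log ε|` must stay away
  from `0`; App. B p.33 L60–62 "we may assume `ε ≤ κ/2`"); the elliptic and regular bounds hold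
  for all `ε`.
* `volW_le_of_lipschitz_param` is an inequality, which is the direction Theorem 1.1 needs; the
  printed `𝓦` (in the coordinate `θ` with `|∂_θ p| = 1/P`) and the typed `volW` (Hausdorff
  measure on `S ∩ F`) differ exactly by such a Jacobian factor (`FST2Regularity`, Faithfulness).
* UNIFORMITY. The constants `r, C` of the singular-region theorems depend on the function `ν`
  (through the neighbourhoods of the `C²` Morse lemma and of the inverse function theorem), not
  only on quantitative data (`|ν|₂`, `|det D₀|`). App. B needs them uniformly in the parameter
  `q ∈ 𝒫_κ` and gets this from compactness and the continuity of `D` in `q` (p.34 L40–58,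
  p.35 L45–47). The QUANTITATIVE theorems `volume_band_le_of_hessian_lower_bound` (elliptic:
  constants from a Hessian lower bound on a ball) and `volume_band_le_of_saddle` (hyperbolic:
  constants from `∂₂²ν ≥ λ`, `∂₁²ν ≤ -λ`, the oscillation and the box) remove this dependence:
  after the linear normalisation of `D₀(q)` their hypotheses hold on a fixed box for all `q`
  near `q⁽ⁱ⁾` by continuity of `D`, so the local constants ARE uniform; the compactness
  bookkeeping itself belongs to the global part and is not done here.
* Nothing here is specific to a model; nothing is asserted about [II]'s hypotheses.
-/

noncomputable section

open Set Filter MeasureTheory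
open scoped NNReal ENNReal Topology

namespace Literature.MathematicalPhysics.QuantumLattice.FermiRG

/-! ### The bridge: `volW` (Hausdorff measure on `S ∩ F`) versus angular integrals, `d = 2` -/

section Reduction

variable {E : Type*} [NormedAddCommGroup E] [InnerProductSpace ℝ E] [MeasurableSpace E] [BorelSpace E]

omit [MeasurableSpace E] [BorelSpace E] in
/-- In dimension `d = 2` the Fermi surface of [II] is one-dimensional: `surfaceDim E = 1`
(`θ ∈ S^{d-1}`, (cWdef) p.2 L113–117). [cite: FeldmanSalmhoferTrubowitz1998, §1 eq. (cWdef) (arXiv p.2 L113–117)] -/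
theorem surfaceDim_eq_one_of_finrank (hd : Module.finrank ℝ E = 2) : surfaceDim E = 1 := by
  simp [surfaceDim, hd]

/-- **Reduction of `𝓦(ε)` to angular integrals (`d = 2`).** [II] defines `𝓦(ε)` ((cWdef), p.2
L107–113) as `sup_q max_{vᵢ = ±1} ∫ dθ₁ dθ₂ 𝟙(|e(v₁ p(0,θ₁) + v₂ p(0,θ₂) + q)| ≤ ε)` in the angular
coordinate `θ ↦ p(0,θ)` of the Fermi curve (§2.2, p.9 L40–62), and App. B bounds exactly these
`dθ₁ dθ₂`-integrals (p.32 L50ff). The tree's `volW` integrates instead the one-dimensional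
Hausdorff measure on the representatives `S ∩ F` (`FST2Regularity.volW`, "Faithfulness"). This
lemma is the bridge: for ANY Lipschitz parametrisation `γ : ℝ → E` (constant `L`) whose image of
`[a,b]` covers `S ∩ F`, `𝓦(ε) ≤ L² · sup_{q, v₁, v₂} vol{(θ₁,θ₂) ∈ [a,b]² : |e(v₁ γ(θ₁) + v₂ γ(θ₂) + q)| ≤ ε}`
(`μH[1]` of a Lipschitz image is at most `L` times the length, `μH[1] = vol` on `ℝ`, Tonelli).
[cite: FeldmanSalmhoferTrubowitz1998, §1 eq. (cWdef) (arXiv p.2 L107–113) with App. B (p.32 L50–60)] -/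
theorem volW_le_of_lipschitz_param (cr : Crystal E) {e : E → ℝ} (he : Continuous e)
    (hd : Module.finrank ℝ E = 2) {γ : ℝ → E} {L : ℝ≥0} {a b : ℝ} (hγ : LipschitzWith L γ)
    (hcov : cr.fermiSurfaceRep e ⊆ γ '' Icc a b) (ε : ℝ) :
    volW cr e ε ≤ (L : ℝ≥0∞) ^ 2 *
      ⨆ (q : E) (v₁ : ℝ) (_ : v₁ = 1 ∨ v₁ = -1) (v₂ : ℝ) (_ : v₂ = 1 ∨ v₂ = -1),
        volume ((Icc a b ×ˢ Icc a b) ∩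
          {θ : ℝ × ℝ | |e (v₁ • γ θ.1 + v₂ • γ θ.2 + q)| ≤ ε}) := by
  haveI : FiniteDimensional ℝ E := Module.finite_of_finrank_pos (by omega)
  unfold volW
  rw [surfaceDim_eq_one_of_finrank hd]
  set SF := cr.fermiSurfaceRep e with hSF
  set μ : Measure E := (μH[1] : Measure E).restrict SF with hμ
  set m : Measure E := (volume.restrict (Icc a b)).map γ with hm
  have hγc : Continuous γ := hγ.continuous
  have hγm : Measurable γ := hγc.measurable
  -- `μ ≤ L • m` on measurable sets
  have hle : ∀ s : Set E, MeasurableSet s → μ s ≤ (L : ℝ≥0∞) * m s := by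
    intro s hs
    rw [hμ, Measure.restrict_apply hs, hm, Measure.map_apply hγm hs,
      Measure.restrict_apply (hγm hs)]
    have hsub : s ∩ SF ⊆ γ '' (γ ⁻¹' s ∩ Icc a b) := by
      rintro z ⟨hz, hzS⟩
      obtain ⟨t, ht, rfl⟩ := hcov hzS
      exact ⟨t, ⟨hz, ht⟩, rfl⟩
    calc μH[1] (s ∩ SF) ≤ μH[1] (γ '' (γ ⁻¹' s ∩ Icc a b)) := measure_mono hsub
      _ ≤ (L : ℝ≥0∞) ^ (1 : ℝ) * μH[1] (γ ⁻¹' s ∩ Icc a b) :=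
          hγ.lipschitzOnWith.hausdorffMeasure_image_le zero_le_one
      _ = (L : ℝ≥0∞) * volume (γ ⁻¹' s ∩ Icc a b) := by
          rw [ENNReal.rpow_one, hausdorffMeasure_real]
  have hμle : μ ≤ (L : ℝ≥0∞) • m := by
    rw [Measure.le_iff]
    intro s hs
    rw [Measure.smul_apply, smul_eq_mul]
    exact hle s hs
  haveI : IsFiniteMeasure μ := by
    refine ⟨?_⟩
    calc μ univ ≤ (L : ℝ≥0∞) * m univ := hle univ MeasurableSet.univ
      _ < ⊤ := by
          rw [hm, Measure.map_apply hγm MeasurableSet.univ, preimage_univ,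
            Measure.restrict_apply MeasurableSet.univ, univ_inter, Real.volume_Icc]
          exact ENNReal.mul_lt_top ENNReal.coe_lt_top ENNReal.ofReal_lt_top
  refine iSup_le fun q => iSup_le fun v₁ => iSup_le fun hv₁ => iSup_le fun v₂ =>
    iSup_le fun hv₂ => ?_
  set W : Set (E × E) := {x | |e (v₁ • x.1 + v₂ • x.2 + q)| ≤ ε} with hW
  have hWm : MeasurableSet W :=
    (isClosed_le (continuous_abs.comp (he.comp (by fun_prop))) continuous_const).measurableSet
  set V : Set (ℝ × ℝ) := (Icc a b ×ˢ Icc a b) ∩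
    {θ : ℝ × ℝ | |e (v₁ • γ θ.1 + v₂ • γ θ.2 + q)| ≤ ε} with hV
  have hVc : Continuous fun θ : ℝ × ℝ => |e (v₁ • γ θ.1 + v₂ • γ θ.2 + q)| :=
    continuous_abs.comp (he.comp (((hγc.comp continuous_fst).const_smul v₁).add
      ((hγc.comp continuous_snd).const_smul v₂) |>.add continuous_const))
  have hVm : MeasurableSet V :=
    (measurableSet_Icc.prod measurableSet_Icc).inter (isClosed_le hVc continuous_const).measurableSet
  -- sections
  have hsec : ∀ t : ℝ, (Icc a b).indicator
      (fun t => volume (γ ⁻¹' (Prod.mk (γ t) ⁻¹' W) ∩ Icc a b)) t = volume (Prod.mk t ⁻¹' V) := by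
    intro t
    by_cases ht : t ∈ Icc a b
    · rw [indicator_of_mem ht]
      congr 1
      ext s
      simp only [hV, hW, mem_inter_iff, mem_preimage, mem_setOf_eq, mem_prod]
      tauto
    · rw [indicator_of_notMem ht]
      have : Prod.mk t ⁻¹' V = ∅ := by
        ext s
        simp only [hV, mem_preimage, mem_inter_iff, mem_prod, mem_setOf_eq, mem_empty_iff_false,
          iff_false, not_and]
        exact fun h _ => absurd h.1 ht
      rw [this, measure_empty]
  have hLtop : (L : ℝ≥0∞) ≠ ⊤ := ENNReal.coe_ne_top
  calc (μ.prod μ) W = ∫⁻ x, μ (Prod.mk x ⁻¹' W) ∂μ := Measure.prod_apply hWm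
    _ ≤ ∫⁻ x, (L : ℝ≥0∞) * m (Prod.mk x ⁻¹' W) ∂μ :=
        lintegral_mono fun x => hle _ (measurable_prodMk_left hWm)
    _ ≤ ∫⁻ x, (L : ℝ≥0∞) * m (Prod.mk x ⁻¹' W) ∂((L : ℝ≥0∞) • m) :=
        lintegral_mono' hμle le_rfl
    _ = (L : ℝ≥0∞) * ∫⁻ x, (L : ℝ≥0∞) * m (Prod.mk x ⁻¹' W) ∂m := lintegral_smul_measure _ _
    _ ≤ (L : ℝ≥0∞) * ∫⁻ t, (L : ℝ≥0∞) * m (Prod.mk (γ t) ⁻¹' W) ∂(volume.restrict (Icc a b)) := by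
        gcongr
        exact lintegral_map_le _ _
    _ = (L : ℝ≥0∞) * ((L : ℝ≥0∞) *
          ∫⁻ t in Icc a b, volume (γ ⁻¹' (Prod.mk (γ t) ⁻¹' W) ∩ Icc a b)) := by
        rw [lintegral_const_mul' _ _ hLtop]
        congr 2
        refine lintegral_congr fun t => ?_
        rw [hm, Measure.map_apply hγm (measurable_prodMk_left hWm),
          Measure.restrict_apply (hγm (measurable_prodMk_left hWm))]
    _ = (L : ℝ≥0∞) ^ 2 * volume V := by
        rw [← mul_assoc, ← pow_two]
        congr 1
        rw [← lintegral_indicator measurableSet_Icc, Measure.volume_eq_prod, Measure.prod_apply hVm]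
        exact lintegral_congr hsec
    _ ≤ _ := by
        gcongr
        exact le_iSup_of_le q (le_iSup_of_le v₁ (le_iSup_of_le hv₁
          (le_iSup_of_le v₂ (le_iSup_of_le hv₂ le_rfl))))


end Reduction

/-! ### The hyperbolic model integral -/

section Model

/-- The `y`-section of the hyperbolic band `{|f₀ + x y| ≤ ε}` at `x ≠ 0` lies in the interval of
radius `ε/|x|` around `-f₀/x`. [folklore] -/
private theorem hypModel_section_subset (f₀ x ε : ℝ) (hx : x ≠ 0) :
    {y : ℝ | |f₀ + x * y| ≤ ε} ⊆ Metric.closedBall (-f₀ / x) (ε / |x|) := by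
  intro y hy
  rw [Metric.mem_closedBall, Real.dist_eq]
  have hxpos : 0 < |x| := abs_pos.2 hx
  rw [le_div_iff₀ hxpos, ← abs_mul]
  have : (y - -f₀ / x) * x = f₀ + x * y := by field_simp; ring
  rw [this]; exact hy

/-- `∫_a^σ 2ε/|x| dx = 2ε log(σ/a)` for `0 < a ≤ σ`, as a Lebesgue integral over `Icc a σ`. [folklore] -/
private theorem setLIntegral_inv_Icc {a σ ε : ℝ} (ha : 0 < a) (haσ : a ≤ σ) (hε : 0 ≤ ε) :
    ∫⁻ x in Icc a σ, ENNReal.ofReal (2 * ε / |x|) = ENNReal.ofReal (2 * ε * Real.log (σ / a)) := by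
  have hσ : 0 < σ := lt_of_lt_of_le ha haσ
  have hcont : ContinuousOn (fun x : ℝ => 2 * ε / |x|) (Icc a σ) := by
    refine ContinuousOn.div continuousOn_const (continuous_abs.continuousOn) fun x hx => ?_
    exact (abs_pos.2 (by linarith [hx.1] : x ≠ 0)).ne'
  have hint : IntegrableOn (fun x : ℝ => 2 * ε / |x|) (Ioc a σ) volume :=
    (hcont.integrableOn_Icc).mono_set Ioc_subset_Icc_self
  rw [setLIntegral_congr Ioc_ae_eq_Icc.symm, ← ofReal_integral_eq_lintegral_ofReal hint]
  · congr 1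
    rw [← intervalIntegral.integral_of_le haσ]
    have heq : ∀ x ∈ uIcc a σ, 2 * ε / |x| = 2 * ε * x⁻¹ := by
      intro x hx
      rw [uIcc_of_le haσ] at hx
      rw [abs_of_pos (by linarith [hx.1]), div_eq_mul_inv]
    rw [intervalIntegral.integral_congr heq, intervalIntegral.integral_const_mul,
      integral_inv_of_pos ha hσ]
  · refine ae_restrict_of_forall_mem measurableSet_Ioc fun x hx => ?_
    have : 0 < |x| := abs_pos.2 (by linarith [hx.1] : x ≠ 0)
    positivity

/-- The mirror image: `∫_{-σ}^{-a} 2ε/|x| dx = 2ε log(σ/a)`. [folklore] -/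
private theorem setLIntegral_inv_Icc_neg {a σ ε : ℝ} (ha : 0 < a) (haσ : a ≤ σ) (hε : 0 ≤ ε) :
    ∫⁻ x in Icc (-σ) (-a), ENNReal.ofReal (2 * ε / |x|) =
      ENNReal.ofReal (2 * ε * Real.log (σ / a)) := by
  have hσ : 0 < σ := lt_of_lt_of_le ha haσ
  have hcont : ContinuousOn (fun x : ℝ => 2 * ε / |x|) (Icc (-σ) (-a)) := by
    refine ContinuousOn.div continuousOn_const (continuous_abs.continuousOn) fun x hx => ?_
    exact (abs_pos.2 (by linarith [hx.2] : x ≠ 0)).ne'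
  have hint : IntegrableOn (fun x : ℝ => 2 * ε / |x|) (Ioc (-σ) (-a)) volume :=
    (hcont.integrableOn_Icc).mono_set Ioc_subset_Icc_self
  rw [setLIntegral_congr Ioc_ae_eq_Icc.symm, ← ofReal_integral_eq_lintegral_ofReal hint]
  · congr 1
    rw [← intervalIntegral.integral_of_le (by linarith : -σ ≤ -a)]
    rw [← intervalIntegral.integral_comp_neg (fun x : ℝ => 2 * ε / |x|)]
    simp only [abs_neg]
    have heq : ∀ x ∈ uIcc a σ, 2 * ε / |x| = 2 * ε * x⁻¹ := by
      intro x hx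
      rw [uIcc_of_le haσ] at hx
      rw [abs_of_pos (by linarith [hx.1]), div_eq_mul_inv]
    rw [intervalIntegral.integral_congr heq, intervalIntegral.integral_const_mul,
      integral_inv_of_pos ha hσ]
  · refine ae_restrict_of_forall_mem measurableSet_Ioc fun x hx => ?_
    have : 0 < |x| := abs_pos.2 (by linarith [hx.2] : x ≠ 0)
    positivity

/-- **The hyperbolic model integral of [II] App. B** (p.35 L108–112, the origin of the factor
`ε |log ε|` in Theorem 1.1): for `0 < ε ≤ σ²` and every level `f₀`,
`vol{(x,y) ∈ [-σ,σ]² : |f₀ + xy| ≤ ε} ≤ 4ε(1 + log(σ²/ε))`.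
[cite: FeldmanSalmhoferTrubowitz1998, App. B (arXiv p.35 L108–112)] -/
theorem volume_hyperbolicModel_le {σ ε : ℝ} (hσ : 0 < σ) (hε : 0 < ε) (hεσ : ε ≤ σ ^ 2)
    (f₀ : ℝ) :
    volume ((Icc (-σ) σ ×ˢ Icc (-σ) σ) ∩ {p : ℝ × ℝ | |f₀ + p.1 * p.2| ≤ ε})
      ≤ ENNReal.ofReal (4 * ε * (1 + Real.log (σ ^ 2 / ε))) := by
  set W := (Icc (-σ) σ ×ˢ Icc (-σ) σ) ∩ {p : ℝ × ℝ | |f₀ + p.1 * p.2| ≤ ε} with hW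
  have hWm : MeasurableSet W :=
    (measurableSet_Icc.prod measurableSet_Icc).inter
      (isClosed_le (by fun_prop) continuous_const).measurableSet
  rw [Measure.volume_eq_prod, Measure.prod_apply hWm]
  set a := ε / σ with ha
  have ha_pos : 0 < a := div_pos hε hσ
  have ha_le : a ≤ σ := by
    rw [ha, div_le_iff₀ hσ]; nlinarith
  have hσa : σ / a = σ ^ 2 / ε := by
    rw [ha]; field_simp
  have hlog : 0 ≤ Real.log (σ ^ 2 / ε) :=
    Real.log_nonneg (by rw [le_div_iff₀ hε]; linarith)
  -- the section bound
  let h : ℝ → ℝ≥0∞ := fun x =>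
    if |x| ≤ a then ENNReal.ofReal (2 * σ) else ENNReal.ofReal (2 * ε / |x|)
  have hsec : ∀ x, volume (Prod.mk x ⁻¹' W) ≤ (Icc (-σ) σ).indicator h x := by
    intro x
    by_cases hx : x ∈ Icc (-σ) σ
    · rw [indicator_of_mem hx]
      by_cases hxa : |x| ≤ a
      · simp only [h, if_pos hxa]
        calc volume (Prod.mk x ⁻¹' W) ≤ volume (Icc (-σ) σ) :=
              measure_mono fun y hy => hy.1.2
          _ = ENNReal.ofReal (2 * σ) := by rw [Real.volume_Icc]; ring_nf
      · simp only [h, if_neg hxa]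
        have hx0 : x ≠ 0 := by
          intro h0; apply hxa; rw [h0, abs_zero]; exact ha_pos.le
        calc volume (Prod.mk x ⁻¹' W)
            ≤ volume (Metric.closedBall (-f₀ / x) (ε / |x|)) :=
              measure_mono fun y hy => hypModel_section_subset f₀ x ε hx0 hy.2
          _ = ENNReal.ofReal (2 * ε / |x|) := by rw [Real.volume_closedBall]; ring_nf
    · rw [indicator_of_notMem hx]
      have : Prod.mk x ⁻¹' W = ∅ := by
        ext y
        simp only [mem_preimage, mem_empty_iff_false, iff_false]
        exact fun hy => hx hy.1.1
      rw [this, measure_empty]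
  -- the three pieces
  have hA : ∫⁻ x in Icc (-a) a, h x = ENNReal.ofReal (4 * ε) := by
    calc ∫⁻ x in Icc (-a) a, h x = ∫⁻ x in Icc (-a) a, ENNReal.ofReal (2 * σ) := by
          refine setLIntegral_congr_fun measurableSet_Icc fun x hx => ?_
          simp only [h, if_pos (abs_le.2 hx)]
      _ = ENNReal.ofReal (2 * σ) * volume (Icc (-a) a) := setLIntegral_const _ _
      _ = ENNReal.ofReal (4 * ε) := by
          rw [Real.volume_Icc, ← ENNReal.ofReal_mul (by positivity)]
          congr 1
          rw [ha]; field_simp; ring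
  have hB : ∫⁻ x in Icc (-σ) σ \ Icc (-a) a, h x ≤
      ENNReal.ofReal (4 * ε * Real.log (σ ^ 2 / ε)) := by
    have hsub : Icc (-σ) σ \ Icc (-a) a ⊆ Icc a σ ∪ Icc (-σ) (-a) := by
      intro x hx
      rcases hx with ⟨hx1, hx2⟩
      simp only [mem_Icc, not_and_or, not_le] at hx1 hx2
      rcases hx2 with h2 | h2
      · exact Or.inr ⟨hx1.1, h2.le⟩
      · exact Or.inl ⟨h2.le, hx1.2⟩
    calc ∫⁻ x in Icc (-σ) σ \ Icc (-a) a, h x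
        = ∫⁻ x in Icc (-σ) σ \ Icc (-a) a, ENNReal.ofReal (2 * ε / |x|) := by
          refine setLIntegral_congr_fun (measurableSet_Icc.diff measurableSet_Icc) fun x hx => ?_
          have hxa : ¬ |x| ≤ a := fun h' => hx.2 (abs_le.1 h')
          simp only [h, if_neg hxa]
      _ ≤ ∫⁻ x in Icc a σ ∪ Icc (-σ) (-a), ENNReal.ofReal (2 * ε / |x|) :=
          lintegral_mono_set hsub
      _ ≤ (∫⁻ x in Icc a σ, ENNReal.ofReal (2 * ε / |x|)) +
            ∫⁻ x in Icc (-σ) (-a), ENNReal.ofReal (2 * ε / |x|) := lintegral_union_le _ _ _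
      _ = ENNReal.ofReal (2 * ε * Real.log (σ ^ 2 / ε)) +
            ENNReal.ofReal (2 * ε * Real.log (σ ^ 2 / ε)) := by
          rw [setLIntegral_inv_Icc ha_pos ha_le hε.le, setLIntegral_inv_Icc_neg ha_pos ha_le hε.le,
            hσa]
      _ = ENNReal.ofReal (4 * ε * Real.log (σ ^ 2 / ε)) := by
          rw [← ENNReal.ofReal_add (by positivity) (by positivity)]; ring_nf
  calc ∫⁻ x, volume (Prod.mk x ⁻¹' W)
      ≤ ∫⁻ x, (Icc (-σ) σ).indicator h x := lintegral_mono hsec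
    _ = ∫⁻ x in Icc (-σ) σ, h x := lintegral_indicator measurableSet_Icc _
    _ ≤ ∫⁻ x in Icc (-a) a ∪ (Icc (-σ) σ \ Icc (-a) a), h x :=
        lintegral_mono_set fun x hx => by
          by_cases h' : x ∈ Icc (-a) a
          · exact Or.inl h'
          · exact Or.inr ⟨hx, h'⟩
    _ ≤ (∫⁻ x in Icc (-a) a, h x) + ∫⁻ x in Icc (-σ) σ \ Icc (-a) a, h x :=
        lintegral_union_le _ _ _
    _ ≤ ENNReal.ofReal (4 * ε) + ENNReal.ofReal (4 * ε * Real.log (σ ^ 2 / ε)) :=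
        add_le_add hA.le hB
    _ = ENNReal.ofReal (4 * ε * (1 + Real.log (σ ^ 2 / ε))) := by
        rw [← ENNReal.ofReal_add (by positivity) (by positivity)]; ring_nf


end Model

/-! ### The singular region at a hyperbolic critical point -/

section Hyperbolic

variable {ν : ℝ × ℝ → ℝ}

/-- For `0 < ε ≤ 1/2`: `1 + log(1/ε) ≤ 3 |log ε|`. [folklore] -/
private theorem one_add_log_inv_le {ε : ℝ} (hε : 0 < ε) (hε2 : ε ≤ 1 / 2) :
    1 + Real.log (1 ^ 2 / ε) ≤ 3 * |Real.log ε| := by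
  have hlog : Real.log ε < 0 := Real.log_neg hε (by linarith)
  have hlog2 : Real.log ε ≤ Real.log (1 / 2) := Real.log_le_log hε hε2
  have hhalf : Real.log (1 / 2) < -(1 / 2) := by
    have h2 : Real.log 2 > 1 / 2 := by
      have := Real.log_two_gt_d9; linarith
    rw [one_div, Real.log_inv]; linarith
  rw [one_pow, one_div, Real.log_inv, abs_of_neg hlog]
  linarith

/-- **[II] App. B, the singular region at a HYPERBOLIC critical point** (p.35 L47–112 with
Theorem A.2): if `ν ∈ C²(ℝ²)` has `ν(0) = 0`, `Dν(0) = 0` and `D²ν(0) = diag(-1, 1)`, then there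
are `r > 0` and `C` such that for every level `f₀` and every `0 < ε ≤ 1/2`,
`vol{φ ∈ B_r(0) : |f₀ + ν(φ)| ≤ ε} ≤ C ε |log ε|`. Proof as printed: by Theorem A.2
(`morseC2_hyperbolic_factorisation`) `ν = x·y` near `0` with `(x, y)` a local `C¹` change of
variables (inverse function theorem); its Jacobian is bounded below near `0`, so by the change
of variables formula (`lintegral_abs_det_fderiv_eq_addHaar_image`) the volume is at most a
constant times the hyperbolic model integral `vol{|f₀ + xy| ≤ ε}` (`volume_hyperbolicModel_le`),
which is `O(ε log(1/ε))` uniformly in `f₀`.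
[cite: FeldmanSalmhoferTrubowitz1998, App. B (arXiv p.35 L47–112)] -/
theorem morseC2_hyperbolic_volume_le (hν : ContDiff ℝ 2 ν) (h0 : ν 0 = 0)
    (h1 : fderiv ℝ ν 0 = 0)
    (h11 : iteratedFDeriv ℝ 2 ν 0 ![((1 : ℝ), (0 : ℝ)), ((1 : ℝ), (0 : ℝ))] = -1)
    (h12 : iteratedFDeriv ℝ 2 ν 0 ![((1 : ℝ), (0 : ℝ)), ((0 : ℝ), (1 : ℝ))] = 0)
    (h22 : iteratedFDeriv ℝ 2 ν 0 ![((0 : ℝ), (1 : ℝ)), ((0 : ℝ), (1 : ℝ))] = 1) :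
    ∃ r : ℝ, 0 < r ∧ ∃ C : ℝ, 0 ≤ C ∧ ∀ (f₀ ε : ℝ), 0 < ε → ε ≤ 1 / 2 →
      volume (Metric.ball (0 : ℝ × ℝ) r ∩ {p | |f₀ + ν p| ≤ ε}) ≤
        ENNReal.ofReal (C * ε * |Real.log ε|) := by
  obtain ⟨x, y, hxC, hyC, hνxy, hx0, hy0, hxd, hyd⟩ :=
    morseC2_hyperbolic_factorisation hν h0 h1 h11 h12 h22
  -- the change of variables `Φ = (x, y)` and its (invertible) derivative at `0`
  set Φ : ℝ × ℝ → ℝ × ℝ := fun p => (x p, y p) with hΦ_def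
  have hΦC : ContDiffAt ℝ 1 Φ 0 := hxC.prodMk hyC
  obtain ⟨L, hL⟩ : ∃ L : (ℝ × ℝ) ≃L[ℝ] (ℝ × ℝ), (L : (ℝ × ℝ) →L[ℝ] (ℝ × ℝ)) =
      (ContinuousLinearMap.snd ℝ ℝ ℝ - ContinuousLinearMap.fst ℝ ℝ ℝ).prod
        ((1 / 2 : ℝ) • (ContinuousLinearMap.fst ℝ ℝ ℝ + ContinuousLinearMap.snd ℝ ℝ ℝ)) :=
    ⟨ContinuousLinearEquiv.equivOfInverse
      ((ContinuousLinearMap.snd ℝ ℝ ℝ - ContinuousLinearMap.fst ℝ ℝ ℝ).prod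
        ((1 / 2 : ℝ) • (ContinuousLinearMap.fst ℝ ℝ ℝ + ContinuousLinearMap.snd ℝ ℝ ℝ)))
      (((-(1 / 2 : ℝ)) • ContinuousLinearMap.fst ℝ ℝ ℝ + ContinuousLinearMap.snd ℝ ℝ ℝ).prod
        ((1 / 2 : ℝ) • ContinuousLinearMap.fst ℝ ℝ ℝ + ContinuousLinearMap.snd ℝ ℝ ℝ))
      (fun p => by ext <;> simp <;> ring) (fun p => by ext <;> simp <;> ring), rfl⟩
  have hΦd : HasFDerivAt Φ (L : (ℝ × ℝ) →L[ℝ] (ℝ × ℝ)) 0 := by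
    rw [hL]; exact hxd.prodMk hyd
  have hΦs : HasStrictFDerivAt Φ (L : (ℝ × ℝ) →L[ℝ] (ℝ × ℝ)) 0 :=
    hΦC.hasStrictFDerivAt' hΦd one_ne_zero
  have hdetL : (L : (ℝ × ℝ) →L[ℝ] (ℝ × ℝ)).det ≠ 0 := by
    have h := L.toLinearEquiv.isUnit_det'
    exact h.ne_zero
  -- the local homeomorphism of the inverse function theorem
  set H := hΦs.toOpenPartialHomeomorph Φ with hH
  have hsrc : H.source ∈ 𝓝 (0 : ℝ × ℝ) :=
    H.open_source.mem_nhds hΦs.mem_toOpenPartialHomeomorph_source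
  -- continuity of the Jacobian determinant at `0`
  have hfd0 : fderiv ℝ Φ 0 = (L : (ℝ × ℝ) →L[ℝ] (ℝ × ℝ)) := hΦd.fderiv
  have hcont : ContinuousAt (fun p => |(fderiv ℝ Φ p).det|) 0 := by
    have h1 : ContDiffAt ℝ 0 (fderiv ℝ Φ) 0 := hΦC.fderiv_right (by norm_num)
    exact continuous_abs.continuousAt.comp
      (ContinuousLinearMap.continuous_det.continuousAt.comp h1.continuousAt)
  set c : ℝ := |(L : (ℝ × ℝ) →L[ℝ] (ℝ × ℝ)).det| / 2 with hc_def
  have hc : 0 < c := by have := abs_pos.2 hdetL; positivity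
  have e3 : ∀ᶠ p in 𝓝 (0 : ℝ × ℝ), c ≤ |(fderiv ℝ Φ p).det| := by
    have hlt : c < |(fderiv ℝ Φ 0).det| := by
      rw [hfd0, hc_def]; have := abs_pos.2 hdetL; linarith
    exact (hcont.eventually (Ioi_mem_nhds hlt)).mono fun p hp => le_of_lt hp
  have e4 : ∀ᶠ p in 𝓝 (0 : ℝ × ℝ), DifferentiableAt ℝ Φ p :=
    (hΦC.eventually (by simp)).mono fun p hp => hp.differentiableAt one_ne_zero
  have e5 : ∀ᶠ p in 𝓝 (0 : ℝ × ℝ), Φ p ∈ Icc (-1 : ℝ) 1 ×ˢ Icc (-1 : ℝ) 1 := by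
    have hΦ0 : Φ 0 = 0 := by simp [hΦ_def, hx0, hy0]
    have hc' : ContinuousAt Φ 0 := hΦC.continuousAt
    have hmem : Icc (-1 : ℝ) 1 ×ˢ Icc (-1 : ℝ) 1 ∈ 𝓝 (Φ 0) := by
      rw [hΦ0]
      exact prod_mem_nhds (Icc_mem_nhds (by norm_num) (by norm_num))
        (Icc_mem_nhds (by norm_num) (by norm_num))
    exact hc' hmem
  have e2 : ∀ᶠ p in 𝓝 (0 : ℝ × ℝ), p ∈ H.source := hsrc
  obtain ⟨r, hr, hball⟩ := Metric.eventually_nhds_iff_ball.1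
    (hνxy.and (e2.and (e3.and (e4.and e5))))
  refine ⟨r, hr, 12 / c, by positivity, fun f₀ ε hε hε2 => ?_⟩
  set A := Metric.ball (0 : ℝ × ℝ) r ∩ {p | |f₀ + ν p| ≤ ε} with hA
  have hAm : MeasurableSet A :=
    measurableSet_ball.inter
      (isClosed_le (continuous_abs.comp (continuous_const.add hν.continuous))
        continuous_const).measurableSet
  have hAball : A ⊆ Metric.ball 0 r := inter_subset_left
  have hinj : InjOn Φ A := by
    have h : InjOn Φ H.source := H.injOn
    exact h.mono fun p hp => (hball p (hAball hp)).2.1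
  have hderiv : ∀ p ∈ A, HasFDerivWithinAt Φ (fderiv ℝ Φ p) A p := fun p hp =>
    ((hball p (hAball hp)).2.2.2.1).hasFDerivAt.hasFDerivWithinAt
  have himage : Φ '' A ⊆
      (Icc (-1 : ℝ) 1 ×ˢ Icc (-1 : ℝ) 1) ∩ {q : ℝ × ℝ | |f₀ + q.1 * q.2| ≤ ε} := by
    rintro _ ⟨p, hp, rfl⟩
    refine ⟨(hball p (hAball hp)).2.2.2.2, ?_⟩
    show |f₀ + x p * y p| ≤ ε
    rw [← (hball p (hAball hp)).1]
    exact hp.2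
  have key : volume A * ENNReal.ofReal c ≤
      ENNReal.ofReal (4 * ε * (1 + Real.log (1 ^ 2 / ε))) := by
    calc volume A * ENNReal.ofReal c = ∫⁻ _ in A, ENNReal.ofReal c := by
          rw [setLIntegral_const, mul_comm]
      _ ≤ ∫⁻ p in A, ENNReal.ofReal |(fderiv ℝ Φ p).det| :=
          setLIntegral_mono' hAm fun p hp => ENNReal.ofReal_le_ofReal (hball p (hAball hp)).2.2.1
      _ = volume (Φ '' A) := lintegral_abs_det_fderiv_eq_addHaar_image volume hAm hderiv hinj
      _ ≤ volume ((Icc (-1 : ℝ) 1 ×ˢ Icc (-1 : ℝ) 1) ∩ {q : ℝ × ℝ | |f₀ + q.1 * q.2| ≤ ε}) :=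
          measure_mono himage
      _ ≤ ENNReal.ofReal (4 * ε * (1 + Real.log (1 ^ 2 / ε))) :=
          volume_hyperbolicModel_le one_pos hε (by linarith) f₀
  have hM : 4 * ε * (1 + Real.log (1 ^ 2 / ε)) / c ≤ 12 / c * ε * |Real.log ε| := by
    rw [div_le_iff₀ hc]
    have h3 := one_add_log_inv_le hε hε2
    have : 12 / c * ε * |Real.log ε| * c = 4 * ε * (3 * |Real.log ε|) := by
      field_simp
      ring
    rw [this]
    exact mul_le_mul_of_nonneg_left h3 (by positivity)
  have hc0 : ENNReal.ofReal c ≠ 0 := (ENNReal.ofReal_pos.2 hc).ne'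
  calc volume A ≤ ENNReal.ofReal (4 * ε * (1 + Real.log (1 ^ 2 / ε))) / ENNReal.ofReal c :=
        (ENNReal.le_div_iff_mul_le (Or.inl hc0) (Or.inl ENNReal.ofReal_ne_top)).2 key
    _ = ENNReal.ofReal (4 * ε * (1 + Real.log (1 ^ 2 / ε)) / c) :=
        (ENNReal.ofReal_div_of_pos hc).symm
    _ ≤ ENNReal.ofReal (12 / c * ε * |Real.log ε|) := ENNReal.ofReal_le_ofReal hM

end Hyperbolic


/-! ### The singular region at an elliptic critical point -/

section Elliptic

variable {ν : ℝ × ℝ → ℝ}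

/-- A weighted interval lemma: if `S ⊆ [0, ∞)` is measurable and `|ρ₂² - ρ₁²| ≤ K` for all
`ρ₁, ρ₂ ∈ S`, then `∫_S ρ dρ ≤ K/2` (the substitution `s = ρ²/2` maps `S` onto a set of diameter
`≤ K/2`). This is the `R`-integration of [II] App. B, p.35 L101–104 ("`2 ∫ dR dα 𝟙(|f₀ + R| ≤ ε)`"),
in the form `R dR` of ordinary polar coordinates. [cite: FeldmanSalmhoferTrubowitz1998, App. B (arXiv p.35 L101–104)] -/
theorem setLIntegral_radial_le_of_sq_sub_sq_le {S : Set ℝ} {K : ℝ} (hS : MeasurableSet S)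
    (hS0 : S ⊆ Ici 0) (hK : ∀ ρ₁ ∈ S, ∀ ρ₂ ∈ S, |ρ₂ ^ 2 - ρ₁ ^ 2| ≤ K) :
    ∫⁻ ρ in S, ENNReal.ofReal ρ ≤ ENNReal.ofReal (K / 2) := by
  -- change of variables `s = ρ²/2`
  have hderiv : ∀ ρ ∈ S, HasDerivWithinAt (fun ρ : ℝ => ρ ^ 2 / 2) ρ S ρ := by
    intro ρ _
    have h0 : HasDerivAt (fun x : ℝ => x ^ 2) (2 * ρ) ρ := by
      have h := hasDerivAt_pow 2 ρ
      norm_num at h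
      exact h
    exact ((h0.div_const 2).hasDerivWithinAt (s := S)).congr_deriv (by ring)
  have hinj : InjOn (fun ρ : ℝ => ρ ^ 2 / 2) S := by
    intro a ha b hb hab
    have hab' : a ^ 2 = b ^ 2 := by
      have := hab; simp only at this; linarith
    exact (pow_left_inj₀ (hS0 ha) (hS0 hb) two_ne_zero).1 hab'
  have hcv := lintegral_image_eq_lintegral_abs_deriv_mul hS hderiv hinj (fun _ => 1)
  simp only [mul_one, lintegral_const, Measure.restrict_apply MeasurableSet.univ, univ_inter,
    one_mul] at hcv
  have habs : ∫⁻ ρ in S, ENNReal.ofReal ρ = ∫⁻ ρ in S, ENNReal.ofReal |ρ| :=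
    setLIntegral_congr_fun hS fun ρ hρ => by rw [abs_of_nonneg (hS0 hρ)]
  rw [habs, ← hcv]
  calc volume ((fun ρ : ℝ => ρ ^ 2 / 2) '' S) ≤ Metric.ediam ((fun ρ : ℝ => ρ ^ 2 / 2) '' S) :=
        Real.volume_le_diam _
    _ ≤ ENNReal.ofReal (K / 2) := by
        refine Metric.ediam_le ?_
        rintro _ ⟨a, ha, rfl⟩ _ ⟨b, hb, rfl⟩
        rw [edist_dist, Real.dist_eq]
        refine ENNReal.ofReal_le_ofReal ?_
        have h := hK b hb a ha
        have : a ^ 2 / 2 - b ^ 2 / 2 = (a ^ 2 - b ^ 2) / 2 := by ring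
        rw [this, abs_div, abs_two]
        linarith

/-- Along a ray: `t ↦ ν (t • v)` has derivative `Dν(t v) v`. [folklore] -/
private theorem hasDerivAt_ray_of_contDiff (hν : ContDiff ℝ 2 ν) (v : ℝ × ℝ) (t : ℝ) :
    HasDerivAt (fun s : ℝ => ν (s • v)) (fderiv ℝ ν (t • v) v) t := by
  have h1 : HasDerivAt (fun s : ℝ => s • v) ((1 : ℝ) • v) t := (hasDerivAt_id t).smul_const v
  rw [one_smul] at h1
  exact ((hν.differentiable (by norm_num)) (t • v)).hasFDerivAt.comp_hasDerivAt t h1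

/-- `Dν(p) v = v₁ ∂₁ν(p) + v₂ ∂₂ν(p)` (linearity of the derivative in the direction). [folklore] -/
private theorem fderiv_apply_eq_coord (p v : ℝ × ℝ) :
    fderiv ℝ ν p v = v.1 * fderiv ℝ ν p ((1 : ℝ), (0 : ℝ)) + v.2 * fderiv ℝ ν p ((0 : ℝ), (1 : ℝ)) := by
  have hv : v = v.1 • ((1 : ℝ), (0 : ℝ)) + v.2 • ((0 : ℝ), (1 : ℝ)) := by ext <;> simp
  conv_lhs => rw [hv]
  simp only [map_add, map_smul, smul_eq_mul]

/-- **[II] App. B, the singular region at an ELLIPTIC critical point** (p.35 L99–104 with the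
elliptic case of Appendix A, p.31 L90–161): if `ν ∈ C²(ℝ²)` has `ν(0) = 0`, `Dν(0) = 0` and
`D²ν(0) = 1`, then there is `r > 0` such that for every level `f₀` and every `ε > 0`,
`vol{φ ∈ B_r(0) : |f₀ + ν(φ)| ≤ ε} ≤ 8π ε`. Proof as printed: in the polar coordinates
`(R, α) = (ν, angle)` the Jacobian is `1 + o(1)` (`morseC2_elliptic_jacobian`); here, equivalently,
in ordinary polar coordinates `(ρ, α)` (Mathlib `lintegral_comp_polarCoord_symm`) the radial
function `ρ ↦ ν(ρ u_α)` has derivative `≥ ρ/2` near `0`, so on each ray the weighted length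
`∫ 𝟙(|f₀ + ν| ≤ ε) ρ dρ` is at most `2 ∫ 𝟙(|f₀ + R| ≤ ε) dR ≤ 4ε`, and the `α`-integration
gives `2π` ("`2 ∫ dR dα 𝟙(|f₀ + R| ≤ ε) ≤ 8π ε`").
[cite: FeldmanSalmhoferTrubowitz1998, App. B (arXiv p.35 L99–104)] -/
theorem morseC2_elliptic_volume_le (hν : ContDiff ℝ 2 ν) (h1 : fderiv ℝ ν 0 = 0)
    (h11 : iteratedFDeriv ℝ 2 ν 0 ![((1 : ℝ), (0 : ℝ)), ((1 : ℝ), (0 : ℝ))] = 1)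
    (h12 : iteratedFDeriv ℝ 2 ν 0 ![((1 : ℝ), (0 : ℝ)), ((0 : ℝ), (1 : ℝ))] = 0)
    (h22 : iteratedFDeriv ℝ 2 ν 0 ![((0 : ℝ), (1 : ℝ)), ((0 : ℝ), (1 : ℝ))] = 1) :
    ∃ r : ℝ, 0 < r ∧ ∀ (f₀ ε : ℝ), 0 < ε →
      volume (Metric.ball (0 : ℝ × ℝ) r ∩ {p | |f₀ + ν p| ≤ ε}) ≤
        ENNReal.ofReal (8 * Real.pi * ε) := by
  -- the Jacobian bound `p·∇ν(p) ≥ |p|²/2` on a punctured neighbourhood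
  have hJ := morseC2_elliptic_jacobian hν h1 h11 h12 h22
  have hhalf : ∀ᶠ p in 𝓝[≠] (0 : ℝ × ℝ), 1 / 2 < (p.1 * fderiv ℝ ν p ((1 : ℝ), (0 : ℝ)) +
      p.2 * fderiv ℝ ν p ((0 : ℝ), (1 : ℝ))) / (p.1 ^ 2 + p.2 ^ 2) :=
    hJ.eventually (Ioi_mem_nhds (by norm_num))
  rw [eventually_nhdsWithin_iff, Metric.eventually_nhds_iff] at hhalf
  obtain ⟨r₀, hr₀, hhalf⟩ := hhalf
  refine ⟨r₀ / 2, by positivity, fun f₀ ε hε => ?_⟩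
  set A := Metric.ball (0 : ℝ × ℝ) (r₀ / 2) ∩ {p | |f₀ + ν p| ≤ ε} with hA
  have hAm : MeasurableSet A :=
    measurableSet_ball.inter
      (isClosed_le (continuous_abs.comp (continuous_const.add hν.continuous))
        continuous_const).measurableSet
  -- radial derivative bound: for `0 < ρ < r₀`, `d/dρ ν(ρ u) ≥ ρ/2`
  have hray : ∀ (θ ρ : ℝ), 0 < ρ → ρ < r₀ →
      ρ / 2 ≤ fderiv ℝ ν (ρ • (Real.cos θ, Real.sin θ)) (Real.cos θ, Real.sin θ) := by
    intro θ ρ hρ hρr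
    set u : ℝ × ℝ := (Real.cos θ, Real.sin θ) with hu
    set p : ℝ × ℝ := ρ • u with hp
    have hp1 : p.1 = ρ * Real.cos θ := by simp [hp, hu]
    have hp2 : p.2 = ρ * Real.sin θ := by simp [hp, hu]
    have hsq : p.1 ^ 2 + p.2 ^ 2 = ρ ^ 2 := by
      rw [hp1, hp2]; nlinarith [Real.cos_sq_add_sin_sq θ]
    have hp0 : p ≠ 0 := by
      intro h
      have : p.1 ^ 2 + p.2 ^ 2 = 0 := by rw [h]; simp
      rw [hsq] at this; exact absurd this (by positivity)
    have hpd : dist p 0 < r₀ := by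
      have hpe : p = (ρ * Real.cos θ, ρ * Real.sin θ) := by simp [hp, hu]
      rw [dist_zero_right, hpe, Prod.norm_def]
      simp only [Real.norm_eq_abs]
      refine max_lt ?_ ?_
      · calc |ρ * Real.cos θ| = ρ * |Real.cos θ| := by rw [abs_mul, abs_of_pos hρ]
          _ ≤ ρ * 1 := mul_le_mul_of_nonneg_left (Real.abs_cos_le_one θ) hρ.le
          _ < r₀ := by linarith
      · calc |ρ * Real.sin θ| = ρ * |Real.sin θ| := by rw [abs_mul, abs_of_pos hρ]
          _ ≤ ρ * 1 := mul_le_mul_of_nonneg_left (Real.abs_sin_le_one θ) hρ.le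
          _ < r₀ := by linarith
    have h := hhalf hpd hp0
    rw [hsq, lt_div_iff₀ (by positivity), ← fderiv_apply_eq_coord] at h
    -- `Dν(p) p = ρ Dν(p) u`
    have hlin : fderiv ℝ ν p p = ρ * fderiv ℝ ν p u := by
      rw [hp, map_smul, smul_eq_mul]
    rw [hlin] at h
    nlinarith
  -- on each ray, two points of `A` have `|ρ₂² - ρ₁²| ≤ 8ε`
  have hpair : ∀ θ : ℝ, ∀ ρ₁ ∈ Ioi (0 : ℝ) ∩ {ρ | ρ • (Real.cos θ, Real.sin θ) ∈ A},
      ∀ ρ₂ ∈ Ioi (0 : ℝ) ∩ {ρ | ρ • (Real.cos θ, Real.sin θ) ∈ A}, |ρ₂ ^ 2 - ρ₁ ^ 2| ≤ 8 * ε := by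
    intro θ
    set u : ℝ × ℝ := (Real.cos θ, Real.sin θ) with hu
    -- the radius of a point of `A` on the ray is `< r₀`
    have hlt : ∀ ρ ∈ Ioi (0 : ℝ) ∩ {ρ | ρ • u ∈ A}, ρ < r₀ := by
      rintro ρ ⟨hρ, hρA⟩
      have hb : ρ • u ∈ Metric.ball (0 : ℝ × ℝ) (r₀ / 2) := hρA.1
      rw [Metric.mem_ball, dist_zero_right, hu, Prod.smul_mk, Prod.norm_def] at hb
      simp only [smul_eq_mul, Real.norm_eq_abs, max_lt_iff] at hb
      have h1 : (ρ * Real.cos θ) ^ 2 < (r₀ / 2) ^ 2 := by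
        have := hb.1; rw [← sq_abs]; have h0 : 0 ≤ |ρ * Real.cos θ| := abs_nonneg _
        nlinarith
      have h2 : (ρ * Real.sin θ) ^ 2 < (r₀ / 2) ^ 2 := by
        have := hb.2; rw [← sq_abs]; have h0 : 0 ≤ |ρ * Real.sin θ| := abs_nonneg _
        nlinarith
      have hsum : ρ ^ 2 < r₀ ^ 2 := by nlinarith [Real.cos_sq_add_sin_sq θ]
      have hρ' : (0 : ℝ) < ρ := hρ
      nlinarith
    -- monotonicity of `ρ ↦ ν(ρ u) - ρ²/4` on `(0, r₀)`
    have hmono : MonotoneOn (fun ρ : ℝ => ν (ρ • u) - ρ ^ 2 / 4) (Icc 0 r₀) := by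
      have hcont : ContinuousOn (fun ρ : ℝ => ν (ρ • u) - ρ ^ 2 / 4) (Icc 0 r₀) := by
        have : Continuous fun ρ : ℝ => ν (ρ • u) - ρ ^ 2 / 4 :=
          (hν.continuous.comp (continuous_id.smul continuous_const)).sub (by fun_prop)
        exact this.continuousOn
      refine monotoneOn_of_hasDerivWithinAt_nonneg (convex_Icc 0 r₀) hcont
        (f' := fun ρ => fderiv ℝ ν (ρ • u) u - ρ / 2) ?_ ?_
      · intro ρ hρ
        rw [interior_Icc] at hρ ⊢
        have h0 : HasDerivAt (fun x : ℝ => x ^ 2) (2 * ρ) ρ := by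
          have h := hasDerivAt_pow 2 ρ
          norm_num at h
          exact h
        exact (((hasDerivAt_ray_of_contDiff hν u ρ).sub (h0.div_const 4)).hasDerivWithinAt
          (s := Ioo 0 r₀)).congr_deriv (by ring)
      · intro ρ hρ
        rw [interior_Icc] at hρ
        have := hray θ ρ hρ.1 hρ.2
        linarith
    -- conclude
    have key : ∀ ρ₁ ∈ Ioi (0 : ℝ) ∩ {ρ | ρ • u ∈ A}, ∀ ρ₂ ∈ Ioi (0 : ℝ) ∩ {ρ | ρ • u ∈ A},
        ρ₁ ≤ ρ₂ → ρ₂ ^ 2 - ρ₁ ^ 2 ≤ 8 * ε := by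
      intro ρ₁ h₁ ρ₂ h₂ h12
      have hρ₁ : (0 : ℝ) < ρ₁ := h₁.1
      have hρ₂ : (0 : ℝ) < ρ₂ := h₂.1
      have hm := hmono ⟨hρ₁.le, (hlt ρ₁ h₁).le⟩ ⟨hρ₂.le, (hlt ρ₂ h₂).le⟩ h12
      simp only at hm
      have e1 : |f₀ + ν (ρ₁ • u)| ≤ ε := h₁.2.2
      have e2 : |f₀ + ν (ρ₂ • u)| ≤ ε := h₂.2.2
      rw [abs_le] at e1 e2
      linarith [e1.1, e1.2, e2.1, e2.2]
    intro ρ₁ h₁ ρ₂ h₂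
    have hρ₁ : (0 : ℝ) < ρ₁ := h₁.1
    have hρ₂ : (0 : ℝ) < ρ₂ := h₂.1
    rcases le_total ρ₁ ρ₂ with h12 | h12
    · rw [abs_of_nonneg (by nlinarith : (0:ℝ) ≤ ρ₂ ^ 2 - ρ₁ ^ 2)]
      exact key ρ₁ h₁ ρ₂ h₂ h12
    · have := key ρ₂ h₂ ρ₁ h₁ h12
      rw [abs_sub_comm, abs_of_nonneg (by nlinarith : (0:ℝ) ≤ ρ₁ ^ 2 - ρ₂ ^ 2)]
      exact this
  -- polar coordinates
  have hsymm : ∀ q : ℝ × ℝ, polarCoord.symm q = q.1 • (Real.cos q.2, Real.sin q.2) := by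
    intro q; rw [polarCoord_symm_apply]; simp [Prod.smul_mk, smul_eq_mul]
  set g : ℝ × ℝ → ℝ≥0∞ := fun q => ENNReal.ofReal q.1 * A.indicator 1 (polarCoord.symm q) with hg
  have hgm : Measurable g :=
    (ENNReal.measurable_ofReal.comp measurable_fst).mul
      ((measurable_one.indicator hAm).comp continuous_polarCoord_symm.measurable)
  have hvol : volume A = ∫⁻ q in polarCoord.target, g q := by
    rw [← lintegral_indicator_one hAm, ← lintegral_comp_polarCoord_symm]
    simp only [hg, smul_eq_mul]
  -- the inner (radial) integral on each ray is `≤ 4ε`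
  have hinner : ∀ θ : ℝ, ∫⁻ ρ in Ioi (0 : ℝ), g (ρ, θ) ≤ ENNReal.ofReal (4 * ε) := by
    intro θ
    set T := {ρ : ℝ | ρ • (Real.cos θ, Real.sin θ) ∈ A} with hT
    have hTm : MeasurableSet T :=
      hAm.preimage (continuous_id.smul continuous_const).measurable
    have hgT : ∀ ρ, g (ρ, θ) = T.indicator (fun ρ => ENNReal.ofReal ρ) ρ := by
      intro ρ
      have hs : polarCoord.symm (ρ, θ) = ρ • (Real.cos θ, Real.sin θ) := by
        rw [hsymm]
      simp only [hg, hs]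
      by_cases hρ : ρ • (Real.cos θ, Real.sin θ) ∈ A
      · rw [indicator_of_mem hρ, indicator_of_mem (show ρ ∈ T from hρ), Pi.one_apply, mul_one]
      · rw [indicator_of_notMem hρ, indicator_of_notMem (show ρ ∉ T from hρ), mul_zero]
    simp_rw [hgT]
    rw [lintegral_indicator hTm, Measure.restrict_restrict hTm]
    have h := setLIntegral_radial_le_of_sq_sub_sq_le (K := 8 * ε) (hTm.inter measurableSet_Ioi)
      (fun ρ hρ => mem_Ici.2 (le_of_lt (mem_Ioi.1 hρ.2)))
      (fun ρ₁ h₁ ρ₂ h₂ => hpair θ ρ₁ ⟨h₁.2, h₁.1⟩ ρ₂ ⟨h₂.2, h₂.1⟩)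
    calc ∫⁻ ρ in T ∩ Ioi 0, ENNReal.ofReal ρ ≤ ENNReal.ofReal (8 * ε / 2) := h
      _ = ENNReal.ofReal (4 * ε) := by congr 1; ring
  rw [hvol, polarCoord_target, Measure.volume_eq_prod, ← Measure.prod_restrict,
    lintegral_prod_symm _ hgm.aemeasurable]
  calc ∫⁻ θ in Ioo (-Real.pi) Real.pi, ∫⁻ ρ in Ioi (0 : ℝ), g (ρ, θ)
      ≤ ∫⁻ _ in Ioo (-Real.pi) Real.pi, ENNReal.ofReal (4 * ε) := lintegral_mono fun θ => hinner θ
    _ = ENNReal.ofReal (4 * ε) * volume (Ioo (-Real.pi) Real.pi) := setLIntegral_const _ _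
    _ = ENNReal.ofReal (8 * Real.pi * ε) := by
        rw [Real.volume_Ioo, ← ENNReal.ofReal_mul (by positivity)]
        congr 1; ring

end Elliptic


/-! ### The regular region: change of variables `θ₁ → η` -/

section Regular

/-- **[II] App. B, the regular region, one slice** (p.33 L88–96: "by a change of variables from
`θ₁` to `η`, `∫ dθ₁ 𝟙(|η| ≤ ε) ≤ (1/δ₁) ∫ dη 𝟙(|η| ≤ ε) ≤ 2ε/δ₁`" on a region where
`|∂η/∂θ₁| ≥ δ₁`): if `g` is continuous on `[a,b]` and differentiable on `(a,b)` with
`g' ≥ δ > 0`, then `vol{t ∈ [a,b] : |f₀ + g(t)| ≤ ε} ≤ 2ε/δ` for every level `f₀`.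
[cite: FeldmanSalmhoferTrubowitz1998, App. B (arXiv p.33 L88–96)] -/
theorem volume_slice_le_of_deriv_ge {g : ℝ → ℝ} {a b δ ε : ℝ} (hδ : 0 < δ)
    (hg : ContinuousOn g (Icc a b)) (hg' : DifferentiableOn ℝ g (Ioo a b))
    (hδg : ∀ t ∈ Ioo a b, δ ≤ deriv g t) (f₀ : ℝ) :
    volume (Icc a b ∩ {t | |f₀ + g t| ≤ ε}) ≤ ENNReal.ofReal (2 * ε / δ) := by
  set S := Icc a b ∩ {t | |f₀ + g t| ≤ ε} with hS
  have hmvt : ∀ x ∈ Icc a b, ∀ y ∈ Icc a b, x ≤ y → δ * (y - x) ≤ g y - g x := by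
    have h := (convex_Icc a b).mul_sub_le_image_sub_of_le_deriv hg
      (by rw [interior_Icc]; exact hg') (C := δ) (by rw [interior_Icc]; exact hδg)
    exact h
  have hdiam : ∀ x ∈ S, ∀ y ∈ S, x ≤ y → y - x ≤ 2 * ε / δ := by
    intro x hx y hy hxy
    have h1 := hmvt x hx.1 y hy.1 hxy
    have h2 : |f₀ + g x| ≤ ε := hx.2
    have h3 : |f₀ + g y| ≤ ε := hy.2
    rw [abs_le] at h2 h3
    rw [le_div_iff₀ hδ]
    nlinarith [h2.1, h2.2, h3.1, h3.2]
  calc volume S ≤ Metric.ediam S := Real.volume_le_diam _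
    _ ≤ ENNReal.ofReal (2 * ε / δ) := by
        refine Metric.ediam_le ?_
        intro x hx y hy
        rw [edist_dist, Real.dist_eq]
        refine ENNReal.ofReal_le_ofReal ?_
        rcases le_total x y with h | h
        · rw [abs_sub_comm, abs_of_nonneg (by linarith)]; exact hdiam x hx y hy h
        · rw [abs_of_nonneg (by linarith)]; exact hdiam y hy x hx h

/-- The same with `g' ≤ -δ < 0`. [cite: FeldmanSalmhoferTrubowitz1998, App. B (arXiv p.33 L88–96)] -/
theorem volume_slice_le_of_deriv_le {g : ℝ → ℝ} {a b δ ε : ℝ} (hδ : 0 < δ)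
    (hg : ContinuousOn g (Icc a b)) (hg' : DifferentiableOn ℝ g (Ioo a b))
    (hδg : ∀ t ∈ Ioo a b, deriv g t ≤ -δ) (f₀ : ℝ) :
    volume (Icc a b ∩ {t | |f₀ + g t| ≤ ε}) ≤ ENNReal.ofReal (2 * ε / δ) := by
  have h := volume_slice_le_of_deriv_ge (g := fun t => -g t) (a := a) (b := b) (ε := ε) hδ hg.neg
    hg'.neg (fun t ht => by
      rw [show (fun t => -g t) = -g from rfl, deriv.neg]
      linarith [hδg t ht]) (-f₀)
  have hset : Icc a b ∩ {t | |-f₀ + -g t| ≤ ε} = Icc a b ∩ {t | |f₀ + g t| ≤ ε} := by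
    ext t
    simp only [mem_inter_iff, mem_setOf_eq]
    rw [show -f₀ + -g t = -(f₀ + g t) by ring, abs_neg]
  rwa [hset] at h

/-- **[II] App. B, the regular region** (p.33 L80–96: on `R₁ = {|∂η/∂θ₁| ≥ δ₁}`,
"`sup_q ∫_{R₁} dθ₁ dθ₂ 𝟙(|η(θ₁,θ₂,q)| ≤ ε) ≤ 2π (1/δ₁) ∫ dη 𝟙(|η| ≤ ε) ≤ 4π ε/δ₁`, the factor
`2π` coming from the `θ₂` integration"), typed for a rectangle `[a,b] × [c,d]` on which
`∂η/∂θ₁ ≥ δ > 0`: `vol{(θ₁,θ₂) ∈ [a,b]×[c,d] : |f₀ + η| ≤ ε} ≤ (d - c) · 2ε/δ`, uniformly in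
the level `f₀` (Fubini and `volume_slice_le_of_deriv_ge`).
[cite: FeldmanSalmhoferTrubowitz1998, App. B (arXiv p.33 L80–96)] -/
theorem volume_rect_le_of_partialDeriv_ge {η : ℝ × ℝ → ℝ} {a b c d δ ε : ℝ} (hδ : 0 < δ)
    (hε : 0 ≤ ε) (hη : Continuous η)
    (hdiff : ∀ θ₂ ∈ Icc c d, DifferentiableOn ℝ (fun θ₁ => η (θ₁, θ₂)) (Ioo a b))
    (hδη : ∀ θ₂ ∈ Icc c d, ∀ θ₁ ∈ Ioo a b, δ ≤ deriv (fun θ₁ => η (θ₁, θ₂)) θ₁) (f₀ : ℝ) :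
    volume ((Icc a b ×ˢ Icc c d) ∩ {p : ℝ × ℝ | |f₀ + η p| ≤ ε}) ≤
      ENNReal.ofReal ((d - c) * (2 * ε / δ)) := by
  set V := (Icc a b ×ˢ Icc c d) ∩ {p : ℝ × ℝ | |f₀ + η p| ≤ ε} with hV
  have hVm : MeasurableSet V :=
    (measurableSet_Icc.prod measurableSet_Icc).inter
      (isClosed_le (continuous_abs.comp (continuous_const.add hη)) continuous_const).measurableSet
  rw [Measure.volume_eq_prod, Measure.prod_apply_symm hVm]
  have hsec : ∀ y, volume ((fun x : ℝ => (x, y)) ⁻¹' V) ≤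
      (Icc c d).indicator (fun _ => ENNReal.ofReal (2 * ε / δ)) y := by
    intro y
    by_cases hy : y ∈ Icc c d
    · rw [indicator_of_mem hy]
      have hset : (fun x : ℝ => (x, y)) ⁻¹' V = Icc a b ∩ {t | |f₀ + η (t, y)| ≤ ε} := by
        ext t
        simp only [hV, mem_preimage, mem_inter_iff, mem_prod, mem_setOf_eq]
        tauto
      rw [hset]
      exact volume_slice_le_of_deriv_ge hδ
        ((hη.comp (continuous_id.prodMk continuous_const)).continuousOn) (hdiff y hy) (hδη y hy) f₀
    · rw [indicator_of_notMem hy]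
      have hset : (fun x : ℝ => (x, y)) ⁻¹' V = ∅ := by
        ext t
        simp only [hV, mem_preimage, mem_inter_iff, mem_prod, mem_setOf_eq, mem_empty_iff_false,
          iff_false, not_and]
        exact fun h _ => absurd h.2 hy
      rw [hset, measure_empty]
  calc ∫⁻ y, volume ((fun x : ℝ => (x, y)) ⁻¹' V)
      ≤ ∫⁻ y, (Icc c d).indicator (fun _ => ENNReal.ofReal (2 * ε / δ)) y := lintegral_mono hsec
    _ = ∫⁻ _ in Icc c d, ENNReal.ofReal (2 * ε / δ) := lintegral_indicator measurableSet_Icc _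
    _ = ENNReal.ofReal (2 * ε / δ) * volume (Icc c d) := setLIntegral_const _ _
    _ = ENNReal.ofReal ((d - c) * (2 * ε / δ)) := by
        rw [Real.volume_Icc, ← ENNReal.ofReal_mul (by positivity), mul_comm]

end Regular


/-! ### General base point and critical value -/

section BasePoint

variable {ν : ℝ × ℝ → ℝ}

/-- Recentring: the `2`-jet of `p ↦ ν(p + p₀) - ν(p₀)` at `0` is that of `ν` at `p₀`, and the
sub-level bands translate. [folklore] -/
private theorem recentre_jet (hν : ContDiff ℝ 2 ν) (p₀ : ℝ × ℝ) :
    ContDiff ℝ 2 (fun p => ν (p + p₀) - ν p₀) ∧ (fun p => ν (p + p₀) - ν p₀) 0 = 0 ∧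
      fderiv ℝ (fun p => ν (p + p₀) - ν p₀) 0 = fderiv ℝ ν p₀ ∧
      iteratedFDeriv ℝ 2 (fun p => ν (p + p₀) - ν p₀) 0 = iteratedFDeriv ℝ 2 ν p₀ := by
  have hsh : ContDiff ℝ 2 fun p : ℝ × ℝ => ν (p + p₀) := hν.comp (contDiff_id.add contDiff_const)
  refine ⟨hsh.sub contDiff_const, by simp, ?_, ?_⟩
  · rw [fderiv_sub_const, fderiv_comp_add_right, zero_add]
  · have heq : (fun p => ν (p + p₀) - ν p₀) = (fun p => ν (p + p₀)) + fun _ => -ν p₀ := by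
      funext p; simp [sub_eq_add_neg]
    rw [heq, iteratedFDeriv_add_apply hsh.contDiffAt contDiffAt_const,
      iteratedFDeriv_const_of_ne two_ne_zero, iteratedFDeriv_comp_add_right, zero_add]
    simp

/-- Translating the sub-level band: `vol{p ∈ B_r(p₀) : |f₀ + ν p| ≤ ε}
= vol{p ∈ B_r(0) : |(f₀ + ν p₀) + (ν(p + p₀) - ν p₀)| ≤ ε}`. [folklore] -/
private theorem volume_band_recentre (ν : ℝ × ℝ → ℝ) (p₀ : ℝ × ℝ) (r f₀ ε : ℝ) :
    volume (Metric.ball p₀ r ∩ {p | |f₀ + ν p| ≤ ε}) =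
      volume (Metric.ball (0 : ℝ × ℝ) r ∩ {p | |(f₀ + ν p₀) + (ν (p + p₀) - ν p₀)| ≤ ε}) := by
  rw [← measure_preimage_add_right volume p₀ (Metric.ball p₀ r ∩ {p | |f₀ + ν p| ≤ ε})]
  congr 1
  ext p
  simp only [mem_preimage, mem_inter_iff, Metric.mem_ball, mem_setOf_eq, dist_eq_norm,
    add_sub_cancel_right, sub_zero]
  constructor
  · rintro ⟨h1, h2⟩; exact ⟨h1, by ring_nf; ring_nf at h2; exact h2⟩
  · rintro ⟨h1, h2⟩; exact ⟨h1, by ring_nf; ring_nf at h2; exact h2⟩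

/-- **The hyperbolic singular-region bound at a general critical point** (the form App. B uses,
p.35 L47–60: `f₀ = η(ϑ^{cr})`, `ν = η(·) - η(ϑ^{cr})` after the normalisation of `D₀`): if
`ν ∈ C²(ℝ²)`, `Dν(p₀) = 0` and `D²ν(p₀) = diag(-1, 1)`, then for some `r > 0`, `C ≥ 0` and all
levels `f₀` and `0 < ε ≤ 1/2`, `vol{p ∈ B_r(p₀) : |f₀ + ν(p)| ≤ ε} ≤ C ε |log ε|` — no
hypothesis on the critical VALUE `ν(p₀)`. [cite: FeldmanSalmhoferTrubowitz1998, App. B (arXiv p.35 L47–112)] -/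
theorem morseC2_hyperbolic_volume_le_at (hν : ContDiff ℝ 2 ν) (p₀ : ℝ × ℝ)
    (h1 : fderiv ℝ ν p₀ = 0)
    (h11 : iteratedFDeriv ℝ 2 ν p₀ ![((1 : ℝ), (0 : ℝ)), ((1 : ℝ), (0 : ℝ))] = -1)
    (h12 : iteratedFDeriv ℝ 2 ν p₀ ![((1 : ℝ), (0 : ℝ)), ((0 : ℝ), (1 : ℝ))] = 0)
    (h22 : iteratedFDeriv ℝ 2 ν p₀ ![((0 : ℝ), (1 : ℝ)), ((0 : ℝ), (1 : ℝ))] = 1) :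
    ∃ r : ℝ, 0 < r ∧ ∃ C : ℝ, 0 ≤ C ∧ ∀ (f₀ ε : ℝ), 0 < ε → ε ≤ 1 / 2 →
      volume (Metric.ball p₀ r ∩ {p | |f₀ + ν p| ≤ ε}) ≤
        ENNReal.ofReal (C * ε * |Real.log ε|) := by
  obtain ⟨hC, h0', h1', h2'⟩ := recentre_jet hν p₀
  rw [h1] at h1'
  obtain ⟨r, hr, C, hC0, hmain⟩ := morseC2_hyperbolic_volume_le hC h0' h1'
    (by rw [h2']; exact h11) (by rw [h2']; exact h12) (by rw [h2']; exact h22)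
  refine ⟨r, hr, C, hC0, fun f₀ ε hε hε2 => ?_⟩
  rw [volume_band_recentre]
  exact hmain (f₀ + ν p₀) ε hε hε2

/-- **The elliptic singular-region bound at a general critical point**: if `ν ∈ C²(ℝ²)`,
`Dν(p₀) = 0` and `D²ν(p₀) = 1`, then for some `r > 0` and all levels `f₀` and `ε > 0`,
`vol{p ∈ B_r(p₀) : |f₀ + ν(p)| ≤ ε} ≤ 8π ε`. [cite: FeldmanSalmhoferTrubowitz1998, App. B (arXiv p.35 L99–104)] -/
theorem morseC2_elliptic_volume_le_at (hν : ContDiff ℝ 2 ν) (p₀ : ℝ × ℝ)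
    (h1 : fderiv ℝ ν p₀ = 0)
    (h11 : iteratedFDeriv ℝ 2 ν p₀ ![((1 : ℝ), (0 : ℝ)), ((1 : ℝ), (0 : ℝ))] = 1)
    (h12 : iteratedFDeriv ℝ 2 ν p₀ ![((1 : ℝ), (0 : ℝ)), ((0 : ℝ), (1 : ℝ))] = 0)
    (h22 : iteratedFDeriv ℝ 2 ν p₀ ![((0 : ℝ), (1 : ℝ)), ((0 : ℝ), (1 : ℝ))] = 1) :
    ∃ r : ℝ, 0 < r ∧ ∀ (f₀ ε : ℝ), 0 < ε →
      volume (Metric.ball p₀ r ∩ {p | |f₀ + ν p| ≤ ε}) ≤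
        ENNReal.ofReal (8 * Real.pi * ε) := by
  obtain ⟨hC, -, h1', h2'⟩ := recentre_jet hν p₀
  rw [h1] at h1'
  obtain ⟨r, hr, hmain⟩ := morseC2_elliptic_volume_le hC h1'
    (by rw [h2']; exact h11) (by rw [h2']; exact h12) (by rw [h2']; exact h22)
  refine ⟨r, hr, fun f₀ ε hε => ?_⟩
  rw [volume_band_recentre]
  exact hmain (f₀ + ν p₀) ε hε

end BasePoint


/-! ### Arbitrary non-degenerate critical points: the linear normalisation of App. B -/

section Nondegenerate

variable {ν : ℝ × ℝ → ℝ}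

/-- Explicit `2 × 2` matrices with non-zero determinant as continuous linear automorphisms of
`ℝ × ℝ`. [folklore] -/
private theorem exists_equiv_of_matrix (m₁₁ m₁₂ m₂₁ m₂₂ : ℝ) (hdet : m₁₁ * m₂₂ - m₁₂ * m₂₁ ≠ 0) :
    ∃ M : (ℝ × ℝ) ≃L[ℝ] (ℝ × ℝ), ∀ p : ℝ × ℝ,
      M p = (m₁₁ * p.1 + m₁₂ * p.2, m₂₁ * p.1 + m₂₂ * p.2) := by
  set D := m₁₁ * m₂₂ - m₁₂ * m₂₁ with hD
  refine ⟨ContinuousLinearEquiv.equivOfInverse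
    ((m₁₁ • ContinuousLinearMap.fst ℝ ℝ ℝ + m₁₂ • ContinuousLinearMap.snd ℝ ℝ ℝ).prod
      (m₂₁ • ContinuousLinearMap.fst ℝ ℝ ℝ + m₂₂ • ContinuousLinearMap.snd ℝ ℝ ℝ))
    (((m₂₂ / D) • ContinuousLinearMap.fst ℝ ℝ ℝ + (-m₁₂ / D) • ContinuousLinearMap.snd ℝ ℝ ℝ).prod
      ((-m₂₁ / D) • ContinuousLinearMap.fst ℝ ℝ ℝ + (m₁₁ / D) • ContinuousLinearMap.snd ℝ ℝ ℝ))
    (fun p => ?_) (fun p => ?_), fun p => ?_⟩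
  · ext <;> simp <;> field_simp <;> ring
  · ext <;> simp <;> field_simp <;> ring
  · simp

/-- Swapping the two new coordinates. [folklore] -/
private theorem normalForm_swap {a b c s₁ s₂ : ℝ} {M : (ℝ × ℝ) ≃L[ℝ] (ℝ × ℝ)}
    (hQ : ∀ v w : ℝ × ℝ, a * (M v).1 * (M w).1 + b * (M v).1 * (M w).2 + b * (M v).2 * (M w).1 +
      c * (M v).2 * (M w).2 = s₁ * v.1 * w.1 + s₂ * v.2 * w.2) :
    ∃ M' : (ℝ × ℝ) ≃L[ℝ] (ℝ × ℝ), ∀ v w : ℝ × ℝ,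
      a * (M' v).1 * (M' w).1 + b * (M' v).1 * (M' w).2 + b * (M' v).2 * (M' w).1 +
        c * (M' v).2 * (M' w).2 = s₂ * v.1 * w.1 + s₁ * v.2 * w.2 := by
  obtain ⟨S, hS⟩ := exists_equiv_of_matrix 0 1 1 0 (by norm_num)
  refine ⟨S.trans M, fun v w => ?_⟩
  have hv : (S.trans M) v = M (v.2, v.1) := by
    rw [ContinuousLinearEquiv.trans_apply, hS]; simp
  have hw : (S.trans M) w = M (w.2, w.1) := by
    rw [ContinuousLinearEquiv.trans_apply, hS]; simp
  rw [hv, hw, hQ (v.2, v.1) (w.2, w.1)]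
  ring

/-- Sylvester normal form, case `a ≠ 0` (complete the square and rescale). [folklore] -/
private theorem normalForm_caseA (a b c : ℝ) (ha : a ≠ 0) (hdet : a * c - b ^ 2 ≠ 0) :
    ∃ (M : (ℝ × ℝ) ≃L[ℝ] (ℝ × ℝ)) (s₁ s₂ : ℝ), (s₁ = 1 ∨ s₁ = -1) ∧ (s₂ = 1 ∨ s₂ = -1) ∧
      ∀ v w : ℝ × ℝ, a * (M v).1 * (M w).1 + b * (M v).1 * (M w).2 + b * (M v).2 * (M w).1 +
        c * (M v).2 * (M w).2 = s₁ * v.1 * w.1 + s₂ * v.2 * w.2 := by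
  set d := a * c - b ^ 2 with hd
  set α := Real.sqrt |a| with hα
  set δ := Real.sqrt |d| with hδ
  have hα0 : 0 < α := Real.sqrt_pos.2 (abs_pos.2 ha)
  have hδ0 : 0 < δ := Real.sqrt_pos.2 (abs_pos.2 hdet)
  have hα2 : α ^ 2 = |a| := Real.sq_sqrt (abs_nonneg a)
  have hδ2 : δ ^ 2 = |d| := Real.sq_sqrt (abs_nonneg d)
  -- `M (t₁, t₂) = (t₁/α - (b/a)(α/δ) t₂, (α/δ) t₂)`
  obtain ⟨M, hM⟩ := exists_equiv_of_matrix (1 / α) (-(b / a) * (α / δ)) 0 (α / δ)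
    (by rw [mul_zero, sub_zero]; positivity)
  refine ⟨M, a / α ^ 2, α ^ 2 * d / (a * δ ^ 2), ?_, ?_, fun v w => ?_⟩
  · rw [hα2]
    rcases lt_or_gt_of_ne ha with h | h
    · right; rw [abs_of_neg h]; field_simp
    · left; rw [abs_of_pos h]; field_simp
  · rw [hα2, hδ2]
    rcases lt_or_gt_of_ne ha with h | h <;> rcases lt_or_gt_of_ne hdet with h' | h'
    · left; rw [abs_of_neg h, abs_of_neg h']; field_simp
    · right; rw [abs_of_neg h, abs_of_pos h']; field_simp
    · right; rw [abs_of_pos h, abs_of_neg h']; field_simp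
    · left; rw [abs_of_pos h, abs_of_pos h']; field_simp
  · rw [hM v, hM w]
    simp only
    field_simp
    ring

/-- **Sylvester normal form in the shape App. B uses** (p.35 L47–80: "rotate `D₀` to
`diag(d₁, d₂)`, rescale by `|dᵢ|^{½}`; then `∂₁²ν(0,0) = ±1`, `∂₂²ν(0,0) = ±1`, and because of
the absolute value we may assume `∂₁²ν = 1`" — we normalise instead to the sign patterns the two
Morse theorems of `FST2MorseLemma` expect, `diag(-1,1)` or `±diag(1,1)`): for a symmetric
non-degenerate `2 × 2` form `(a, b; b, c)` there is a linear change of variables `M` with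
`Q(Mv, Mw) = s₁ v₁w₁ + s₂ v₂w₂`, `(s₁, s₂) ∈ {(-1,1), (1,1), (-1,-1)}`. [folklore] -/
private theorem exists_normalForm (a b c : ℝ) (hdet : a * c - b ^ 2 ≠ 0) :
    ∃ (M : (ℝ × ℝ) ≃L[ℝ] (ℝ × ℝ)) (s₁ s₂ : ℝ),
      ((s₁ = -1 ∧ s₂ = 1) ∨ (s₁ = 1 ∧ s₂ = 1) ∨ (s₁ = -1 ∧ s₂ = -1)) ∧
      ∀ v w : ℝ × ℝ, a * (M v).1 * (M w).1 + b * (M v).1 * (M w).2 + b * (M v).2 * (M w).1 +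
        c * (M v).2 * (M w).2 = s₁ * v.1 * w.1 + s₂ * v.2 * w.2 := by
  -- first a normal form with an arbitrary sign pattern
  have step : ∃ (M : (ℝ × ℝ) ≃L[ℝ] (ℝ × ℝ)) (s₁ s₂ : ℝ), (s₁ = 1 ∨ s₁ = -1) ∧ (s₂ = 1 ∨ s₂ = -1) ∧
      ∀ v w : ℝ × ℝ, a * (M v).1 * (M w).1 + b * (M v).1 * (M w).2 + b * (M v).2 * (M w).1 +
        c * (M v).2 * (M w).2 = s₁ * v.1 * w.1 + s₂ * v.2 * w.2 := by
    rcases ne_or_eq a 0 with ha | ha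
    · exact normalForm_caseA a b c ha hdet
    rcases ne_or_eq c 0 with hc | hc
    · -- swap the roles of the coordinates: the form `(c, b; b, a)`
      obtain ⟨M₀, s₁, s₂, hs₁, hs₂, hQ⟩ := normalForm_caseA c b a hc (by rw [mul_comm]; exact hdet)
      obtain ⟨S, hS⟩ := exists_equiv_of_matrix 0 1 1 0 (by norm_num)
      refine ⟨M₀.trans S, s₁, s₂, hs₁, hs₂, fun v w => ?_⟩
      have hv : (M₀.trans S) v = ((M₀ v).2, (M₀ v).1) := by
        rw [ContinuousLinearEquiv.trans_apply, hS]; simp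
      have hw : (M₀.trans S) w = ((M₀ w).2, (M₀ w).1) := by
        rw [ContinuousLinearEquiv.trans_apply, hS]; simp
      rw [hv, hw, ← hQ v w]
      simp only
      ring
    · have hb : b ≠ 0 := by
        intro hb; apply hdet; rw [ha, hc, hb]; ring
      set μ := Real.sqrt (2 * |b|) with hμ
      have hμ0 : 0 < μ := Real.sqrt_pos.2 (by positivity)
      have hμ2 : μ ^ 2 = 2 * |b| := Real.sq_sqrt (by positivity)
      obtain ⟨M, hM⟩ := exists_equiv_of_matrix (1 / μ) (1 / μ) (1 / μ) (-(1 / μ))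
        (by
          rw [show (1 / μ) * (-(1 / μ)) - (1 / μ) * (1 / μ) = -2 / μ ^ 2 by ring]
          exact div_ne_zero (by norm_num) (by positivity))
      refine ⟨M, 2 * b / μ ^ 2, -(2 * b / μ ^ 2), ?_, ?_, fun v w => ?_⟩
      · rw [hμ2]
        rcases lt_or_gt_of_ne hb with h | h
        · right; rw [abs_of_neg h]; field_simp
        · left; rw [abs_of_pos h]; field_simp
      · rw [hμ2]
        rcases lt_or_gt_of_ne hb with h | h
        · left; rw [abs_of_neg h]; field_simp
        · right; rw [abs_of_pos h]; field_simp
      · rw [hM v, hM w, ha, hc]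
        simp only
        field_simp
        ring
  obtain ⟨M, s₁, s₂, hs₁, hs₂, hQ⟩ := step
  by_cases hbad : s₁ = 1 ∧ s₂ = -1
  · obtain ⟨M', hQ'⟩ := normalForm_swap hQ
    exact ⟨M', s₂, s₁, Or.inl ⟨hbad.2, hbad.1⟩, hQ'⟩
  · refine ⟨M, s₁, s₂, ?_, hQ⟩
    rcases hs₁ with h1 | h1 <;> rcases hs₂ with h2 | h2
    · exact Or.inr (Or.inl ⟨h1, h2⟩)
    · exact absurd ⟨h1, h2⟩ hbad
    · exact Or.inl ⟨h1, h2⟩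
    · exact Or.inr (Or.inr ⟨h1, h2⟩)

/-- A bilinear map on `ℝ × ℝ` in coordinates. [folklore] -/
private theorem bilin_apply_coord (B : ℝ × ℝ →L[ℝ] ℝ × ℝ →L[ℝ] ℝ) (u w : ℝ × ℝ) :
    B u w = u.1 * w.1 * B (1, 0) (1, 0) + u.1 * w.2 * B (1, 0) (0, 1)
      + u.2 * w.1 * B (0, 1) (1, 0) + u.2 * w.2 * B (0, 1) (0, 1) := by
  have hu : u = u.1 • ((1 : ℝ), (0 : ℝ)) + u.2 • ((0 : ℝ), (1 : ℝ)) := by ext <;> simp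
  have hw : w = w.1 • ((1 : ℝ), (0 : ℝ)) + w.2 • ((0 : ℝ), (1 : ℝ)) := by ext <;> simp
  conv_lhs => rw [hu, hw]
  simp only [map_add, map_smul, add_apply, smul_apply, smul_eq_mul]
  ring

/-- The Hessian of `ν ∘ M` at `0` for a linear `M` with respect to the Hessian entries of `ν`
at `0`. [folklore] -/
private theorem hess_comp_linear (hν : ContDiff ℝ 2 ν) (M : (ℝ × ℝ) →L[ℝ] (ℝ × ℝ)) (v w : ℝ × ℝ) :
    iteratedFDeriv ℝ 2 (ν ∘ M) 0 ![v, w] =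
      iteratedFDeriv ℝ 2 ν 0 ![((1 : ℝ), (0 : ℝ)), ((1 : ℝ), (0 : ℝ))] * (M v).1 * (M w).1 +
      iteratedFDeriv ℝ 2 ν 0 ![((1 : ℝ), (0 : ℝ)), ((0 : ℝ), (1 : ℝ))] * (M v).1 * (M w).2 +
      iteratedFDeriv ℝ 2 ν 0 ![((1 : ℝ), (0 : ℝ)), ((0 : ℝ), (1 : ℝ))] * (M v).2 * (M w).1 +
      iteratedFDeriv ℝ 2 ν 0 ![((0 : ℝ), (1 : ℝ)), ((0 : ℝ), (1 : ℝ))] * (M v).2 * (M w).2 := by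
  rw [M.iteratedFDeriv_comp_right hν 0 (by norm_cast), ContinuousMultilinearMap.compContinuousLinearMap_apply,
    map_zero]
  have hsymm : IsSymmSndFDerivAt ℝ ν 0 := hν.contDiffAt.isSymmSndFDerivAt (by simp)
  have h21 : fderiv ℝ (fderiv ℝ ν) 0 ((0 : ℝ), (1 : ℝ)) ((1 : ℝ), (0 : ℝ)) =
      fderiv ℝ (fderiv ℝ ν) 0 ((1 : ℝ), (0 : ℝ)) ((0 : ℝ), (1 : ℝ)) := hsymm _ _
  simp only [iteratedFDeriv_two_apply, Matrix.cons_val_zero, Matrix.cons_val_one]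
  rw [bilin_apply_coord (fderiv ℝ (fderiv ℝ ν) 0) (M v) (M w), h21]
  ring

/-- Transfer of sub-level band volumes under a linear change of variables. [folklore] -/
private theorem volume_band_le_of_equiv (ν : ℝ × ℝ → ℝ) (M : (ℝ × ℝ) ≃L[ℝ] (ℝ × ℝ)) {r : ℝ}
    (hr : 0 < r) :
    ∃ r' : ℝ, 0 < r' ∧ ∀ f₀ ε : ℝ,
      volume (Metric.ball (0 : ℝ × ℝ) r' ∩ {p | |f₀ + ν p| ≤ ε}) ≤
        ENNReal.ofReal |LinearMap.det (M : (ℝ × ℝ) →ₗ[ℝ] (ℝ × ℝ))| *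
          volume (Metric.ball (0 : ℝ × ℝ) r ∩ {p | |f₀ + ν (M p)| ≤ ε}) := by
  set K := ‖(M.symm : (ℝ × ℝ) →L[ℝ] (ℝ × ℝ))‖ with hK
  have hK0 : 0 ≤ K := norm_nonneg _
  refine ⟨r / (K + 1), by positivity, fun f₀ ε => ?_⟩
  have hsub : Metric.ball (0 : ℝ × ℝ) (r / (K + 1)) ∩ {p | |f₀ + ν p| ≤ ε} ⊆
      M '' (Metric.ball (0 : ℝ × ℝ) r ∩ {p | |f₀ + ν (M p)| ≤ ε}) := by
    rintro p ⟨hp, hpε⟩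
    refine ⟨M.symm p, ⟨?_, ?_⟩, M.apply_symm_apply p⟩
    · rw [Metric.mem_ball, dist_zero_right] at hp ⊢
      have h1 : ‖M.symm p‖ ≤ K * ‖p‖ := (M.symm : (ℝ × ℝ) →L[ℝ] (ℝ × ℝ)).le_opNorm p
      have h2 : K * ‖p‖ ≤ K * (r / (K + 1)) := mul_le_mul_of_nonneg_left hp.le hK0
      have h3 : K * (r / (K + 1)) < r := by
        rw [mul_div_assoc', div_lt_iff₀ (by positivity)]; nlinarith
      linarith
    · show |f₀ + ν (M (M.symm p))| ≤ ε
      rw [M.apply_symm_apply]; exact hpε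
  calc volume (Metric.ball (0 : ℝ × ℝ) (r / (K + 1)) ∩ {p | |f₀ + ν p| ≤ ε})
      ≤ volume (M '' (Metric.ball (0 : ℝ × ℝ) r ∩ {p | |f₀ + ν (M p)| ≤ ε})) := measure_mono hsub
    _ = _ := Measure.addHaar_image_continuousLinearEquiv volume M _

/-- For `0 < ε ≤ 1/2`, a bound `C ε` is also a bound `2C ε |log ε|`. [folklore] -/
private theorem eps_le_two_mul_eps_abs_log {ε : ℝ} (hε : 0 < ε) (hε2 : ε ≤ 1 / 2) :
    ε ≤ 2 * ε * |Real.log ε| := by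
  have hlog : Real.log ε < 0 := Real.log_neg hε (by linarith)
  have hlog2 : Real.log ε ≤ Real.log (1 / 2) := Real.log_le_log hε hε2
  have hhalf : Real.log (1 / 2) < -(1 / 2) := by
    have h2 : Real.log 2 > 1 / 2 := by
      have := Real.log_two_gt_d9; linarith
    rw [one_div, Real.log_inv]; linarith
  rw [abs_of_neg hlog]
  nlinarith

/-- **[II] App. B, the singular region at an ARBITRARY non-degenerate critical point** (p.34
L60–p.35 L112: "`η` is `C²`, so `D` is continuous … `|det D₀(q)| ≥ ⅜ w₀²` … rotate … rescale …
`ν(0,0) = 0`, `∂ᵢν(0,0) = 0`, `∂₁∂₂ν(0,0) = 0`, `∂ᵢ²ν(0,0) = ±1` … if `∂₂²ν = 1`, by Theorem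
[A, elliptic] … `≤ 8π ε`; if `∂₂²ν = -1`, by Theorem [A.2] … `≤ Const ε |log ε|`"), as ONE
statement: if `ν ∈ C²(ℝ²)`, `Dν(p₀) = 0` and the Hessian of `ν` at `p₀` is non-degenerate
(`∂₁²ν ∂₂²ν - (∂₁∂₂ν)² ≠ 0`), then there are `r > 0`, `C ≥ 0` with
`vol{p ∈ B_r(p₀) : |f₀ + ν(p)| ≤ ε} ≤ C ε |log ε|` for all levels `f₀` and all `0 < ε ≤ ½`.
The linear normalisation (`exists_normalForm`, Jacobian via
`Measure.addHaar_image_continuousLinearEquiv`) reduces to `morseC2_hyperbolic_volume_le`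
(`diag(-1,1)`) or `morseC2_elliptic_volume_le` (`±diag(1,1)`, where `8π ε ≤ 16π ε|log ε|`).
[cite: FeldmanSalmhoferTrubowitz1998, App. B (arXiv p.34 L60–p.35 L112)] -/
theorem morseC2_nondegenerate_volume_le_at (hν : ContDiff ℝ 2 ν) (p₀ : ℝ × ℝ)
    (h1 : fderiv ℝ ν p₀ = 0)
    (hdet : iteratedFDeriv ℝ 2 ν p₀ ![((1 : ℝ), (0 : ℝ)), ((1 : ℝ), (0 : ℝ))] *
        iteratedFDeriv ℝ 2 ν p₀ ![((0 : ℝ), (1 : ℝ)), ((0 : ℝ), (1 : ℝ))] -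
      iteratedFDeriv ℝ 2 ν p₀ ![((1 : ℝ), (0 : ℝ)), ((0 : ℝ), (1 : ℝ))] ^ 2 ≠ 0) :
    ∃ r : ℝ, 0 < r ∧ ∃ C : ℝ, 0 ≤ C ∧ ∀ (f₀ ε : ℝ), 0 < ε → ε ≤ 1 / 2 →
      volume (Metric.ball p₀ r ∩ {p | |f₀ + ν p| ≤ ε}) ≤
        ENNReal.ofReal (C * ε * |Real.log ε|) := by
  -- recentre at `0`
  obtain ⟨hμC, hμ0, hμ1, hμ2⟩ := recentre_jet hν p₀
  set μ' : ℝ × ℝ → ℝ := fun p => ν (p + p₀) - ν p₀ with hμ'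
  rw [h1] at hμ1
  set a := iteratedFDeriv ℝ 2 ν p₀ ![((1 : ℝ), (0 : ℝ)), ((1 : ℝ), (0 : ℝ))] with ha
  set b := iteratedFDeriv ℝ 2 ν p₀ ![((1 : ℝ), (0 : ℝ)), ((0 : ℝ), (1 : ℝ))] with hb
  set c := iteratedFDeriv ℝ 2 ν p₀ ![((0 : ℝ), (1 : ℝ)), ((0 : ℝ), (1 : ℝ))] with hc
  -- the linear normalisation
  obtain ⟨M, s₁, s₂, hpat, hQ⟩ := exists_normalForm a b c hdet
  set ν' : ℝ × ℝ → ℝ := μ' ∘ ⇑(M : (ℝ × ℝ) →L[ℝ] (ℝ × ℝ)) with hν'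
  have hν'C : ContDiff ℝ 2 ν' := hμC.comp (M : (ℝ × ℝ) →L[ℝ] (ℝ × ℝ)).contDiff
  have hν'0 : ν' 0 = 0 := by simp [hν', hμ0]
  have hν'1 : fderiv ℝ ν' 0 = 0 := by
    have h := ((hμC.differentiable (by norm_num)) ((M : (ℝ × ℝ) →L[ℝ] (ℝ × ℝ)) 0)).hasFDerivAt.comp
      (0 : ℝ × ℝ) (M : (ℝ × ℝ) →L[ℝ] (ℝ × ℝ)).hasFDerivAt
    rw [map_zero, hμ1, ContinuousLinearMap.zero_comp] at h
    exact h.fderiv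
  have hν'2 : ∀ v w : ℝ × ℝ, iteratedFDeriv ℝ 2 ν' 0 ![v, w] = s₁ * v.1 * w.1 + s₂ * v.2 * w.2 := by
    intro v w
    rw [hν', hess_comp_linear hμC (M : (ℝ × ℝ) →L[ℝ] (ℝ × ℝ)) v w, hμ2, ← hQ v w]
    rfl
  have e11 : iteratedFDeriv ℝ 2 ν' 0 ![((1 : ℝ), (0 : ℝ)), ((1 : ℝ), (0 : ℝ))] = s₁ := by
    rw [hν'2]; simp
  have e12 : iteratedFDeriv ℝ 2 ν' 0 ![((1 : ℝ), (0 : ℝ)), ((0 : ℝ), (1 : ℝ))] = 0 := by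
    rw [hν'2]; simp
  have e22 : iteratedFDeriv ℝ 2 ν' 0 ![((0 : ℝ), (1 : ℝ)), ((0 : ℝ), (1 : ℝ))] = s₂ := by
    rw [hν'2]; simp
  -- the bound for `ν'` on a ball around `0`
  have hbound : ∃ r : ℝ, 0 < r ∧ ∃ C : ℝ, 0 ≤ C ∧ ∀ (f₀ ε : ℝ), 0 < ε → ε ≤ 1 / 2 →
      volume (Metric.ball (0 : ℝ × ℝ) r ∩ {p | |f₀ + ν' p| ≤ ε}) ≤
        ENNReal.ofReal (C * ε * |Real.log ε|) := by
    rcases hpat with ⟨hs1, hs2⟩ | ⟨hs1, hs2⟩ | ⟨hs1, hs2⟩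
    · -- hyperbolic
      exact morseC2_hyperbolic_volume_le hν'C hν'0 hν'1 (by rw [e11, hs1]) e12 (by rw [e22, hs2])
    · -- elliptic
      obtain ⟨r, hr, hmain⟩ :=
        morseC2_elliptic_volume_le hν'C hν'1 (by rw [e11, hs1]) e12 (by rw [e22, hs2])
      refine ⟨r, hr, 16 * Real.pi, by positivity, fun f₀ ε hε hε2 => (hmain f₀ ε hε).trans ?_⟩
      refine ENNReal.ofReal_le_ofReal ?_
      have := eps_le_two_mul_eps_abs_log hε hε2
      nlinarith [Real.pi_pos]
    · -- elliptic for `-ν'`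
      have hnC : ContDiff ℝ 2 (fun p => -ν' p) := hν'C.neg
      have hn1 : fderiv ℝ (fun p => -ν' p) 0 = 0 := by
        rw [show (fun p => -ν' p) = -ν' from rfl, fderiv_neg, hν'1, neg_zero]
      have hn2 : ∀ m : Fin 2 → ℝ × ℝ, iteratedFDeriv ℝ 2 (fun p => -ν' p) 0 m =
          -iteratedFDeriv ℝ 2 ν' 0 m := by
        intro m
        rw [show (fun p => -ν' p) = -ν' from rfl, iteratedFDeriv_neg_apply]
        rfl
      obtain ⟨r, hr, hmain⟩ := morseC2_elliptic_volume_le hnC hn1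
        (by rw [hn2, e11, hs1]; norm_num) (by rw [hn2, e12]; norm_num) (by rw [hn2, e22, hs2]; norm_num)
      refine ⟨r, hr, 16 * Real.pi, by positivity, fun f₀ ε hε hε2 => ?_⟩
      have hset : Metric.ball (0 : ℝ × ℝ) r ∩ {p | |f₀ + ν' p| ≤ ε} =
          Metric.ball (0 : ℝ × ℝ) r ∩ {p | |-f₀ + -ν' p| ≤ ε} := by
        ext p
        simp only [mem_inter_iff, mem_setOf_eq]
        rw [show -f₀ + -ν' p = -(f₀ + ν' p) by ring, abs_neg]
      rw [hset]
      refine (hmain (-f₀) ε hε).trans (ENNReal.ofReal_le_ofReal ?_)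
      have := eps_le_two_mul_eps_abs_log hε hε2
      nlinarith [Real.pi_pos]
  obtain ⟨r, hr, C, hC0, hmain⟩ := hbound
  -- undo the linear change of variables and the recentring
  obtain ⟨r', hr', htrans⟩ := volume_band_le_of_equiv μ' M hr
  refine ⟨r', hr', |LinearMap.det (M : (ℝ × ℝ) →ₗ[ℝ] (ℝ × ℝ))| * C, by positivity,
    fun f₀ ε hε hε2 => ?_⟩
  rw [volume_band_recentre]
  calc volume (Metric.ball (0 : ℝ × ℝ) r' ∩ {p | |f₀ + ν p₀ + (ν (p + p₀) - ν p₀)| ≤ ε})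
      ≤ ENNReal.ofReal |LinearMap.det (M : (ℝ × ℝ) →ₗ[ℝ] (ℝ × ℝ))| *
          volume (Metric.ball (0 : ℝ × ℝ) r ∩ {p | |f₀ + ν p₀ + μ' (M p)| ≤ ε}) :=
        htrans (f₀ + ν p₀) ε
    _ ≤ ENNReal.ofReal |LinearMap.det (M : (ℝ × ℝ) →ₗ[ℝ] (ℝ × ℝ))| *
          ENNReal.ofReal (C * ε * |Real.log ε|) := by
        gcongr
        exact hmain (f₀ + ν p₀) ε hε hε2
    _ = ENNReal.ofReal (|LinearMap.det (M : (ℝ × ℝ) →ₗ[ℝ] (ℝ × ℝ))| * C * ε * |Real.log ε|) := by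
        rw [← ENNReal.ofReal_mul (abs_nonneg _)]
        congr 1
        ring

end Nondegenerate


/-! ### A quantitative elliptic bound (constants from a Hessian lower bound only) -/

section Quantitative

variable {ν : ℝ × ℝ → ℝ}

/-- Derivative of the directional derivative: `D(p ↦ Dν(p) w)(p) = (D²ν(p))ᵀ w`. [folklore] -/
private theorem hasFDerivAt_partial_of_contDiff (hν : ContDiff ℝ 2 ν) (w p : ℝ × ℝ) :
    HasFDerivAt (fun q => fderiv ℝ ν q w) ((fderiv ℝ (fderiv ℝ ν) p).flip w) p := by
  have hd : ContDiff ℝ 1 (fderiv ℝ ν) := hν.fderiv_right (by norm_num)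
  have h := ((hd.differentiable one_ne_zero) p).hasFDerivAt.clm_apply (hasFDerivAt_const w p)
  simpa using h

/-- Along a ray: `s ↦ Dν(s u) u` has derivative `D²ν(s u)(u)(u)`. [folklore] -/
private theorem hasDerivAt_ray_fderiv (hν : ContDiff ℝ 2 ν) (u : ℝ × ℝ) (s : ℝ) :
    HasDerivAt (fun t : ℝ => fderiv ℝ ν (t • u) u) (fderiv ℝ (fderiv ℝ ν) (s • u) u u) s := by
  have h1 : HasDerivAt (fun t : ℝ => t • u) ((1 : ℝ) • u) s := (hasDerivAt_id s).smul_const u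
  rw [one_smul] at h1
  have h2 := hasFDerivAt_partial_of_contDiff hν u (s • u)
  have h3 : HasDerivAt ((fun q => fderiv ℝ ν q u) ∘ fun t : ℝ => t • u)
      (((fderiv ℝ (fderiv ℝ ν) (s • u)).flip u) u) s := h2.comp_hasDerivAt s h1
  rw [ContinuousLinearMap.flip_apply] at h3
  exact h3

/-- **A quantitative form of the elliptic singular-region bound** (the elliptic case of [II]
App. B, p.35 L99–104, with constants depending only on a Hessian lower bound — the form in which
the bound is uniform over a compactly parametrised family, as App. B needs in `q ∈ 𝒫_κ`,
p.34 L40–58): if `ν ∈ C²(ℝ²)`, `Dν(0) = 0` and `D²ν(p)(v,v) ≥ λ (v₁² + v₂²)` for all `p` in the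
ball `B_{r₀}(0)` (sup norm), `λ > 0`, then for every level `f₀` and every `ε > 0`,
`vol{p ∈ B_{r₀/2}(0) : |f₀ + ν p| ≤ ε} ≤ 4π ε/λ`. Proof: on each ray the radial derivative is
`≥ λρ`, so two points of the band on a ray have `ρ₂² - ρ₁² ≤ 4ε/λ`; polar coordinates.
[cite: FeldmanSalmhoferTrubowitz1998, App. B (arXiv p.35 L99–104)] -/
theorem volume_band_le_of_hessian_lower_bound (hν : ContDiff ℝ 2 ν) {r₀ lam : ℝ} (hr₀ : 0 < r₀)
    (hlam : 0 < lam) (h1 : fderiv ℝ ν 0 = 0)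
    (hH : ∀ p ∈ Metric.ball (0 : ℝ × ℝ) r₀, ∀ v : ℝ × ℝ,
      lam * (v.1 ^ 2 + v.2 ^ 2) ≤ fderiv ℝ (fderiv ℝ ν) p v v)
    (f₀ ε : ℝ) (hε : 0 < ε) :
    volume (Metric.ball (0 : ℝ × ℝ) (r₀ / 2) ∩ {p | |f₀ + ν p| ≤ ε}) ≤
      ENNReal.ofReal (4 * Real.pi * ε / lam) := by
  set A := Metric.ball (0 : ℝ × ℝ) (r₀ / 2) ∩ {p | |f₀ + ν p| ≤ ε} with hA
  have hAm : MeasurableSet A :=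
    measurableSet_ball.inter
      (isClosed_le (continuous_abs.comp (continuous_const.add hν.continuous))
        continuous_const).measurableSet
  -- radial derivative bound: for `0 ≤ ρ < r₀`, `d/dρ ν(ρ u) ≥ λ ρ`
  have hray : ∀ (θ ρ : ℝ), 0 ≤ ρ → ρ < r₀ →
      lam * ρ ≤ fderiv ℝ ν (ρ • (Real.cos θ, Real.sin θ)) (Real.cos θ, Real.sin θ) := by
    intro θ ρ hρ hρr
    set u : ℝ × ℝ := (Real.cos θ, Real.sin θ) with hu
    have hball : ∀ s : ℝ, 0 ≤ s → s < r₀ → s • u ∈ Metric.ball (0 : ℝ × ℝ) r₀ := by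
      intro s hs hsr
      rw [Metric.mem_ball, dist_zero_right, hu, Prod.smul_mk, Prod.norm_def]
      simp only [smul_eq_mul, Real.norm_eq_abs]
      refine max_lt ?_ ?_
      · calc |s * Real.cos θ| = s * |Real.cos θ| := by rw [abs_mul, abs_of_nonneg hs]
          _ ≤ s * 1 := mul_le_mul_of_nonneg_left (Real.abs_cos_le_one θ) hs
          _ < r₀ := by linarith
      · calc |s * Real.sin θ| = s * |Real.sin θ| := by rw [abs_mul, abs_of_nonneg hs]
          _ ≤ s * 1 := mul_le_mul_of_nonneg_left (Real.abs_sin_le_one θ) hs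
          _ < r₀ := by linarith
    -- `G(s) = Dν(s u) u - λ s` is non-decreasing on `[0, r₀)` and vanishes at `0`
    have hmono : MonotoneOn (fun s : ℝ => fderiv ℝ ν (s • u) u - lam * s) (Ico 0 r₀) := by
      have hcont : ContinuousOn (fun s : ℝ => fderiv ℝ ν (s • u) u - lam * s) (Ico 0 r₀) := by
        have hc : Continuous fun s : ℝ => fderiv ℝ ν (s • u) u - lam * s :=
          (((hν.continuous_fderiv (by norm_num)).comp (continuous_id.smul continuous_const)).clm_apply
            continuous_const).sub (continuous_const.mul continuous_id)
        exact hc.continuousOn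
      refine monotoneOn_of_hasDerivWithinAt_nonneg (convex_Ico 0 r₀) hcont
        (f' := fun s => fderiv ℝ (fderiv ℝ ν) (s • u) u u - lam) ?_ ?_
      · intro s hs
        rw [interior_Ico] at hs ⊢
        exact (((hasDerivAt_ray_fderiv hν u s).sub
          ((hasDerivAt_id s).const_mul lam)).hasDerivWithinAt).congr_deriv (by simp)
      · intro s hs
        rw [interior_Ico] at hs
        have h := hH (s • u) (hball s hs.1.le hs.2) u
        have hu1 : u.1 ^ 2 + u.2 ^ 2 = 1 := by
          simp only [hu]; nlinarith [Real.cos_sq_add_sin_sq θ]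
        rw [hu1, mul_one] at h
        linarith
    have h0 : fderiv ℝ ν ((0 : ℝ) • u) u - lam * 0 = 0 := by simp [h1]
    have h := hmono (show (0 : ℝ) ∈ Ico 0 r₀ from ⟨le_rfl, hr₀⟩) ⟨hρ, hρr⟩ hρ
    simp only [zero_smul, h1, zero_apply, mul_zero, sub_zero] at h
    linarith
  -- on each ray, two points of `A` have `|ρ₂² - ρ₁²| ≤ 4ε/λ`
  have hpair : ∀ θ : ℝ, ∀ ρ₁ ∈ Ioi (0 : ℝ) ∩ {ρ | ρ • (Real.cos θ, Real.sin θ) ∈ A},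
      ∀ ρ₂ ∈ Ioi (0 : ℝ) ∩ {ρ | ρ • (Real.cos θ, Real.sin θ) ∈ A},
        |ρ₂ ^ 2 - ρ₁ ^ 2| ≤ 4 * ε / lam := by
    intro θ
    set u : ℝ × ℝ := (Real.cos θ, Real.sin θ) with hu
    have hlt : ∀ ρ ∈ Ioi (0 : ℝ) ∩ {ρ | ρ • u ∈ A}, ρ < r₀ := by
      rintro ρ ⟨hρ, hρA⟩
      have hb : ρ • u ∈ Metric.ball (0 : ℝ × ℝ) (r₀ / 2) := hρA.1
      rw [Metric.mem_ball, dist_zero_right, hu, Prod.smul_mk, Prod.norm_def] at hb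
      simp only [smul_eq_mul, Real.norm_eq_abs, max_lt_iff] at hb
      have h1 : (ρ * Real.cos θ) ^ 2 < (r₀ / 2) ^ 2 := by
        have := hb.1; rw [← sq_abs]; have h0 : 0 ≤ |ρ * Real.cos θ| := abs_nonneg _
        nlinarith
      have h2 : (ρ * Real.sin θ) ^ 2 < (r₀ / 2) ^ 2 := by
        have := hb.2; rw [← sq_abs]; have h0 : 0 ≤ |ρ * Real.sin θ| := abs_nonneg _
        nlinarith
      have hsum : ρ ^ 2 < r₀ ^ 2 := by nlinarith [Real.cos_sq_add_sin_sq θ]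
      have hρ' : (0 : ℝ) < ρ := hρ
      nlinarith
    have hmono : MonotoneOn (fun ρ : ℝ => ν (ρ • u) - lam * ρ ^ 2 / 2) (Icc 0 r₀) := by
      have hcont : ContinuousOn (fun ρ : ℝ => ν (ρ • u) - lam * ρ ^ 2 / 2) (Icc 0 r₀) := by
        have : Continuous fun ρ : ℝ => ν (ρ • u) - lam * ρ ^ 2 / 2 :=
          (hν.continuous.comp (continuous_id.smul continuous_const)).sub (by fun_prop)
        exact this.continuousOn
      refine monotoneOn_of_hasDerivWithinAt_nonneg (convex_Icc 0 r₀) hcont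
        (f' := fun ρ => fderiv ℝ ν (ρ • u) u - lam * ρ) ?_ ?_
      · intro ρ hρ
        rw [interior_Icc] at hρ ⊢
        have h0 : HasDerivAt (fun x : ℝ => x ^ 2) (2 * ρ) ρ := by
          have h := hasDerivAt_pow 2 ρ
          norm_num at h
          exact h
        exact (((hasDerivAt_ray_of_contDiff hν u ρ).sub ((h0.const_mul lam).div_const 2)).hasDerivWithinAt
          (s := Ioo 0 r₀)).congr_deriv (by ring)
      · intro ρ hρ
        rw [interior_Icc] at hρ
        have := hray θ ρ hρ.1.le hρ.2
        linarith
    have key : ∀ ρ₁ ∈ Ioi (0 : ℝ) ∩ {ρ | ρ • u ∈ A}, ∀ ρ₂ ∈ Ioi (0 : ℝ) ∩ {ρ | ρ • u ∈ A},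
        ρ₁ ≤ ρ₂ → ρ₂ ^ 2 - ρ₁ ^ 2 ≤ 4 * ε / lam := by
      intro ρ₁ h₁ ρ₂ h₂ h12
      have hρ₁ : (0 : ℝ) < ρ₁ := h₁.1
      have hρ₂ : (0 : ℝ) < ρ₂ := h₂.1
      have hm := hmono ⟨hρ₁.le, (hlt ρ₁ h₁).le⟩ ⟨hρ₂.le, (hlt ρ₂ h₂).le⟩ h12
      simp only at hm
      have e1 : |f₀ + ν (ρ₁ • u)| ≤ ε := h₁.2.2
      have e2 : |f₀ + ν (ρ₂ • u)| ≤ ε := h₂.2.2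
      rw [abs_le] at e1 e2
      rw [le_div_iff₀ hlam]
      nlinarith [e1.1, e1.2, e2.1, e2.2]
    intro ρ₁ h₁ ρ₂ h₂
    have hρ₁ : (0 : ℝ) < ρ₁ := h₁.1
    have hρ₂ : (0 : ℝ) < ρ₂ := h₂.1
    rcases le_total ρ₁ ρ₂ with h12 | h12
    · rw [abs_of_nonneg (by nlinarith : (0:ℝ) ≤ ρ₂ ^ 2 - ρ₁ ^ 2)]
      exact key ρ₁ h₁ ρ₂ h₂ h12
    · have := key ρ₂ h₂ ρ₁ h₁ h12
      rw [abs_sub_comm, abs_of_nonneg (by nlinarith : (0:ℝ) ≤ ρ₁ ^ 2 - ρ₂ ^ 2)]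
      exact this
  -- polar coordinates (as in `morseC2_elliptic_volume_le`)
  have hsymm : ∀ q : ℝ × ℝ, polarCoord.symm q = q.1 • (Real.cos q.2, Real.sin q.2) := by
    intro q; rw [polarCoord_symm_apply]; simp [Prod.smul_mk, smul_eq_mul]
  set g : ℝ × ℝ → ℝ≥0∞ := fun q => ENNReal.ofReal q.1 * A.indicator 1 (polarCoord.symm q) with hg
  have hgm : Measurable g :=
    (ENNReal.measurable_ofReal.comp measurable_fst).mul
      ((measurable_one.indicator hAm).comp continuous_polarCoord_symm.measurable)
  have hvol : volume A = ∫⁻ q in polarCoord.target, g q := by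
    rw [← lintegral_indicator_one hAm, ← lintegral_comp_polarCoord_symm]
    simp only [hg, smul_eq_mul]
  have hinner : ∀ θ : ℝ, ∫⁻ ρ in Ioi (0 : ℝ), g (ρ, θ) ≤ ENNReal.ofReal (2 * ε / lam) := by
    intro θ
    set T := {ρ : ℝ | ρ • (Real.cos θ, Real.sin θ) ∈ A} with hT
    have hTm : MeasurableSet T :=
      hAm.preimage (continuous_id.smul continuous_const).measurable
    have hgT : ∀ ρ, g (ρ, θ) = T.indicator (fun ρ => ENNReal.ofReal ρ) ρ := by
      intro ρ
      have hs : polarCoord.symm (ρ, θ) = ρ • (Real.cos θ, Real.sin θ) := by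
        rw [hsymm]
      simp only [hg, hs]
      by_cases hρ : ρ • (Real.cos θ, Real.sin θ) ∈ A
      · rw [indicator_of_mem hρ, indicator_of_mem (show ρ ∈ T from hρ), Pi.one_apply, mul_one]
      · rw [indicator_of_notMem hρ, indicator_of_notMem (show ρ ∉ T from hρ), mul_zero]
    simp_rw [hgT]
    rw [lintegral_indicator hTm, Measure.restrict_restrict hTm]
    have h := setLIntegral_radial_le_of_sq_sub_sq_le (K := 4 * ε / lam) (hTm.inter measurableSet_Ioi)
      (fun ρ hρ => mem_Ici.2 (le_of_lt (mem_Ioi.1 hρ.2)))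
      (fun ρ₁ h₁ ρ₂ h₂ => hpair θ ρ₁ ⟨h₁.2, h₁.1⟩ ρ₂ ⟨h₂.2, h₂.1⟩)
    calc ∫⁻ ρ in T ∩ Ioi 0, ENNReal.ofReal ρ ≤ ENNReal.ofReal (4 * ε / lam / 2) := h
      _ = ENNReal.ofReal (2 * ε / lam) := by congr 1; ring
  rw [hvol, polarCoord_target, Measure.volume_eq_prod, ← Measure.prod_restrict,
    lintegral_prod_symm _ hgm.aemeasurable]
  calc ∫⁻ θ in Ioo (-Real.pi) Real.pi, ∫⁻ ρ in Ioi (0 : ℝ), g (ρ, θ)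
      ≤ ∫⁻ _ in Ioo (-Real.pi) Real.pi, ENNReal.ofReal (2 * ε / lam) :=
        lintegral_mono fun θ => hinner θ
    _ = ENNReal.ofReal (2 * ε / lam) * volume (Ioo (-Real.pi) Real.pi) := setLIntegral_const _ _
    _ = ENNReal.ofReal (4 * Real.pi * ε / lam) := by
        rw [Real.volume_Ioo, ← ENNReal.ofReal_mul (by positivity)]
        congr 1; ring

/-- The same at a general base point `p₀`: `Dν(p₀) = 0` and `D²ν ≥ λ` on `B_{r₀}(p₀)` give
`vol{p ∈ B_{r₀/2}(p₀) : |f₀ + ν p| ≤ ε} ≤ 4π ε/λ` for all `f₀` and `ε > 0` — constants from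
`(r₀, λ)` only, hence uniform over any family of functions sharing them (App. B, p.34 L40–58).
[cite: FeldmanSalmhoferTrubowitz1998, App. B (arXiv p.35 L99–104)] -/
theorem volume_band_le_of_hessian_lower_bound_at (hν : ContDiff ℝ 2 ν) (p₀ : ℝ × ℝ)
    {r₀ lam : ℝ} (hr₀ : 0 < r₀) (hlam : 0 < lam) (h1 : fderiv ℝ ν p₀ = 0)
    (hH : ∀ p ∈ Metric.ball p₀ r₀, ∀ v : ℝ × ℝ,
      lam * (v.1 ^ 2 + v.2 ^ 2) ≤ fderiv ℝ (fderiv ℝ ν) p v v)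
    (f₀ ε : ℝ) (hε : 0 < ε) :
    volume (Metric.ball p₀ (r₀ / 2) ∩ {p | |f₀ + ν p| ≤ ε}) ≤
      ENNReal.ofReal (4 * Real.pi * ε / lam) := by
  set μ' : ℝ × ℝ → ℝ := fun p => ν (p + p₀) with hμ'
  have hC : ContDiff ℝ 2 μ' := hν.comp (contDiff_id.add contDiff_const)
  have hfd : fderiv ℝ μ' = fun p => fderiv ℝ ν (p + p₀) := by
    funext p; rw [hμ', fderiv_comp_add_right]
  have h1' : fderiv ℝ μ' 0 = 0 := by rw [hfd]; simp [h1]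
  have hH' : ∀ p ∈ Metric.ball (0 : ℝ × ℝ) r₀, ∀ v : ℝ × ℝ,
      lam * (v.1 ^ 2 + v.2 ^ 2) ≤ fderiv ℝ (fderiv ℝ μ') p v v := by
    intro p hp v
    rw [hfd, fderiv_comp_add_right]
    refine hH (p + p₀) ?_ v
    rw [Metric.mem_ball, dist_eq_norm, add_sub_cancel_right]
    rwa [Metric.mem_ball, dist_zero_right] at hp
  rw [volume_band_recentre]
  have hset : Metric.ball (0 : ℝ × ℝ) (r₀ / 2) ∩ {p | |f₀ + ν p₀ + (ν (p + p₀) - ν p₀)| ≤ ε} =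
      Metric.ball (0 : ℝ × ℝ) (r₀ / 2) ∩ {p | |f₀ + μ' p| ≤ ε} := by
    ext p
    simp only [hμ', mem_inter_iff, mem_setOf_eq]
    rw [show f₀ + ν p₀ + (ν (p + p₀) - ν p₀) = f₀ + ν (p + p₀) by ring]
  rw [hset]
  exact volume_band_le_of_hessian_lower_bound hC hr₀ hlam h1' hH' f₀ ε hε

end Quantitative


/-! ### One-dimensional toolbox: sub-level bands of uniformly convex slices -/

section ConvexSlice

/-- Strong convexity from a `λ`-increasing derivative: the tangent-below inequality with the
quadratic gain, to the right. [folklore] -/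
private theorem strongConvex_right {h h' : ℝ → ℝ} {a b lam : ℝ}
    (hd : ∀ x ∈ Icc a b, HasDerivAt h (h' x) x)
    (hmono : ∀ x ∈ Icc a b, ∀ y ∈ Icc a b, x ≤ y → lam * (y - x) ≤ h' y - h' x)
    {x y : ℝ} (hx : x ∈ Icc a b) (hy : y ∈ Icc a b) (hxy : x ≤ y) :
    h' x * (y - x) + lam * (y - x) ^ 2 / 2 ≤ h y - h x := by
  have hsub : Icc x y ⊆ Icc a b := Icc_subset_Icc hx.1 hy.2
  set φ : ℝ → ℝ := fun s => h s - h x - h' x * (s - x) - lam * (s - x) ^ 2 / 2 with hφ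
  have hφd : ∀ s ∈ Icc a b, HasDerivAt φ (h' s - h' x - lam * (s - x)) s := by
    intro s hs
    have h1 : HasDerivAt (fun s => h' x * (s - x)) (h' x * 1) s :=
      ((hasDerivAt_id s).sub_const x).const_mul (h' x)
    have h2 : HasDerivAt (fun s => lam * (s - x) ^ 2 / 2) (lam * (2 * (s - x) * 1) / 2) s :=
      (((hasDerivAt_id s).sub_const x).pow 2 |>.const_mul lam).div_const 2 |>.congr_deriv
        (by simp only [id_eq]; ring)
    have h3 := (((hd s hs).sub_const (h x)).sub h1).sub h2
    exact h3.congr_deriv (by ring)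
  have hmonoφ : MonotoneOn φ (Icc x y) := by
    have hcont : ContinuousOn φ (Icc x y) := fun s hs =>
      (hφd s (hsub hs)).continuousAt.continuousWithinAt
    refine monotoneOn_of_hasDerivWithinAt_nonneg (convex_Icc x y) hcont
      (f' := fun s => h' s - h' x - lam * (s - x)) ?_ ?_
    · intro s hs
      rw [interior_Icc] at hs ⊢
      exact (hφd s (hsub (Ioo_subset_Icc_self hs))).hasDerivWithinAt
    · intro s hs
      rw [interior_Icc] at hs
      have := hmono x hx s (hsub (Ioo_subset_Icc_self hs)) hs.1.le
      linarith
  have h := hmonoφ (left_mem_Icc.2 hxy) (right_mem_Icc.2 hxy) hxy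
  simp only [hφ, sub_self, mul_zero, zero_pow two_ne_zero, zero_div] at h
  linarith

/-- The same inequality read from the right end point (tangent at `y`). [folklore] -/
private theorem strongConvex_left {h h' : ℝ → ℝ} {a b lam : ℝ}
    (hd : ∀ x ∈ Icc a b, HasDerivAt h (h' x) x)
    (hmono : ∀ x ∈ Icc a b, ∀ y ∈ Icc a b, x ≤ y → lam * (y - x) ≤ h' y - h' x)
    {x y : ℝ} (hx : x ∈ Icc a b) (hy : y ∈ Icc a b) (hxy : x ≤ y) :
    -(h' y * (y - x)) + lam * (y - x) ^ 2 / 2 ≤ h x - h y := by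
  -- apply `strongConvex_right` to the reflected function `s ↦ h (-s)`
  have hd' : ∀ s ∈ Icc (-b) (-a), HasDerivAt (fun s => h (-s)) (-(h' (-s))) s := by
    intro s hs
    have hs' : -s ∈ Icc a b := ⟨by linarith [hs.2], by linarith [hs.1]⟩
    have h1 := (hd (-s) hs').comp s (hasDerivAt_neg s)
    exact h1.congr_deriv (by ring)
  have hmono' : ∀ s ∈ Icc (-b) (-a), ∀ t ∈ Icc (-b) (-a), s ≤ t →
      lam * (t - s) ≤ -(h' (-t)) - -(h' (-s)) := by
    intro s hs t ht hst
    have hs' : -s ∈ Icc a b := ⟨by linarith [hs.2], by linarith [hs.1]⟩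
    have ht' : -t ∈ Icc a b := ⟨by linarith [ht.2], by linarith [ht.1]⟩
    have := hmono (-t) ht' (-s) hs' (by linarith)
    linarith
  have h := strongConvex_right hd' hmono' (x := -y) (y := -x)
    ⟨by linarith [hy.2], by linarith [hy.1]⟩ ⟨by linarith [hx.2], by linarith [hx.1]⟩ (by linarith)
  simp only [neg_neg] at h
  have e : -x - -y = y - x := by ring
  rw [e] at h
  linarith

/-- Two monotone pieces: if on `E ⊆ [a,b]` points `x ≤ y` are `ℓ`-close whenever `h'(x) ≥ 0`, and
whenever `h'(y) ≤ 0`, then `vol E ≤ 2ℓ`. [folklore] -/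
private theorem volume_le_two_pieces {h' : ℝ → ℝ} {E : Set ℝ} {ℓ : ℝ}
    (hE : ∀ x ∈ E, ∀ y ∈ E, x ≤ y → (0 ≤ h' x → y - x ≤ ℓ) ∧ (h' y ≤ 0 → y - x ≤ ℓ)) :
    volume E ≤ 2 * ENNReal.ofReal ℓ := by
  have hsub : E ⊆ (E ∩ {x | 0 ≤ h' x}) ∪ (E ∩ {x | h' x ≤ 0}) := by
    intro x hx
    rcases le_total 0 (h' x) with h | h
    · exact Or.inl ⟨hx, h⟩
    · exact Or.inr ⟨hx, h⟩
  have hdiam : ∀ (F : Set ℝ), (∀ x ∈ F, ∀ y ∈ F, x ≤ y → y - x ≤ ℓ) →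
      volume F ≤ ENNReal.ofReal ℓ := by
    intro F hF
    calc volume F ≤ Metric.ediam F := Real.volume_le_diam _
      _ ≤ ENNReal.ofReal ℓ := by
          refine Metric.ediam_le ?_
          intro x hx y hy
          rw [edist_dist, Real.dist_eq]
          refine ENNReal.ofReal_le_ofReal ?_
          rcases le_total x y with h | h
          · rw [abs_sub_comm, abs_of_nonneg (by linarith)]; exact hF x hx y hy h
          · rw [abs_of_nonneg (by linarith)]; exact hF y hy x hx h
  have h1 : volume (E ∩ {x | 0 ≤ h' x}) ≤ ENNReal.ofReal ℓ :=
    hdiam _ fun x hx y hy hxy => (hE x hx.1 y hy.1 hxy).1 hx.2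
  have h2 : volume (E ∩ {x | h' x ≤ 0}) ≤ ENNReal.ofReal ℓ :=
    hdiam _ fun x hx y hy hxy => (hE x hx.1 y hy.1 hxy).2 hy.2
  calc volume E ≤ volume ((E ∩ {x | 0 ≤ h' x}) ∪ (E ∩ {x | h' x ≤ 0})) := measure_mono hsub
    _ ≤ volume (E ∩ {x | 0 ≤ h' x}) + volume (E ∩ {x | h' x ≤ 0}) := measure_union_le _ _
    _ ≤ ENNReal.ofReal ℓ + ENNReal.ofReal ℓ := add_le_add h1 h2
    _ = 2 * ENNReal.ofReal ℓ := by ring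

/-- **Band lemma for a uniformly convex slice** (the `dR`-count behind App. B's slices; used in
the elliptic/regular regimes): if `h` is differentiable on `[a,b]` with a `λ`-increasing
derivative (`h'(y) - h'(x) ≥ λ(y - x)`), then `vol{x ∈ [a,b] : t₁ ≤ h(x) ≤ t₂} ≤ 2 √(2(t₂-t₁)/λ)`
— two monotone pieces, on each of which `h` gains at least `λ d²/2` over a distance `d`.
[cite: FeldmanSalmhoferTrubowitz1998, App. B (arXiv p.33 L88–96, p.35 L99–104)] -/
theorem volume_band_le_of_deriv_uniformMono {h h' : ℝ → ℝ} {a b lam t₁ t₂ : ℝ} (hlam : 0 < lam)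
    (hd : ∀ x ∈ Icc a b, HasDerivAt h (h' x) x)
    (hmono : ∀ x ∈ Icc a b, ∀ y ∈ Icc a b, x ≤ y → lam * (y - x) ≤ h' y - h' x) :
    volume (Icc a b ∩ {x | t₁ ≤ h x ∧ h x ≤ t₂}) ≤
      2 * ENNReal.ofReal (Real.sqrt (2 * (t₂ - t₁) / lam)) := by
  refine volume_le_two_pieces (h' := h') fun x hx y hy hxy => ?_
  have hsq_to_le : lam * (y - x) ^ 2 / 2 ≤ t₂ - t₁ → y - x ≤ Real.sqrt (2 * (t₂ - t₁) / lam) := by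
    intro hq
    have h1 : (y - x) ^ 2 ≤ 2 * (t₂ - t₁) / lam := by
      rw [le_div_iff₀ hlam]; linarith
    calc y - x = Real.sqrt ((y - x) ^ 2) := (Real.sqrt_sq (by linarith)).symm
      _ ≤ Real.sqrt (2 * (t₂ - t₁) / lam) := Real.sqrt_le_sqrt h1
  constructor
  · intro hpos
    have h := strongConvex_right hd hmono hx.1 hy.1 hxy
    apply hsq_to_le
    have : 0 ≤ h' x * (y - x) := mul_nonneg hpos (by linarith)
    linarith [hx.2.1, hx.2.2, hy.2.1, hy.2.2]
  · intro hneg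
    have h := strongConvex_left hd hmono hx.1 hy.1 hxy
    apply hsq_to_le
    have : h' y * (y - x) ≤ 0 := mul_nonpos_of_nonpos_of_nonneg hneg (by linarith)
    linarith [hx.2.1, hx.2.2, hy.2.1, hy.2.2]

/-- **Band lemma away from the bottom of a uniformly convex slice** (the regime that produces
`ε/√u` and, after the `dφ₁`-integration, the logarithm of App. B in the hyperbolic case): with
`h` as above, any `x₀ ∈ [a,b]` (typically the minimiser of `h`) and a level `c` with
`D := c - ε - h(x₀) > 0`, `vol{x ∈ [a,b] : |h(x) - c| ≤ ε} ≤ 4ε/√(2λD)` — on the band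
`|h'| ≥ √(2λD)` (from `h(x) - h(x₀) ≤ h'(x)²/(2λ)`, strong convexity), two monotone pieces.
[cite: FeldmanSalmhoferTrubowitz1998, App. B (arXiv p.33 L88–96, p.35 L108–112)] -/
theorem volume_band_le_of_deriv_uniformMono_of_gap {h h' : ℝ → ℝ} {a b lam c ε : ℝ}
    (hlam : 0 < lam) (hd : ∀ x ∈ Icc a b, HasDerivAt h (h' x) x)
    (hmono : ∀ x ∈ Icc a b, ∀ y ∈ Icc a b, x ≤ y → lam * (y - x) ≤ h' y - h' x)
    {x₀ : ℝ} (hx₀ : x₀ ∈ Icc a b) (hgap : 0 < c - ε - h x₀) :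
    volume (Icc a b ∩ {x | |h x - c| ≤ ε}) ≤
      2 * ENNReal.ofReal (2 * ε / Real.sqrt (2 * lam * (c - ε - h x₀))) := by
  set D := c - ε - h x₀ with hD
  set κ := Real.sqrt (2 * lam * D) with hκ
  have hκ0 : 0 < κ := Real.sqrt_pos.2 (by positivity)
  have hκ2 : κ ^ 2 = 2 * lam * D := Real.sq_sqrt (by positivity)
  -- `h(x) - h(x₀) ≤ h'(x)²/(2λ)` on `[a,b]`
  have hP : ∀ x ∈ Icc a b, h x - h x₀ ≤ h' x ^ 2 / (2 * lam) := by
    intro x hx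
    rw [le_div_iff₀ (by positivity)]
    rcases le_total x₀ x with h0x | hx0
    · have h := strongConvex_left hd hmono hx₀ hx h0x
      nlinarith [sq_nonneg (h' x - lam * (x - x₀))]
    · have h := strongConvex_right hd hmono hx hx₀ hx0
      nlinarith [sq_nonneg (h' x + lam * (x₀ - x))]
  -- on the band, `|h'| ≥ κ`
  have hband : ∀ x ∈ Icc a b ∩ {x | |h x - c| ≤ ε}, κ ≤ |h' x| := by
    rintro x ⟨hx, hxc⟩
    have hxc0 : |h x - c| ≤ ε := hxc
    have hxc' : c - ε ≤ h x := by
      have := (abs_le.1 hxc0).1; linarith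
    have h1 : 2 * lam * D ≤ h' x ^ 2 := by
      have := hP x hx
      rw [le_div_iff₀ (by positivity)] at this
      nlinarith
    calc κ = Real.sqrt (κ ^ 2) := (Real.sqrt_sq hκ0.le).symm
      _ ≤ Real.sqrt (h' x ^ 2) := Real.sqrt_le_sqrt (by rw [hκ2]; exact h1)
      _ = |h' x| := Real.sqrt_sq_eq_abs _
  refine volume_le_two_pieces (h' := h') fun x hx y hy hxy => ?_
  have hxb := hband x hx
  have hyb := hband y hy
  have ex := abs_le.1 (show |h x - c| ≤ ε from hx.2)
  have ey := abs_le.1 (show |h y - c| ≤ ε from hy.2)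
  constructor
  · intro hpos
    have hx' : κ ≤ h' x := by rwa [abs_of_nonneg hpos] at hxb
    have h := strongConvex_right hd hmono hx.1 hy.1 hxy
    have hk : κ * (y - x) ≤ 2 * ε := by nlinarith [ex.1, ex.2, ey.1, ey.2]
    rw [le_div_iff₀ hκ0]; linarith
  · intro hneg
    have hy' : κ ≤ -h' y := by rwa [abs_of_nonpos hneg] at hyb
    have h := strongConvex_left hd hmono hx.1 hy.1 hxy
    have hk : κ * (y - x) ≤ 2 * ε := by nlinarith [ex.1, ex.2, ey.1, ey.2]
    rw [le_div_iff₀ hκ0]; linarith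


/-- **Chord inequality** for a uniformly convex slice: `h(θ_a x + θ_b y) ≤ θ_a h(x) + θ_b h(y)
- (λ/2) θ_a θ_b (y - x)²` (from the two tangent inequalities at the intermediate point).
[cite: FeldmanSalmhoferTrubowitz1998, App. B (arXiv p.35 L47–60)] -/
theorem strongConvex_chord_of_deriv_uniformMono {h h' : ℝ → ℝ} {a b lam : ℝ}
    (hd : ∀ x ∈ Icc a b, HasDerivAt h (h' x) x)
    (hmono : ∀ x ∈ Icc a b, ∀ y ∈ Icc a b, x ≤ y → lam * (y - x) ≤ h' y - h' x)
    {x y : ℝ} (hx : x ∈ Icc a b) (hy : y ∈ Icc a b) (hxy : x ≤ y) {θa θb : ℝ} (ha : 0 ≤ θa)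
    (hb : 0 ≤ θb) (hab : θa + θb = 1) :
    h (θa * x + θb * y) ≤ θa * h x + θb * h y - lam / 2 * θa * θb * (y - x) ^ 2 := by
  set z := θa * x + θb * y with hz
  have e1 : y - z = θa * (y - x) := by rw [hz]; linear_combination (-y) * hab
  have e2 : z - x = θb * (y - x) := by rw [hz]; linear_combination x * hab
  have hxz : x ≤ z := by
    have := mul_nonneg hb (sub_nonneg.2 hxy); linarith
  have hzy : z ≤ y := by
    have := mul_nonneg ha (sub_nonneg.2 hxy); linarith
  have hzI : z ∈ Icc a b := ⟨le_trans hx.1 hxz, le_trans hzy hy.2⟩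
  have h1 := strongConvex_right hd hmono hzI hy hzy
  have h2 := strongConvex_left hd hmono hx hzI hxz
  rw [e1] at h1
  rw [e2] at h2
  have h1' := mul_le_mul_of_nonneg_left h1 hb
  have h2' := mul_le_mul_of_nonneg_left h2 ha
  have hsum : θa * h x + θb * h y - h z * (θa + θb) ≥
      lam / 2 * θa * θb * (θa + θb) * (y - x) ^ 2 := by nlinarith
  rw [hab] at hsum
  linarith

/-- **The chord inequality is stable under suprema** (App. B's marginal over the inner variable:
`u(φ₁) = c - min_{φ₂} ν(φ₁,φ₂)` is uniformly convex when every `φ₁ ↦ c - ν(φ₁,φ₂)` is):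
a pointwise supremum over a non-empty family of functions satisfying the `λ`-chord inequality on
`[a,b]`, finite at every point, satisfies it. [cite: FeldmanSalmhoferTrubowitz1998, App. B (arXiv p.35 L47–60)] -/
theorem chord_sSup_of_forall {K : Set ℝ} (hK : K.Nonempty) {g : ℝ → ℝ → ℝ} {a b lam : ℝ}
    (hch : ∀ k ∈ K, ∀ x ∈ Icc a b, ∀ y ∈ Icc a b, x ≤ y → ∀ θa θb : ℝ, 0 ≤ θa → 0 ≤ θb →
      θa + θb = 1 →
      g k (θa * x + θb * y) ≤ θa * g k x + θb * g k y - lam / 2 * θa * θb * (y - x) ^ 2)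
    (hbdd : ∀ x ∈ Icc a b, BddAbove ((fun k => g k x) '' K)) :
    ∀ x ∈ Icc a b, ∀ y ∈ Icc a b, x ≤ y → ∀ θa θb : ℝ, 0 ≤ θa → 0 ≤ θb → θa + θb = 1 →
      sSup ((fun k => g k (θa * x + θb * y)) '' K) ≤
        θa * sSup ((fun k => g k x) '' K) + θb * sSup ((fun k => g k y) '' K) -
          lam / 2 * θa * θb * (y - x) ^ 2 := by
  intro x hx y hy hxy θa θb ha hb hab
  have hne : ((fun k => g k (θa * x + θb * y)) '' K).Nonempty := hK.image _
  refine csSup_le hne ?_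
  rintro _ ⟨k, hk, rfl⟩
  have h1 : g k x ≤ sSup ((fun k => g k x) '' K) := le_csSup (hbdd x hx) ⟨k, hk, rfl⟩
  have h2 : g k y ≤ sSup ((fun k => g k y) '' K) := le_csSup (hbdd y hy) ⟨k, hk, rfl⟩
  have h := hch k hk x hx y hy hxy θa θb ha hb hab
  nlinarith [mul_le_mul_of_nonneg_left h1 ha, mul_le_mul_of_nonneg_left h2 hb]

/-- **Band lemma for a continuous function satisfying the chord inequality** (derivative-free;
the marginal `u(φ₁)` of App. B's saddle is such a function but need not be differentiable):
if `u` is continuous on `[a,b]`, satisfies the `λ`-chord inequality, and `m₀ = u(x₀)` is its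
minimum, then for `m₀ < t₂`: `vol{x ∈ [a,b] : t₁ ≤ u(x) ≤ t₂} ≤ 4 (t₂ - t₁)/√(λ (t₂ - m₀))`
when `t₁ ≤ t₂` — quadratic growth `u(x) - m₀ ≥ (λ/4)(x - x₀)²` away from the minimiser and, on
each side of `x₀`, the chord between `x₀` and the far point.
[cite: FeldmanSalmhoferTrubowitz1998, App. B (arXiv p.35 L47–60, L108–112)] -/
theorem volume_band_le_of_chord {u : ℝ → ℝ} {a b lam t₁ t₂ x₀ : ℝ} (hlam : 0 < lam)
    (ht : t₁ ≤ t₂)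
    (hch : ∀ x ∈ Icc a b, ∀ y ∈ Icc a b, x ≤ y → ∀ θa θb : ℝ, 0 ≤ θa → 0 ≤ θb → θa + θb = 1 →
      u (θa * x + θb * y) ≤ θa * u x + θb * u y - lam / 2 * θa * θb * (y - x) ^ 2)
    (hx₀ : x₀ ∈ Icc a b) (hmin : ∀ x ∈ Icc a b, u x₀ ≤ u x) (ht₂ : u x₀ < t₂) :
    volume (Icc a b ∩ {x | t₁ ≤ u x ∧ u x ≤ t₂}) ≤
      2 * ENNReal.ofReal (2 * (t₂ - t₁) / Real.sqrt (lam * (t₂ - u x₀))) := by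
  set m₀ := u x₀ with hm₀
  set R := 2 * Real.sqrt ((t₂ - m₀) / lam) with hR
  have hD : 0 < t₂ - m₀ := by linarith
  -- quadratic growth away from the minimiser
  have hgrow : ∀ x ∈ Icc a b, lam / 4 * (x - x₀) ^ 2 ≤ u x - m₀ := by
    intro x hx
    rcases le_total x₀ x with h0x | hx0
    · have h := hch x₀ hx₀ x hx h0x (1 / 2) (1 / 2) (by norm_num) (by norm_num) (by norm_num)
      have hmid : (1 / 2 : ℝ) * x₀ + 1 / 2 * x ∈ Icc a b :=
        ⟨by linarith [hx₀.1, hx.1], by linarith [hx₀.2, hx.2]⟩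
      have hm := hmin _ hmid
      nlinarith
    · have h := hch x hx x₀ hx₀ hx0 (1 / 2) (1 / 2) (by norm_num) (by norm_num) (by norm_num)
      have hmid : (1 / 2 : ℝ) * x + 1 / 2 * x₀ ∈ Icc a b :=
        ⟨by linarith [hx₀.1, hx.1], by linarith [hx₀.2, hx.2]⟩
      have hm := hmin _ hmid
      nlinarith
  -- hence `|x - x₀| ≤ R` on `{u ≤ t₂}`
  have hRad : ∀ x ∈ Icc a b, u x ≤ t₂ → |x - x₀| ≤ R := by
    intro x hx hxt
    have h1 : (x - x₀) ^ 2 ≤ 4 * ((t₂ - m₀) / lam) := by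
      rw [mul_div_assoc', le_div_iff₀ hlam]
      nlinarith [hgrow x hx]
    calc |x - x₀| = Real.sqrt ((x - x₀) ^ 2) := (Real.sqrt_sq_eq_abs _).symm
      _ ≤ Real.sqrt (4 * ((t₂ - m₀) / lam)) := Real.sqrt_le_sqrt h1
      _ = R := by
          rw [hR, Real.sqrt_mul (by norm_num), show Real.sqrt 4 = 2 by
            rw [show (4 : ℝ) = 2 ^ 2 by norm_num, Real.sqrt_sq (by norm_num)]]
  -- the length bound on each side of `x₀`
  set ℓ := 2 * (t₂ - t₁) / Real.sqrt (lam * (t₂ - m₀)) with hℓ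
  have hℓR : ℓ = (t₂ - t₁) / (t₂ - m₀) * R := by
    rw [hℓ, hR, Real.sqrt_div' _ hlam.le, Real.sqrt_mul (by linarith)]
    have h1 : Real.sqrt (t₂ - m₀) ≠ 0 := (Real.sqrt_pos.2 hD).ne'
    have h2 : Real.sqrt lam ≠ 0 := (Real.sqrt_pos.2 hlam).ne'
    have h3 : Real.sqrt (t₂ - m₀) ^ 2 = t₂ - m₀ := Real.sq_sqrt hD.le
    field_simp
    nlinarith [h3]
  set E := Icc a b ∩ {x | t₁ ≤ u x ∧ u x ≤ t₂} with hE
  -- right of `x₀`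
  have hright : ∀ x ∈ E, ∀ y ∈ E, x ≤ y → x₀ ≤ x → y - x ≤ ℓ := by
    intro x hx y hy hxy h0x
    rcases eq_or_lt_of_le hxy with heq | hlt
    · rw [heq, sub_self, hℓ]; positivity
    have hy0 : 0 < y - x₀ := by linarith
    -- chord between `x₀` and `y` at `x`
    set θb := (x - x₀) / (y - x₀) with hθb
    set θa := (y - x) / (y - x₀) with hθa
    have hab : θa + θb = 1 := by rw [hθa, hθb]; field_simp; ring
    have ha : 0 ≤ θa := by rw [hθa]; positivity
    have hb : 0 ≤ θb := by rw [hθb]; exact div_nonneg (by linarith) hy0.le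
    have hxeq : θa * x₀ + θb * y = x := by rw [hθa, hθb]; field_simp; ring
    have h := hch x₀ hx₀ y hy.1 (by linarith) θa θb ha hb hab
    rw [hxeq] at h
    have hux : t₁ ≤ u x := hx.2.1
    have huy : u y ≤ t₂ := hy.2.2
    -- `t₁ ≤ θa m₀ + θb t₂` hence `θa (t₂ - m₀) ≤ t₂ - t₁`
    have key : θa * (t₂ - m₀) ≤ t₂ - t₁ := by
      have hnn : 0 ≤ lam / 2 * θa * θb * (y - x₀) ^ 2 := by positivity
      have h3 := mul_le_mul_of_nonneg_left huy hb
      have h4 : u x ≤ θa * m₀ + θb * t₂ := by rw [hm₀]; linarith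
      have h5 : θb = 1 - θa := by linarith
      rw [h5] at h4
      have h6 : θa * (t₂ - m₀) = θa * t₂ - θa * m₀ := by ring
      have h7 : (1 - θa) * t₂ = t₂ - θa * t₂ := by ring
      rw [h7] at h4
      linarith
    have hyx0 : y - x₀ ≤ R := by
      have := hRad y hy.1 huy; rwa [abs_of_pos hy0] at this
    have hθle : θa ≤ (t₂ - t₁) / (t₂ - m₀) := by rw [le_div_iff₀ hD]; exact key
    have hR0 : 0 ≤ R := by positivity
    calc y - x = θa * (y - x₀) := by rw [hθa]; field_simp
      _ ≤ θa * R := mul_le_mul_of_nonneg_left hyx0 ha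
      _ ≤ (t₂ - t₁) / (t₂ - m₀) * R := mul_le_mul_of_nonneg_right hθle hR0
      _ = ℓ := hℓR.symm
  -- left of `x₀`
  have hleft : ∀ x ∈ E, ∀ y ∈ E, x ≤ y → y ≤ x₀ → y - x ≤ ℓ := by
    intro x hx y hy hxy hy0'
    rcases eq_or_lt_of_le hxy with heq | hlt
    · rw [heq, sub_self, hℓ]; positivity
    have hx0 : 0 < x₀ - x := by linarith
    -- chord between `x` and `x₀` at `y`
    set θa := (x₀ - y) / (x₀ - x) with hθa
    set θb := (y - x) / (x₀ - x) with hθb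
    have hab : θa + θb = 1 := by rw [hθa, hθb]; field_simp; ring
    have ha : 0 ≤ θa := by rw [hθa]; exact div_nonneg (by linarith) hx0.le
    have hb : 0 ≤ θb := by rw [hθb]; positivity
    have hyeq : θa * x + θb * x₀ = y := by rw [hθa, hθb]; field_simp; ring
    have h := hch x hx.1 x₀ hx₀ (by linarith) θa θb ha hb hab
    rw [hyeq] at h
    have huy : t₁ ≤ u y := hy.2.1
    have hux : u x ≤ t₂ := hx.2.2
    have key : θb * (t₂ - m₀) ≤ t₂ - t₁ := by
      have hnn : 0 ≤ lam / 2 * θa * θb * (x₀ - x) ^ 2 := by positivity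
      have h3 := mul_le_mul_of_nonneg_left hux ha
      have h4 : u y ≤ θa * t₂ + θb * m₀ := by rw [hm₀]; linarith
      have h5 : θa = 1 - θb := by linarith
      rw [h5] at h4
      have h6 : θb * (t₂ - m₀) = θb * t₂ - θb * m₀ := by ring
      have h7 : (1 - θb) * t₂ = t₂ - θb * t₂ := by ring
      rw [h7] at h4
      linarith
    have hxx0 : x₀ - x ≤ R := by
      have := hRad x hx.1 hux; rwa [abs_sub_comm, abs_of_pos hx0] at this
    have hθle : θb ≤ (t₂ - t₁) / (t₂ - m₀) := by rw [le_div_iff₀ hD]; exact key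
    have hR0 : 0 ≤ R := by positivity
    calc y - x = θb * (x₀ - x) := by rw [hθb]; field_simp
      _ ≤ θb * R := mul_le_mul_of_nonneg_left hxx0 hb
      _ ≤ (t₂ - t₁) / (t₂ - m₀) * R := mul_le_mul_of_nonneg_right hθle hR0
      _ = ℓ := hℓR.symm
  -- two pieces
  have hsub : E ⊆ (E ∩ {x | x₀ ≤ x}) ∪ (E ∩ {x | x ≤ x₀}) := by
    intro x hx
    rcases le_total x₀ x with h | h
    · exact Or.inl ⟨hx, h⟩
    · exact Or.inr ⟨hx, h⟩
  have hdiam : ∀ (F : Set ℝ), (∀ x ∈ F, ∀ y ∈ F, x ≤ y → y - x ≤ ℓ) →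
      volume F ≤ ENNReal.ofReal ℓ := by
    intro F hF
    calc volume F ≤ Metric.ediam F := Real.volume_le_diam _
      _ ≤ ENNReal.ofReal ℓ := by
          refine Metric.ediam_le ?_
          intro x hx y hy
          rw [edist_dist, Real.dist_eq]
          refine ENNReal.ofReal_le_ofReal ?_
          rcases le_total x y with h | h
          · rw [abs_sub_comm, abs_of_nonneg (by linarith)]; exact hF x hx y hy h
          · rw [abs_of_nonneg (by linarith)]; exact hF y hy x hx h
  have h1 : volume (E ∩ {x | x₀ ≤ x}) ≤ ENNReal.ofReal ℓ :=
    hdiam _ fun x hx y hy hxy => hright x hx.1 y hy.1 hxy hx.2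
  have h2 : volume (E ∩ {x | x ≤ x₀}) ≤ ENNReal.ofReal ℓ :=
    hdiam _ fun x hx y hy hxy => hleft x hx.1 y hy.1 hxy hy.2
  calc volume E ≤ volume ((E ∩ {x | x₀ ≤ x}) ∪ (E ∩ {x | x ≤ x₀})) := measure_mono hsub
    _ ≤ volume (E ∩ {x | x₀ ≤ x}) + volume (E ∩ {x | x ≤ x₀}) := measure_union_le _ _
    _ ≤ ENNReal.ofReal ℓ + ENNReal.ofReal ℓ := add_le_add h1 h2
    _ = 2 * ENNReal.ofReal ℓ := by ring

/-- The sub-level set version (`t₁ = -∞`): `vol{x ∈ [a,b] : u(x) ≤ t₂} ≤ 4 √((t₂ - m₀)/λ)`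
(quadratic growth away from the minimiser). [cite: FeldmanSalmhoferTrubowitz1998, App. B (arXiv p.35 L47–60)] -/
theorem volume_sublevel_le_of_chord {u : ℝ → ℝ} {a b lam t₂ x₀ : ℝ} (hlam : 0 < lam)
    (hch : ∀ x ∈ Icc a b, ∀ y ∈ Icc a b, x ≤ y → ∀ θa θb : ℝ, 0 ≤ θa → 0 ≤ θb → θa + θb = 1 →
      u (θa * x + θb * y) ≤ θa * u x + θb * u y - lam / 2 * θa * θb * (y - x) ^ 2)
    (hx₀ : x₀ ∈ Icc a b) (hmin : ∀ x ∈ Icc a b, u x₀ ≤ u x) :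
    volume (Icc a b ∩ {x | u x ≤ t₂}) ≤
      ENNReal.ofReal (4 * Real.sqrt ((t₂ - u x₀) / lam)) := by
  set m₀ := u x₀ with hm₀
  have hgrow : ∀ x ∈ Icc a b, lam / 4 * (x - x₀) ^ 2 ≤ u x - m₀ := by
    intro x hx
    rcases le_total x₀ x with h0x | hx0
    · have h := hch x₀ hx₀ x hx h0x (1 / 2) (1 / 2) (by norm_num) (by norm_num) (by norm_num)
      have hmid : (1 / 2 : ℝ) * x₀ + 1 / 2 * x ∈ Icc a b :=
        ⟨by linarith [hx₀.1, hx.1], by linarith [hx₀.2, hx.2]⟩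
      have hm := hmin _ hmid
      nlinarith
    · have h := hch x hx x₀ hx₀ hx0 (1 / 2) (1 / 2) (by norm_num) (by norm_num) (by norm_num)
      have hmid : (1 / 2 : ℝ) * x + 1 / 2 * x₀ ∈ Icc a b :=
        ⟨by linarith [hx₀.1, hx.1], by linarith [hx₀.2, hx.2]⟩
      have hm := hmin _ hmid
      nlinarith
  have hRad : ∀ x ∈ Icc a b, u x ≤ t₂ → |x - x₀| ≤ 2 * Real.sqrt ((t₂ - m₀) / lam) := by
    intro x hx hxt
    have h1 : (x - x₀) ^ 2 ≤ 4 * ((t₂ - m₀) / lam) := by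
      rw [mul_div_assoc', le_div_iff₀ hlam]
      nlinarith [hgrow x hx]
    calc |x - x₀| = Real.sqrt ((x - x₀) ^ 2) := (Real.sqrt_sq_eq_abs _).symm
      _ ≤ Real.sqrt (4 * ((t₂ - m₀) / lam)) := Real.sqrt_le_sqrt h1
      _ = 2 * Real.sqrt ((t₂ - m₀) / lam) := by
          rw [Real.sqrt_mul (by norm_num), show Real.sqrt 4 = 2 by
            rw [show (4 : ℝ) = 2 ^ 2 by norm_num, Real.sqrt_sq (by norm_num)]]
  calc volume (Icc a b ∩ {x | u x ≤ t₂}) ≤ Metric.ediam (Icc a b ∩ {x | u x ≤ t₂}) :=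
        Real.volume_le_diam _
    _ ≤ ENNReal.ofReal (4 * Real.sqrt ((t₂ - m₀) / lam)) := by
        refine Metric.ediam_le ?_
        rintro x ⟨hx, hxt⟩ y ⟨hy, hyt⟩
        rw [edist_dist, Real.dist_eq]
        refine ENNReal.ofReal_le_ofReal ?_
        have h1 := hRad x hx hxt
        have h2 := hRad y hy hyt
        calc |x - y| = |(x - x₀) - (y - x₀)| := by ring_nf
          _ ≤ |x - x₀| + |y - x₀| := abs_sub _ _
          _ ≤ _ := by linarith

end ConvexSlice


/-! ### A quantitative hyperbolic (saddle) bound by slicing -/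

section Saddle

variable {ν : ℝ × ℝ → ℝ}

/-- Uniform band bound for chord functions: `vol{t₁ ≤ u ≤ t₂} ≤ 4 √((t₂ - t₁)/λ)`. [folklore] -/
private theorem volume_band_le_of_chord_unif {u : ℝ → ℝ} {a b lam t₁ t₂ x₀ : ℝ} (hlam : 0 < lam)
    (ht : t₁ ≤ t₂)
    (hch : ∀ x ∈ Icc a b, ∀ y ∈ Icc a b, x ≤ y → ∀ θa θb : ℝ, 0 ≤ θa → 0 ≤ θb → θa + θb = 1 →
      u (θa * x + θb * y) ≤ θa * u x + θb * u y - lam / 2 * θa * θb * (y - x) ^ 2)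
    (hx₀ : x₀ ∈ Icc a b) (hmin : ∀ x ∈ Icc a b, u x₀ ≤ u x) :
    volume (Icc a b ∩ {x | t₁ ≤ u x ∧ u x ≤ t₂}) ≤
      ENNReal.ofReal (4 * Real.sqrt ((t₂ - t₁) / lam)) := by
  by_cases hD : t₂ - u x₀ ≤ t₂ - t₁
  · calc volume (Icc a b ∩ {x | t₁ ≤ u x ∧ u x ≤ t₂}) ≤ volume (Icc a b ∩ {x | u x ≤ t₂}) :=
          measure_mono fun x hx => ⟨hx.1, hx.2.2⟩
      _ ≤ ENNReal.ofReal (4 * Real.sqrt ((t₂ - u x₀) / lam)) :=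
          volume_sublevel_le_of_chord hlam hch hx₀ hmin
      _ ≤ ENNReal.ofReal (4 * Real.sqrt ((t₂ - t₁) / lam)) := by
          refine ENNReal.ofReal_le_ofReal ?_
          gcongr
  · push Not at hD
    have ht₂ : u x₀ < t₂ := by linarith
    set s := t₂ - t₁ with hs
    set D := t₂ - u x₀ with hD'
    have hs0 : 0 ≤ s := by linarith
    have hD0 : 0 < D := by linarith
    have hreal : 2 * (2 * s / Real.sqrt (lam * D)) ≤ 4 * Real.sqrt (s / lam) := by
      have hsq : Real.sqrt (s / lam) * Real.sqrt (lam * D) = Real.sqrt (s * D) := by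
        rw [← Real.sqrt_mul (div_nonneg hs0 hlam.le)]
        congr 1; field_simp
      have hpos : 0 < Real.sqrt (lam * D) := Real.sqrt_pos.2 (by positivity)
      have h1 : s ≤ Real.sqrt (s / lam) * Real.sqrt (lam * D) := by
        rw [hsq]
        calc s = Real.sqrt (s ^ 2) := (Real.sqrt_sq hs0).symm
          _ ≤ Real.sqrt (s * D) := Real.sqrt_le_sqrt (by nlinarith)
      rw [show 2 * (2 * s / Real.sqrt (lam * D)) = 4 * (s / Real.sqrt (lam * D)) by ring]
      refine mul_le_mul_of_nonneg_left ?_ (by norm_num)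
      rw [div_le_iff₀ hpos]
      exact h1
    calc volume (Icc a b ∩ {x | t₁ ≤ u x ∧ u x ≤ t₂})
        ≤ 2 * ENNReal.ofReal (2 * (t₂ - t₁) / Real.sqrt (lam * (t₂ - u x₀))) :=
          volume_band_le_of_chord hlam ht hch hx₀ hmin ht₂
      _ = ENNReal.ofReal (2 * (2 * s / Real.sqrt (lam * D))) := by
          rw [ENNReal.ofReal_mul (by norm_num : (0:ℝ) ≤ 2), show ENNReal.ofReal 2 = 2 by simp]
      _ ≤ ENNReal.ofReal (4 * Real.sqrt (s / lam)) := ENNReal.ofReal_le_ofReal hreal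

/-- Dyadic band bound for chord functions: `vol{t < u ≤ 4t} ≤ 12 √t/√λ`. [folklore] -/
private theorem volume_dyadic_band_le_of_chord {u : ℝ → ℝ} {a b lam t x₀ : ℝ} (hlam : 0 < lam)
    (ht : 0 < t)
    (hch : ∀ x ∈ Icc a b, ∀ y ∈ Icc a b, x ≤ y → ∀ θa θb : ℝ, 0 ≤ θa → 0 ≤ θb → θa + θb = 1 →
      u (θa * x + θb * y) ≤ θa * u x + θb * u y - lam / 2 * θa * θb * (y - x) ^ 2)
    (hx₀ : x₀ ∈ Icc a b) (hmin : ∀ x ∈ Icc a b, u x₀ ≤ u x) :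
    volume (Icc a b ∩ {x | t < u x ∧ u x ≤ 4 * t}) ≤
      ENNReal.ofReal (12 * Real.sqrt t / Real.sqrt lam) := by
  have hsub1 : Icc a b ∩ {x | t < u x ∧ u x ≤ 4 * t} ⊆ Icc a b ∩ {x | u x ≤ 4 * t} :=
    fun x hx => ⟨hx.1, hx.2.2⟩
  have hsl := volume_sublevel_le_of_chord (t₂ := 4 * t) hlam hch hx₀ hmin
  have hsql : 0 < Real.sqrt lam := Real.sqrt_pos.2 hlam
  set D := 4 * t - u x₀ with hD
  by_cases hDt : t ≤ D
  · -- band lemma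
    have ht₂ : u x₀ < 4 * t := by linarith
    have h := volume_band_le_of_chord (t₁ := t) (t₂ := 4 * t) hlam (by linarith) hch hx₀ hmin ht₂
    have hsub2 : Icc a b ∩ {x | t < u x ∧ u x ≤ 4 * t} ⊆ Icc a b ∩ {x | t ≤ u x ∧ u x ≤ 4 * t} :=
      fun x hx => ⟨hx.1, hx.2.1.le, hx.2.2⟩
    have hreal : 2 * (2 * (4 * t - t) / Real.sqrt (lam * D)) ≤ 12 * Real.sqrt t / Real.sqrt lam := by
      have h1 : Real.sqrt (lam * t) ≤ Real.sqrt (lam * D) :=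
        Real.sqrt_le_sqrt (by nlinarith)
      have h2 : 0 < Real.sqrt (lam * t) := Real.sqrt_pos.2 (by positivity)
      have h3 : Real.sqrt (lam * t) = Real.sqrt lam * Real.sqrt t := Real.sqrt_mul hlam.le t
      have h4 : Real.sqrt t * Real.sqrt t = t := Real.mul_self_sqrt ht.le
      calc 2 * (2 * (4 * t - t) / Real.sqrt (lam * D)) = 12 * t / Real.sqrt (lam * D) := by ring
        _ ≤ 12 * t / Real.sqrt (lam * t) := by gcongr
        _ = 12 * Real.sqrt t / Real.sqrt lam := by
            rw [h3, div_eq_div_iff (by positivity) hsql.ne']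
            nlinarith [h4]
    calc volume (Icc a b ∩ {x | t < u x ∧ u x ≤ 4 * t})
        ≤ volume (Icc a b ∩ {x | t ≤ u x ∧ u x ≤ 4 * t}) := measure_mono hsub2
      _ ≤ 2 * ENNReal.ofReal (2 * (4 * t - t) / Real.sqrt (lam * (4 * t - u x₀))) := h
      _ = ENNReal.ofReal (2 * (2 * (4 * t - t) / Real.sqrt (lam * D))) := by
          rw [ENNReal.ofReal_mul (by norm_num : (0:ℝ) ≤ 2), show ENNReal.ofReal 2 = 2 by simp]
      _ ≤ _ := ENNReal.ofReal_le_ofReal hreal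
  · push Not at hDt
    have hreal : 4 * Real.sqrt ((4 * t - u x₀) / lam) ≤ 12 * Real.sqrt t / Real.sqrt lam := by
      rw [← hD]
      have h1 : Real.sqrt D ≤ Real.sqrt t := Real.sqrt_le_sqrt hDt.le
      have h2 : Real.sqrt D / Real.sqrt lam ≤ Real.sqrt t / Real.sqrt lam :=
        div_le_div_of_nonneg_right h1 hsql.le
      have h0 : 0 ≤ Real.sqrt t / Real.sqrt lam := by positivity
      calc 4 * Real.sqrt (D / lam) = 4 * (Real.sqrt D / Real.sqrt lam) := by
            rw [Real.sqrt_div' _ hlam.le]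
        _ ≤ 4 * (Real.sqrt t / Real.sqrt lam) := by linarith
        _ ≤ 12 * Real.sqrt t / Real.sqrt lam := by rw [mul_div_assoc]; linarith
    calc volume (Icc a b ∩ {x | t < u x ∧ u x ≤ 4 * t}) ≤ volume (Icc a b ∩ {x | u x ≤ 4 * t}) :=
          measure_mono hsub1
      _ ≤ ENNReal.ofReal (4 * Real.sqrt ((4 * t - u x₀) / lam)) := hsl
      _ ≤ _ := ENNReal.ofReal_le_ofReal hreal

/-- Along a line: `t ↦ ν (p₀ + t v)` has derivative `Dν(p₀ + t v) v`. [folklore] -/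
private theorem hasDerivAt_line (hν : ContDiff ℝ 2 ν) (p₀ v : ℝ × ℝ) (s : ℝ) :
    HasDerivAt (fun t : ℝ => ν (p₀ + t • v)) (fderiv ℝ ν (p₀ + s • v) v) s := by
  have h1 : HasDerivAt (fun t : ℝ => p₀ + t • v) ((1 : ℝ) • v) s :=
    ((hasDerivAt_id s).smul_const v).const_add p₀
  rw [one_smul] at h1
  exact ((hν.differentiable (by norm_num)) (p₀ + s • v)).hasFDerivAt.comp_hasDerivAt s h1

/-- Along a line: `t ↦ Dν(p₀ + t v) w` has derivative `D²ν(p₀ + t v)(v)(w)`. [folklore] -/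
private theorem hasDerivAt_line_fderiv (hν : ContDiff ℝ 2 ν) (p₀ v w : ℝ × ℝ) (s : ℝ) :
    HasDerivAt (fun t : ℝ => fderiv ℝ ν (p₀ + t • v) w) (fderiv ℝ (fderiv ℝ ν) (p₀ + s • v) v w) s := by
  have h1 : HasDerivAt (fun t : ℝ => p₀ + t • v) ((1 : ℝ) • v) s :=
    ((hasDerivAt_id s).smul_const v).const_add p₀
  rw [one_smul] at h1
  have h2 := hasFDerivAt_partial_of_contDiff hν w (p₀ + s • v)
  have h3 : HasDerivAt ((fun q => fderiv ℝ ν q w) ∘ fun t : ℝ => p₀ + t • v)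
      (((fderiv ℝ (fderiv ℝ ν) (p₀ + s • v)).flip w) v) s := h2.comp_hasDerivAt s h1
  rw [ContinuousLinearMap.flip_apply] at h3
  exact h3

/-- A `λ`-increasing derivative along a segment, from a second-derivative lower bound. [folklore] -/
private theorem uniformMono_of_hess (hν : ContDiff ℝ 2 ν) (p₀ v : ℝ × ℝ) {a b lam : ℝ}
    (hH : ∀ t ∈ Icc a b, lam ≤ fderiv ℝ (fderiv ℝ ν) (p₀ + t • v) v v) :
    ∀ t₁ ∈ Icc a b, ∀ t₂ ∈ Icc a b, t₁ ≤ t₂ →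
      lam * (t₂ - t₁) ≤ fderiv ℝ ν (p₀ + t₂ • v) v - fderiv ℝ ν (p₀ + t₁ • v) v := by
  have hmono : MonotoneOn (fun t : ℝ => fderiv ℝ ν (p₀ + t • v) v - lam * t) (Icc a b) := by
    have hcont : ContinuousOn (fun t : ℝ => fderiv ℝ ν (p₀ + t • v) v - lam * t) (Icc a b) :=
      fun t _ => ((hasDerivAt_line_fderiv hν p₀ v v t).sub
        ((hasDerivAt_id t).const_mul lam)).continuousAt.continuousWithinAt
    refine monotoneOn_of_hasDerivWithinAt_nonneg (convex_Icc a b) hcont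
      (f' := fun t => fderiv ℝ (fderiv ℝ ν) (p₀ + t • v) v v - lam) ?_ ?_
    · intro t ht
      rw [interior_Icc] at ht ⊢
      exact (((hasDerivAt_line_fderiv hν p₀ v v t).sub
        ((hasDerivAt_id t).const_mul lam)).hasDerivWithinAt).congr_deriv (by simp)
    · intro t ht
      rw [interior_Icc] at ht
      have := hH t (Ioo_subset_Icc_self ht)
      linarith
  intro t₁ h₁ t₂ h₂ h12
  have h := hmono h₁ h₂ h12
  simp only at h
  linarith

/-- **A quantitative bound for the sub-level band of a saddle** — the hyperbolic singular region
of [II] App. B with constants depending ONLY on quantitative data (the form needed for the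
uniformity in `q ∈ 𝒫_κ`, p.34 L40–58; cf. the module docstring, "UNIFORMITY"): if
`ν ∈ C²(ℝ²)` satisfies `∂₂²ν ≥ λ` and `∂₁²ν ≤ -λ` on the box `[-σ,σ]²` (`λ > 0`; no critical point
and no normal form is assumed) and oscillates by at most `Ω` there, then for every level `f₀`,
every `ε > 0` and every `K ∈ ℕ` with `Ω + ε ≤ 2ε·4^K` (so `K ≈ log₄((Ω+ε)/2ε)`),
`vol{p ∈ [-σ,σ]² : |f₀ + ν p| ≤ ε} ≤ (32 + 48 K) ε/λ`. Proof by slicing (Tonelli): each slice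
`φ₂ ↦ ν(φ₁,φ₂)` is uniformly convex, its band has length `≤ 4√(ε/λ)` and, at distance `u`
above the slice minimum, `≤ 4ε/√(λu)` (`volume_band_le_of_deriv_uniformMono(_of_gap)`); the
marginal `u(φ₁) = -f₀ - min_{φ₂} ν(φ₁,φ₂)` satisfies the `λ`-chord inequality
(`chord_sSup_of_forall`), so its dyadic level bands `{2ε4^k < u ≤ 2ε4^{k+1}}` have length
`≤ 12√(2ε4^k/λ)` (`volume_band_le_of_chord`) — each dyadic shell contributes `≤ 48ε/λ`, the
bottom `{-ε ≤ u ≤ 2ε}` contributes `≤ 32ε/λ`, and slices with `u ∉ [-ε, Ω + ε]` are empty.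
[cite: FeldmanSalmhoferTrubowitz1998, App. B (arXiv p.35 L47–112)] -/
theorem volume_band_le_of_saddle (hν : ContDiff ℝ 2 ν) {σ lam Ω : ℝ} (hσ : 0 < σ) (hlam : 0 < lam)
    (hyy : ∀ p ∈ Icc (-σ) σ ×ˢ Icc (-σ) σ,
      lam ≤ fderiv ℝ (fderiv ℝ ν) p ((0 : ℝ), (1 : ℝ)) ((0 : ℝ), (1 : ℝ)))
    (hxx : ∀ p ∈ Icc (-σ) σ ×ˢ Icc (-σ) σ,
      fderiv ℝ (fderiv ℝ ν) p ((1 : ℝ), (0 : ℝ)) ((1 : ℝ), (0 : ℝ)) ≤ -lam)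
    (hosc : ∀ p ∈ Icc (-σ) σ ×ˢ Icc (-σ) σ, ∀ q ∈ Icc (-σ) σ ×ˢ Icc (-σ) σ, ν p - ν q ≤ Ω)
    (f₀ ε : ℝ) (hε : 0 < ε) (K : ℕ) (hK : Ω + ε ≤ 2 * ε * 4 ^ K) :
    volume ((Icc (-σ) σ ×ˢ Icc (-σ) σ) ∩ {p : ℝ × ℝ | |f₀ + ν p| ≤ ε}) ≤
      ENNReal.ofReal ((32 + 48 * K) * ε / lam) := by
  set J := Icc (-σ) σ with hJ
  have hJc : IsCompact J := isCompact_Icc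
  have hJne : J.Nonempty := ⟨0, by rw [hJ]; exact ⟨by linarith, by linarith⟩⟩
  set c := -f₀ with hc
  set W := (J ×ˢ J) ∩ {p : ℝ × ℝ | |f₀ + ν p| ≤ ε} with hW
  have hWm : MeasurableSet W :=
    (measurableSet_Icc.prod measurableSet_Icc).inter
      (isClosed_le (continuous_abs.comp (continuous_const.add hν.continuous))
        continuous_const).measurableSet
  -- coordinates
  have exy : ∀ x y : ℝ, ((x, (0 : ℝ)) + y • ((0 : ℝ), (1 : ℝ)) : ℝ × ℝ) = (x, y) := by
    intro x y; ext <;> simp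
  have eyx : ∀ x y : ℝ, ((((0 : ℝ), y) + x • ((1 : ℝ), (0 : ℝ))) : ℝ × ℝ) = (x, y) := by
    intro x y; ext <;> simp
  -- the marginal `u x = sup_y (c - ν (x, y))`
  set u : ℝ → ℝ := fun x => sSup ((fun y => c - ν (x, y)) '' J) with hu
  have hu_cont : Continuous u := by
    have h := hJc.continuous_sSup (f := fun x y => c - ν (x, y)) (by
      show Continuous fun p : ℝ × ℝ => c - ν (p.1, p.2)
      exact continuous_const.sub (hν.continuous.comp (by fun_prop)))
    exact h
  have hbdd : ∀ x : ℝ, BddAbove ((fun y => c - ν (x, y)) '' J) := fun x =>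
    (hJc.image_of_continuousOn ((continuous_const.sub (hν.continuous.comp
      (continuous_const.prodMk continuous_id))).continuousOn)).bddAbove
  -- slice minimisers and `u x = c - min`
  have hslice_min : ∀ x : ℝ, ∃ y₀ ∈ J, (∀ y ∈ J, ν (x, y₀) ≤ ν (x, y)) ∧ u x = c - ν (x, y₀) := by
    intro x
    have hcy : ContinuousOn (fun y : ℝ => ν (x, y)) J :=
      (hν.continuous.comp (continuous_const.prodMk continuous_id)).continuousOn
    obtain ⟨y₀, hy₀, hmin⟩ := hJc.exists_isMinOn hJne hcy
    have hmin' : ∀ y ∈ J, ν (x, y₀) ≤ ν (x, y) := fun y hy => (isMinOn_iff.1 hmin) y hy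
    refine ⟨y₀, hy₀, hmin', ?_⟩
    refine IsGreatest.csSup_eq ⟨⟨y₀, hy₀, rfl⟩, ?_⟩
    rintro _ ⟨y, hy, rfl⟩
    have := hmin' y hy
    simp only
    linarith
  -- the chord inequality for `u` on `J`
  have hu_chord : ∀ x ∈ J, ∀ y ∈ J, x ≤ y → ∀ θa θb : ℝ, 0 ≤ θa → 0 ≤ θb → θa + θb = 1 →
      u (θa * x + θb * y) ≤ θa * u x + θb * u y - lam / 2 * θa * θb * (y - x) ^ 2 := by
    have h := chord_sSup_of_forall (K := J) hJne (g := fun yy x => c - ν (x, yy)) (a := -σ) (b := σ)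
      (lam := lam) ?_ (fun x _ => hbdd x)
    · exact h
    intro yy hyy x hx y hy hxy θa θb ha hb hab
    -- `x ↦ c - ν (x, yy)` has `λ`-increasing derivative `-∂₁ν`
    have hd : ∀ x ∈ Icc (-σ) σ, HasDerivAt (fun x => c - ν (x, yy))
        (-(fderiv ℝ ν (((0 : ℝ), yy) + x • ((1 : ℝ), (0 : ℝ))) ((1 : ℝ), (0 : ℝ)))) x := by
      intro x _
      have h1 := (hasDerivAt_line hν ((0 : ℝ), yy) ((1 : ℝ), (0 : ℝ)) x).const_sub c
      refine h1.congr_of_eventuallyEq ?_ |>.congr_deriv rfl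
      exact Filter.Eventually.of_forall fun x => by simp
    have hm : ∀ x₁ ∈ Icc (-σ) σ, ∀ x₂ ∈ Icc (-σ) σ, x₁ ≤ x₂ →
        lam * (x₂ - x₁) ≤ -(fderiv ℝ ν (((0 : ℝ), yy) + x₂ • ((1 : ℝ), (0 : ℝ))) ((1 : ℝ), (0 : ℝ))) -
          -(fderiv ℝ ν (((0 : ℝ), yy) + x₁ • ((1 : ℝ), (0 : ℝ))) ((1 : ℝ), (0 : ℝ))) := by
      have hneg := uniformMono_of_hess (ν := fun p => -ν p) hν.neg ((0 : ℝ), yy) ((1 : ℝ), (0 : ℝ))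
        (a := -σ) (b := σ) (lam := lam) ?_
      · intro x₁ h₁ x₂ h₂ h12
        have h := hneg x₁ h₁ x₂ h₂ h12
        have e : ∀ q : ℝ × ℝ, fderiv ℝ (fun p => -ν p) q = -fderiv ℝ ν q := fun q => by
          rw [show (fun p => -ν p) = -ν from rfl, fderiv_neg]
        simp only [e, neg_apply] at h
        exact h
      · intro t ht
        have e2 : fderiv ℝ (fderiv ℝ (fun p => -ν p)) (((0 : ℝ), yy) + t • ((1 : ℝ), (0 : ℝ))) =
            -fderiv ℝ (fderiv ℝ ν) (((0 : ℝ), yy) + t • ((1 : ℝ), (0 : ℝ))) := by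
          rw [show (fderiv ℝ (fun p => -ν p)) = -fderiv ℝ ν from by
            funext q; rw [show (fun p => -ν p) = -ν from rfl, fderiv_neg]; rfl]
          rw [fderiv_neg]
        rw [e2, neg_apply, neg_apply, eyx]
        have := hxx (t, yy) ⟨ht, hyy⟩
        linarith
    exact strongConvex_chord_of_deriv_uniformMono hd hm hx hy hxy ha hb hab
  -- a minimiser of `u` on `J`
  obtain ⟨x₀, hx₀, hx₀min⟩ := hJc.exists_isMinOn hJne hu_cont.continuousOn
  have hmin0 : ∀ x ∈ J, u x₀ ≤ u x := fun x hx => (isMinOn_iff.1 hx₀min) x hx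
  -- slice bounds
  set A : ℝ≥0∞ := ENNReal.ofReal (4 * Real.sqrt (ε / lam)) with hA
  set tk : ℕ → ℝ := fun k => 2 * ε * 4 ^ k with htk
  have htk_pos : ∀ k, 0 < tk k := fun k => by simp only [htk]; positivity
  set Bk : ℕ → ℝ≥0∞ := fun k => ENNReal.ofReal (4 * ε / (Real.sqrt lam * Real.sqrt (tk k))) with hBk
  have hslice : ∀ x ∈ J,
      (volume (Prod.mk x ⁻¹' W) ≤ A) ∧
      (∀ k, tk k < u x → volume (Prod.mk x ⁻¹' W) ≤ Bk k) ∧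
      (u x < -ε → Prod.mk x ⁻¹' W = ∅) ∧ (Ω + ε < u x → Prod.mk x ⁻¹' W = ∅) := by
    intro x hx
    obtain ⟨y₀, hy₀, hy₀min, hux⟩ := hslice_min x
    have hsec : Prod.mk x ⁻¹' W = J ∩ {y | |ν (x, y) - c| ≤ ε} := by
      ext y
      simp only [hW, mem_preimage, mem_inter_iff, mem_prod, mem_setOf_eq, hc]
      rw [show f₀ + ν (x, y) = ν (x, y) - -f₀ by ring]
      tauto
    -- slice derivative data
    have hd : ∀ y ∈ Icc (-σ) σ, HasDerivAt (fun y => ν (x, y))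
        (fderiv ℝ ν ((x, (0 : ℝ)) + y • ((0 : ℝ), (1 : ℝ))) ((0 : ℝ), (1 : ℝ))) y := by
      intro y _
      have h1 := hasDerivAt_line hν (x, (0 : ℝ)) ((0 : ℝ), (1 : ℝ)) y
      refine h1.congr_of_eventuallyEq ?_
      exact Filter.Eventually.of_forall fun y => by simp
    have hm : ∀ y₁ ∈ Icc (-σ) σ, ∀ y₂ ∈ Icc (-σ) σ, y₁ ≤ y₂ →
        lam * (y₂ - y₁) ≤ fderiv ℝ ν ((x, (0 : ℝ)) + y₂ • ((0 : ℝ), (1 : ℝ))) ((0 : ℝ), (1 : ℝ)) -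
          fderiv ℝ ν ((x, (0 : ℝ)) + y₁ • ((0 : ℝ), (1 : ℝ))) ((0 : ℝ), (1 : ℝ)) :=
      uniformMono_of_hess hν (x, (0 : ℝ)) ((0 : ℝ), (1 : ℝ)) fun t ht => by
        rw [exy]; exact hyy (x, t) ⟨hx, ht⟩
    refine ⟨?_, ?_, ?_, ?_⟩
    · -- bound A
      rw [hsec]
      have h := volume_band_le_of_deriv_uniformMono (t₁ := c - ε) (t₂ := c + ε) hlam hd hm
      have hset : J ∩ {y | |ν (x, y) - c| ≤ ε} = Icc (-σ) σ ∩ {y | c - ε ≤ ν (x, y) ∧ ν (x, y) ≤ c + ε} := by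
        ext y; simp only [hJ, mem_inter_iff, mem_setOf_eq, abs_le]; constructor
        · rintro ⟨h1, h2, h3⟩; exact ⟨h1, by linarith, by linarith⟩
        · rintro ⟨h1, h2, h3⟩; exact ⟨h1, by linarith, by linarith⟩
      rw [hset]
      refine h.trans ?_
      rw [hA, show (2 : ℝ≥0∞) = ENNReal.ofReal 2 by simp, ← ENNReal.ofReal_mul (by norm_num)]
      refine ENNReal.ofReal_le_ofReal (le_of_eq ?_)
      rw [show c + ε - (c - ε) = 2 * (2 * ε) / 2 by ring]
      rw [show 2 * (2 * (2 * ε) / 2) / lam = 4 * (ε / lam) by ring, Real.sqrt_mul' _ (by positivity),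
        show Real.sqrt 4 = 2 by rw [show (4:ℝ) = 2 ^ 2 by norm_num, Real.sqrt_sq (by norm_num)]]
      ring
    · -- bound B
      intro k hk
      rw [hsec]
      have hgap : 0 < c - ε - ν (x, y₀) := by
        have : u x = c - ν (x, y₀) := hux
        have h2ε : 2 * ε ≤ tk k := by
          simp only [htk]
          have : (1 : ℝ) ≤ 4 ^ k := one_le_pow₀ (by norm_num)
          nlinarith
        linarith
      have h := volume_band_le_of_deriv_uniformMono_of_gap (c := c) (ε := ε) hlam hd hm hy₀ hgap
      refine h.trans ?_
      rw [hBk, show (2 : ℝ≥0∞) = ENNReal.ofReal 2 by simp, ← ENNReal.ofReal_mul (by norm_num)]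
      refine ENNReal.ofReal_le_ofReal ?_
      -- `2 (2ε/√(2λ(u-ε))) ≤ 4ε/(√λ √t_k)` since `2(u - ε) ≥ u > t_k`
      have hux' : c - ε - ν (x, y₀) = u x - ε := by rw [hux]; ring
      rw [hux']
      have h1 : lam * tk k ≤ 2 * lam * (u x - ε) := by
        have h2ε : 2 * ε ≤ tk k := by
          simp only [htk]
          have : (1 : ℝ) ≤ 4 ^ k := one_le_pow₀ (by norm_num)
          nlinarith
        nlinarith
      have h2 : Real.sqrt lam * Real.sqrt (tk k) ≤ Real.sqrt (2 * lam * (u x - ε)) := by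
        rw [← Real.sqrt_mul hlam.le]; exact Real.sqrt_le_sqrt h1
      have h3 : 0 < Real.sqrt lam * Real.sqrt (tk k) := by
        have := htk_pos k; positivity
      calc 2 * (2 * ε / Real.sqrt (2 * lam * (u x - ε))) = 4 * ε / Real.sqrt (2 * lam * (u x - ε)) := by
            ring
        _ ≤ 4 * ε / (Real.sqrt lam * Real.sqrt (tk k)) := by gcongr
    · -- empty below
      intro hlt
      rw [hsec]
      ext y
      simp only [mem_inter_iff, mem_setOf_eq, mem_empty_iff_false, iff_false, not_and, not_le]
      intro hy
      have h1 := hy₀min y hy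
      have : u x = c - ν (x, y₀) := hux
      rw [abs_sub_comm]  -- |c - ν| hmm
      rw [abs_sub_comm]
      have : ε < ν (x, y) - c := by linarith
      calc ε < ν (x, y) - c := this
        _ ≤ |ν (x, y) - c| := le_abs_self _
    · -- empty above
      intro hgt
      rw [hsec]
      ext y
      simp only [mem_inter_iff, mem_setOf_eq, mem_empty_iff_false, iff_false, not_and, not_le]
      intro hy
      have h1 := hosc (x, y) ⟨hx, hy⟩ (x, y₀) ⟨hx, hy₀⟩
      have : u x = c - ν (x, y₀) := hux
      have h2 : ε < c - ν (x, y) := by linarith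
      calc ε < c - ν (x, y) := h2
        _ ≤ |ν (x, y) - c| := by rw [abs_sub_comm]; exact le_abs_self _
  -- the majorant
  set L : Set ℝ := J ∩ {x | -ε ≤ u x ∧ u x ≤ 2 * ε} with hL
  set Dk : ℕ → Set ℝ := fun k => J ∩ {x | tk k < u x ∧ u x ≤ 4 * tk k} with hDk
  have hLm : MeasurableSet L :=
    measurableSet_Icc.inter ((isClosed_le continuous_const hu_cont).inter
      (isClosed_le hu_cont continuous_const)).measurableSet
  have hDkm : ∀ k, MeasurableSet (Dk k) := fun k =>
    measurableSet_Icc.inter ((isOpen_lt continuous_const hu_cont).measurableSet.inter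
      (isClosed_le hu_cont continuous_const).measurableSet)
  set Φ : ℝ → ℝ≥0∞ := fun x => L.indicator (fun _ => A) x +
    ∑ k ∈ Finset.range K, (Dk k).indicator (fun _ => Bk k) x with hΦ
  have hpt : ∀ x, volume (Prod.mk x ⁻¹' W) ≤ Φ x := by
    intro x
    by_cases hx : x ∈ J
    swap
    · have : Prod.mk x ⁻¹' W = ∅ := by
        ext y
        simp only [hW, mem_preimage, mem_inter_iff, mem_prod, mem_empty_iff_false, iff_false, not_and]
        exact fun h _ => absurd h.1 hx
      rw [this, measure_empty]; exact zero_le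
    obtain ⟨hAx, hBx, hlow, hhigh⟩ := hslice x hx
    by_cases h1 : u x < -ε
    · rw [hlow h1, measure_empty]; exact zero_le
    by_cases h2 : Ω + ε < u x
    · rw [hhigh h2, measure_empty]; exact zero_le
    push Not at h1 h2
    by_cases h3 : u x ≤ 2 * ε
    · -- the bottom layer
      have hxL : x ∈ L := ⟨hx, h1, h3⟩
      calc volume (Prod.mk x ⁻¹' W) ≤ A := hAx
        _ = L.indicator (fun _ => A) x := (indicator_of_mem hxL (fun _ => A)).symm
        _ ≤ Φ x := le_self_add
    · push Not at h3
      -- find the dyadic shell: minimal `k` with `u x ≤ 4 t_k`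
      have hK0 : 0 < K := by
        rcases Nat.eq_zero_or_pos K with h0 | h0
        · exfalso; rw [h0, pow_zero, mul_one] at hK; linarith
        · exact h0
      have hex : ∃ k, u x ≤ 4 * tk k := ⟨K - 1, by
        have : 4 * tk (K - 1) = 2 * ε * 4 ^ K := by
          simp only [htk]
          rw [show (4 : ℝ) * (2 * ε * 4 ^ (K - 1)) = 2 * ε * (4 ^ (K - 1) * 4) by ring, ← pow_succ,
            Nat.sub_add_cancel hK0]
        linarith⟩
      classical
      set k₀ := Nat.find hex with hk₀
      have hk₀le : u x ≤ 4 * tk k₀ := Nat.find_spec hex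
      have hk₀lt : tk k₀ < u x := by
        rcases Nat.eq_zero_or_pos k₀ with h0 | h0
        · rw [h0]; simp only [htk, pow_zero, mul_one]; exact h3
        · have hprev := Nat.find_min hex (show k₀ - 1 < k₀ by omega)
          push Not at hprev
          have : 4 * tk (k₀ - 1) = tk k₀ := by
            simp only [htk]
            rw [show (4 : ℝ) * (2 * ε * 4 ^ (k₀ - 1)) = 2 * ε * (4 ^ (k₀ - 1) * 4) by ring, ← pow_succ,
              Nat.sub_add_cancel h0]
          linarith
      have hk₀K : k₀ < K := by
        have h := Nat.find_le (h := hex) (n := K - 1) (by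
          have : 4 * tk (K - 1) = 2 * ε * 4 ^ K := by
            simp only [htk]
            rw [show (4 : ℝ) * (2 * ε * 4 ^ (K - 1)) = 2 * ε * (4 ^ (K - 1) * 4) by ring, ← pow_succ,
              Nat.sub_add_cancel hK0]
          linarith)
        omega
      have hxD : x ∈ Dk k₀ := ⟨hx, hk₀lt, hk₀le⟩
      calc volume (Prod.mk x ⁻¹' W) ≤ Bk k₀ := hBx k₀ hk₀lt
        _ = (Dk k₀).indicator (fun _ => Bk k₀) x := (indicator_of_mem hxD (fun _ => Bk k₀)).symm
        _ ≤ ∑ k ∈ Finset.range K, (Dk k).indicator (fun _ => Bk k) x :=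
            Finset.single_le_sum (f := fun k => (Dk k).indicator (fun _ => Bk k) x)
              (fun _ _ => zero_le) (Finset.mem_range.2 hk₀K)
        _ ≤ Φ x := le_add_self
  -- integrate the majorant
  have hvolL : volume L ≤ ENNReal.ofReal (8 * Real.sqrt (ε / lam)) := by
    have h := volume_band_le_of_chord_unif (t₁ := -ε) (t₂ := 2 * ε) hlam (by linarith) hu_chord hx₀ hmin0
    refine h.trans (ENNReal.ofReal_le_ofReal ?_)
    rw [show 2 * ε - -ε = 3 * ε by ring]
    have : Real.sqrt (3 * ε / lam) ≤ Real.sqrt (4 * (ε / lam)) :=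
      Real.sqrt_le_sqrt (by rw [mul_div_assoc]; gcongr; norm_num)
    rw [Real.sqrt_mul' _ (by positivity), show Real.sqrt 4 = 2 by
      rw [show (4:ℝ) = 2 ^ 2 by norm_num, Real.sqrt_sq (by norm_num)]] at this
    linarith
  have hvolD : ∀ k, volume (Dk k) ≤ ENNReal.ofReal (12 * Real.sqrt (tk k) / Real.sqrt lam) := fun k =>
    volume_dyadic_band_le_of_chord hlam (htk_pos k) hu_chord hx₀ hmin0
  have hΦint : ∫⁻ x, Φ x = A * volume L + ∑ k ∈ Finset.range K, Bk k * volume (Dk k) := by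
    rw [hΦ, lintegral_add_left (Measurable.indicator measurable_const hLm),
      lintegral_indicator_const hLm,
      lintegral_finsetSum _ (fun k _ => Measurable.indicator measurable_const (hDkm k))]
    congr 1
    exact Finset.sum_congr rfl fun k _ => lintegral_indicator_const (hDkm k) _
  have hterm : ∀ k, Bk k * volume (Dk k) ≤ ENNReal.ofReal (48 * ε / lam) := by
    intro k
    have h1 : 0 < Real.sqrt lam := Real.sqrt_pos.2 hlam
    have h2 : 0 < Real.sqrt (tk k) := Real.sqrt_pos.2 (htk_pos k)
    have h3 : Real.sqrt lam * Real.sqrt lam = lam := Real.mul_self_sqrt hlam.le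
    calc Bk k * volume (Dk k) ≤ Bk k * ENNReal.ofReal (12 * Real.sqrt (tk k) / Real.sqrt lam) := by
          gcongr
          exact hvolD k
      _ = ENNReal.ofReal (48 * ε / lam) := by
          rw [hBk, ← ENNReal.ofReal_mul (by positivity)]
          congr 1
          rw [div_mul_div_comm, show 4 * ε * (12 * Real.sqrt (tk k)) = 48 * ε * Real.sqrt (tk k) by ring,
            show Real.sqrt lam * Real.sqrt (tk k) * Real.sqrt lam =
              Real.sqrt lam * Real.sqrt lam * Real.sqrt (tk k) by ring,
            mul_div_mul_right _ _ h2.ne', h3]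
  have hlowterm : A * volume L ≤ ENNReal.ofReal (32 * ε / lam) := by
    calc A * volume L ≤ A * ENNReal.ofReal (8 * Real.sqrt (ε / lam)) := by
          gcongr
      _ = ENNReal.ofReal (32 * ε / lam) := by
          rw [hA, ← ENNReal.ofReal_mul (by positivity)]
          congr 1
          have h3 : Real.sqrt (ε / lam) * Real.sqrt (ε / lam) = ε / lam :=
            Real.mul_self_sqrt (by positivity)
          rw [show 4 * Real.sqrt (ε / lam) * (8 * Real.sqrt (ε / lam)) =
            32 * (Real.sqrt (ε / lam) * Real.sqrt (ε / lam)) by ring, h3]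
          ring
  calc volume W = ∫⁻ x, volume (Prod.mk x ⁻¹' W) := by
        rw [Measure.volume_eq_prod, Measure.prod_apply hWm]
    _ ≤ ∫⁻ x, Φ x := lintegral_mono hpt
    _ = A * volume L + ∑ k ∈ Finset.range K, Bk k * volume (Dk k) := hΦint
    _ ≤ ENNReal.ofReal (32 * ε / lam) + ∑ k ∈ Finset.range K, ENNReal.ofReal (48 * ε / lam) :=
        add_le_add hlowterm (Finset.sum_le_sum fun k _ => hterm k)
    _ = ENNReal.ofReal ((32 + 48 * K) * ε / lam) := by
        rw [Finset.sum_const, Finset.card_range, nsmul_eq_mul]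
        rw [show ((K : ℕ) : ℝ≥0∞) = ENNReal.ofReal (K : ℝ) by simp,
          ← ENNReal.ofReal_mul (by positivity), ← ENNReal.ofReal_add (by positivity) (by positivity)]
        congr 1
        ring

/-- **The saddle bound in the `Q·ε(1+|log ε|)` shape of [II] Theorem 1.1.** Under the hypotheses
of `volume_band_le_of_saddle` (a `C²` function on the box `[-σ,σ]²` with `∂₂²ν ≥ λ`,
`∂₁²ν ≤ -λ` there and oscillation at most `Ω`), for every `f₀` and every `0 < ε ≤ 1/2`,
`vol{p ∈ [-σ,σ]² : |f₀ + ν p| ≤ ε} ≤ ((80 + 35·log(Ω+1))/λ) · ε · (1 + |log ε|)`: the constant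
depends on `(λ, Ω)` only (take `K = ⌈log((Ω+ε)/2ε)/log 4⌉₊` in `volume_band_le_of_saddle` and
use `log 4 > 48/35`). This is the hyperbolic singular-region estimate of App. B («a contribution
proportional to ε log ε», p.35 L99–112) with constants uniform in the quantitative data, which
is what «by continuity of D … if s is chosen small enough» (p.35 L45–60) asks of it.
[cite: FeldmanSalmhoferTrubowitz1998, App. B (arXiv p.35 L45–112)] -/
theorem volume_band_le_of_saddle_log (hν : ContDiff ℝ 2 ν) {σ lam Ω : ℝ} (hσ : 0 < σ)
    (hlam : 0 < lam)
    (hyy : ∀ p ∈ Icc (-σ) σ ×ˢ Icc (-σ) σ,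
      lam ≤ fderiv ℝ (fderiv ℝ ν) p ((0 : ℝ), (1 : ℝ)) ((0 : ℝ), (1 : ℝ)))
    (hxx : ∀ p ∈ Icc (-σ) σ ×ˢ Icc (-σ) σ,
      fderiv ℝ (fderiv ℝ ν) p ((1 : ℝ), (0 : ℝ)) ((1 : ℝ), (0 : ℝ)) ≤ -lam)
    (hosc : ∀ p ∈ Icc (-σ) σ ×ˢ Icc (-σ) σ, ∀ q ∈ Icc (-σ) σ ×ˢ Icc (-σ) σ, ν p - ν q ≤ Ω)
    (f₀ ε : ℝ) (hε : 0 < ε) (hε2 : ε ≤ 1 / 2) :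
    volume ((Icc (-σ) σ ×ˢ Icc (-σ) σ) ∩ {p : ℝ × ℝ | |f₀ + ν p| ≤ ε}) ≤
      ENNReal.ofReal ((80 + 35 * Real.log (Ω + 1)) / lam * ε * (1 + |Real.log ε|)) := by
  have hΩ : 0 ≤ Ω := by
    have h0 : ((0 : ℝ), (0 : ℝ)) ∈ Icc (-σ) σ ×ˢ Icc (-σ) σ :=
      ⟨⟨by linarith, by linarith⟩, ⟨by linarith, by linarith⟩⟩
    have := hosc _ h0 _ h0
    linarith
  have hlog4 : 48 / 35 < Real.log 4 := by
    have h : Real.log 4 = 2 * Real.log 2 := by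
      rw [show (4 : ℝ) = 2 ^ 2 by norm_num, Real.log_pow]; norm_num
    rw [h]; have := Real.log_two_gt_d9; linarith
  have hlog4pos : 0 < Real.log 4 := by linarith
  set L := Real.log ((Ω + ε) / (2 * ε)) / Real.log 4 with hL
  set K := ⌈L⌉₊ with hKdef
  -- the hypothesis of the `K`-form holds for this `K`
  have hK : Ω + ε ≤ 2 * ε * 4 ^ K := by
    have h2ε : 0 < 2 * ε := by linarith
    by_cases hle : Ω + ε ≤ 2 * ε
    · calc Ω + ε ≤ 2 * ε * 1 := by linarith
        _ ≤ 2 * ε * 4 ^ K := by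
            gcongr
            exact one_le_pow₀ (by norm_num)
    · have hKL : L ≤ K := Nat.le_ceil L
      have h4K : (Ω + ε) / (2 * ε) ≤ (4 : ℝ) ^ K := by
        have hlogle : Real.log ((Ω + ε) / (2 * ε)) ≤ (K : ℝ) * Real.log 4 := by
          have := (div_le_iff₀ hlog4pos).1 hKL
          linarith
        calc (Ω + ε) / (2 * ε) = Real.exp (Real.log ((Ω + ε) / (2 * ε))) := by
              rw [Real.exp_log (by positivity)]
          _ ≤ Real.exp ((K : ℝ) * Real.log 4) := Real.exp_le_exp.2 hlogle
          _ = (4 : ℝ) ^ K := by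
              rw [← Real.rpow_natCast, Real.rpow_def_of_pos (by norm_num), mul_comm]
      rw [div_le_iff₀ h2ε] at h4K
      linarith
  refine (volume_band_le_of_saddle hν hσ hlam hyy hxx hosc f₀ ε hε K hK).trans
    (ENNReal.ofReal_le_ofReal ?_)
  have hlogΩ : 0 ≤ Real.log (Ω + 1) := Real.log_nonneg (by linarith)
  have habsnn : 0 ≤ |Real.log ε| := abs_nonneg _
  -- `K ≤ 1 + (log(Ω+1) + |log ε|)/log 4`
  have hKle : (K : ℝ) ≤ 1 + (Real.log (Ω + 1) + |Real.log ε|) / Real.log 4 := by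
    have hlogε : Real.log ε < 0 := Real.log_neg hε (by linarith)
    have habs : |Real.log ε| = -Real.log ε := abs_of_neg hlogε
    have hLle : L ≤ (Real.log (Ω + 1) + |Real.log ε|) / Real.log 4 := by
      rw [hL]
      apply div_le_div_of_nonneg_right _ hlog4pos.le
      rw [Real.log_div (by positivity) (by positivity), Real.log_mul (by norm_num) hε.ne', habs]
      have h1 : Real.log (Ω + ε) ≤ Real.log (Ω + 1) :=
        Real.log_le_log (by positivity) (by linarith)
      have h2 := Real.log_two_gt_d9
      linarith
    by_cases hL0 : 0 ≤ L
    · have := Nat.ceil_lt_add_one hL0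
      linarith
    · push Not at hL0
      have hK0 : K = 0 := Nat.ceil_eq_zero.2 hL0.le
      rw [hK0, Nat.cast_zero]
      positivity
  have hK48 : 32 + 48 * (K : ℝ) ≤ 80 + 35 * (Real.log (Ω + 1) + |Real.log ε|) := by
    have hq : 48 * ((Real.log (Ω + 1) + |Real.log ε|) / Real.log 4) ≤
        35 * (Real.log (Ω + 1) + |Real.log ε|) := by
      rw [mul_div_assoc', div_le_iff₀ hlog4pos]
      have : 0 ≤ Real.log (Ω + 1) + |Real.log ε| := by positivity
      nlinarith
    linarith
  have hfin : 32 + 48 * (K : ℝ) ≤ (80 + 35 * Real.log (Ω + 1)) * (1 + |Real.log ε|) := by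
    nlinarith
  calc (32 + 48 * (K : ℝ)) * ε / lam = (32 + 48 * (K : ℝ)) * (ε / lam) := by ring
    _ ≤ (80 + 35 * Real.log (Ω + 1)) * (1 + |Real.log ε|) * (ε / lam) := by gcongr
    _ = (80 + 35 * Real.log (Ω + 1)) / lam * ε * (1 + |Real.log ε|) := by ring

end Saddle

/-! ### The regular region by tiling (App. B p.32 L88–96, quantitative) -/

section RegularTiling

variable {η : ℝ × ℝ → ℝ}

/-- Slices of a `C¹` function along the first coordinate. [folklore] -/
private theorem hasDerivAt_slice_fst (hη : ContDiff ℝ 1 η) (t y : ℝ) :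
    HasDerivAt (fun t => η (t, y)) (fderiv ℝ η (t, y) ((1 : ℝ), (0 : ℝ))) t := by
  have hl : HasDerivAt (fun t : ℝ => (t, y)) ((1 : ℝ), (0 : ℝ)) t :=
    (hasDerivAt_id t).prodMk (hasDerivAt_const t y)
  have hd : HasFDerivAt η (fderiv ℝ η (t, y)) (t, y) :=
    ((hη.differentiable (by simp)) (t, y)).hasFDerivAt
  exact hd.comp_hasDerivAt t hl

/-- Slices of a `C¹` function along the second coordinate. [folklore] -/
private theorem hasDerivAt_slice_snd (hη : ContDiff ℝ 1 η) (x t : ℝ) :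
    HasDerivAt (fun t => η (x, t)) (fderiv ℝ η (x, t) ((0 : ℝ), (1 : ℝ))) t := by
  have hl : HasDerivAt (fun t : ℝ => (x, t)) ((0 : ℝ), (1 : ℝ)) t :=
    (hasDerivAt_const t x).prodMk (hasDerivAt_id t)
  have hd : HasFDerivAt η (fderiv ℝ η (x, t)) (x, t) :=
    ((hη.differentiable (by simp)) (x, t)).hasFDerivAt
  exact hd.comp_hasDerivAt t hl

/-- Rectangle bound, `∂₁η ≥ δ` in `fderiv` language. [folklore] -/
private theorem volume_rect_le_of_fderiv_fst_ge (hη : ContDiff ℝ 1 η) {a b c d δ ε : ℝ}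
    (hδ : 0 < δ) (hε : 0 ≤ ε) (f₀ : ℝ)
    (h : ∀ p ∈ Icc a b ×ˢ Icc c d, δ ≤ fderiv ℝ η p ((1 : ℝ), (0 : ℝ))) :
    volume ((Icc a b ×ˢ Icc c d) ∩ {p : ℝ × ℝ | |f₀ + η p| ≤ ε}) ≤
      ENNReal.ofReal ((d - c) * (2 * ε / δ)) := by
  refine volume_rect_le_of_partialDeriv_ge hδ hε hη.continuous (fun θ₂ _ => ?_)
    (fun θ₂ hθ₂ θ₁ hθ₁ => ?_) f₀
  · exact fun t _ => (hasDerivAt_slice_fst hη t θ₂).differentiableAt.differentiableWithinAt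
  · rw [(hasDerivAt_slice_fst hη θ₁ θ₂).deriv]
    exact h _ ⟨Ioo_subset_Icc_self hθ₁, hθ₂⟩

/-- Rectangle bound, `∂₁η ≤ -δ`. [folklore] -/
private theorem volume_rect_le_of_fderiv_fst_le (hη : ContDiff ℝ 1 η) {a b c d δ ε : ℝ}
    (hδ : 0 < δ) (hε : 0 ≤ ε) (f₀ : ℝ)
    (h : ∀ p ∈ Icc a b ×ˢ Icc c d, fderiv ℝ η p ((1 : ℝ), (0 : ℝ)) ≤ -δ) :
    volume ((Icc a b ×ˢ Icc c d) ∩ {p : ℝ × ℝ | |f₀ + η p| ≤ ε}) ≤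
      ENNReal.ofReal ((d - c) * (2 * ε / δ)) := by
  have hη' : ContDiff ℝ 1 (fun p => -η p) := hη.neg
  have hset : {p : ℝ × ℝ | |f₀ + η p| ≤ ε} = {p : ℝ × ℝ | |-f₀ + -η p| ≤ ε} := by
    ext p
    simp only [mem_setOf_eq]
    rw [show -f₀ + -η p = -(f₀ + η p) by ring, abs_neg]
  rw [hset]
  refine volume_rect_le_of_fderiv_fst_ge hη' hδ hε (-f₀) fun p hp => ?_
  have : fderiv ℝ (fun p => -η p) p = -fderiv ℝ η p := fderiv_neg
  rw [this, neg_apply]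
  linarith [h p hp]

/-- Swapping the coordinates preserves Lebesgue measure on `ℝ × ℝ`. [folklore] -/
private theorem volume_swap_band (η : ℝ × ℝ → ℝ) (a b c d f₀ ε : ℝ) (hη : Continuous η) :
    volume ((Icc a b ×ˢ Icc c d) ∩ {p : ℝ × ℝ | |f₀ + η p| ≤ ε}) =
      volume ((Icc c d ×ˢ Icc a b) ∩ {p : ℝ × ℝ | |f₀ + η (p.2, p.1)| ≤ ε}) := by
  have hmp : MeasurePreserving (Prod.swap : ℝ × ℝ → ℝ × ℝ) volume volume := by
    have := (Measure.measurePreserving_swap (μ := (volume : Measure ℝ)) (ν := (volume : Measure ℝ)))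
    rwa [← Measure.volume_eq_prod] at this
  have hT : MeasurableSet ((Icc c d ×ˢ Icc a b) ∩ {p : ℝ × ℝ | |f₀ + η (p.2, p.1)| ≤ ε}) :=
    (measurableSet_Icc.prod measurableSet_Icc).inter
      (isClosed_le (continuous_abs.comp (continuous_const.add
        (hη.comp (continuous_snd.prodMk continuous_fst)))) continuous_const).measurableSet
  rw [← hmp.measure_preimage hT.nullMeasurableSet]
  congr 1
  ext p
  simp only [mem_preimage, mem_inter_iff, mem_prod, mem_setOf_eq, Prod.swap]
  tauto

/-- `fderiv` of `η ∘ swap`. [folklore] -/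
private theorem fderiv_swap_apply (hη : ContDiff ℝ 1 η) (p : ℝ × ℝ) :
    fderiv ℝ (fun p : ℝ × ℝ => η (p.2, p.1)) p ((1 : ℝ), (0 : ℝ)) =
      fderiv ℝ η (p.2, p.1) ((0 : ℝ), (1 : ℝ)) := by
  have hg : HasFDerivAt (fun p : ℝ × ℝ => (p.2, p.1))
      ((ContinuousLinearMap.snd ℝ ℝ ℝ).prod (ContinuousLinearMap.fst ℝ ℝ ℝ)) p :=
    hasFDerivAt_snd.prodMk hasFDerivAt_fst
  have hd : HasFDerivAt η (fderiv ℝ η (p.2, p.1)) (p.2, p.1) :=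
    ((hη.differentiable (by simp)) (p.2, p.1)).hasFDerivAt
  have hc : HasFDerivAt (fun p : ℝ × ℝ => η (p.2, p.1))
      ((fderiv ℝ η (p.2, p.1)).comp
        ((ContinuousLinearMap.snd ℝ ℝ ℝ).prod (ContinuousLinearMap.fst ℝ ℝ ℝ))) p :=
    hd.comp p hg
  rw [hc.fderiv]
  simp

/-- Rectangle bound, `∂₂η ≥ δ`. [folklore] -/
private theorem volume_rect_le_of_fderiv_snd_ge (hη : ContDiff ℝ 1 η) {a b c d δ ε : ℝ}
    (hδ : 0 < δ) (hε : 0 ≤ ε) (f₀ : ℝ)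
    (h : ∀ p ∈ Icc a b ×ˢ Icc c d, δ ≤ fderiv ℝ η p ((0 : ℝ), (1 : ℝ))) :
    volume ((Icc a b ×ˢ Icc c d) ∩ {p : ℝ × ℝ | |f₀ + η p| ≤ ε}) ≤
      ENNReal.ofReal ((b - a) * (2 * ε / δ)) := by
  rw [volume_swap_band η a b c d f₀ ε hη.continuous]
  have hη' : ContDiff ℝ 1 (fun p : ℝ × ℝ => η (p.2, p.1)) :=
    hη.comp (contDiff_snd.prodMk contDiff_fst)
  refine volume_rect_le_of_fderiv_fst_ge hη' hδ hε f₀ fun p hp => ?_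
  rw [fderiv_swap_apply hη]
  exact h _ ⟨hp.2, hp.1⟩

/-- Rectangle bound, `∂₂η ≤ -δ`. [folklore] -/
private theorem volume_rect_le_of_fderiv_snd_le (hη : ContDiff ℝ 1 η) {a b c d δ ε : ℝ}
    (hδ : 0 < δ) (hε : 0 ≤ ε) (f₀ : ℝ)
    (h : ∀ p ∈ Icc a b ×ˢ Icc c d, fderiv ℝ η p ((0 : ℝ), (1 : ℝ)) ≤ -δ) :
    volume ((Icc a b ×ˢ Icc c d) ∩ {p : ℝ × ℝ | |f₀ + η p| ≤ ε}) ≤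
      ENNReal.ofReal ((b - a) * (2 * ε / δ)) := by
  rw [volume_swap_band η a b c d f₀ ε hη.continuous]
  have hη' : ContDiff ℝ 1 (fun p : ℝ × ℝ => η (p.2, p.1)) :=
    hη.comp (contDiff_snd.prodMk contDiff_fst)
  refine volume_rect_le_of_fderiv_fst_le hη' hδ hε f₀ fun p hp => ?_
  rw [fderiv_swap_apply hη]
  exact h _ ⟨hp.2, hp.1⟩

/-- Cover of `[a, a + n s]` by the `n` consecutive tiles of length `s`. [folklore] -/
private theorem Icc_subset_iUnion_tiles {a s : ℝ} {n : ℕ} (hn : 0 < n) :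
    Icc a (a + n * s) ⊆ ⋃ i ∈ Finset.range n, Icc (a + i * s) (a + (i + 1) * s) := by
  induction n with
  | zero => exact absurd hn (lt_irrefl 0)
  | succ k ih =>
    intro x hx
    rcases Nat.eq_zero_or_pos k with hk | hk
    · subst hk
      refine mem_iUnion₂.2 ⟨0, Finset.mem_range.2 (by norm_num), ?_⟩
      push_cast at hx ⊢
      exact ⟨by linarith [hx.1], by linarith [hx.2]⟩
    · by_cases hxk : x ≤ a + k * s
      · obtain ⟨i, hi, hxi⟩ := mem_iUnion₂.1 (ih hk ⟨hx.1, hxk⟩)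
        exact mem_iUnion₂.2 ⟨i, Finset.mem_range.2
          ((Finset.mem_range.1 hi).trans (Nat.lt_succ_self k)), hxi⟩
      · refine mem_iUnion₂.2 ⟨k, Finset.mem_range.2 (Nat.lt_succ_self k), ?_⟩
        push_cast at hx ⊢
        exact ⟨(not_le.1 hxk).le, by linarith [hx.2]⟩

/-- **The regular region by tiling** — the `R_δ(ε) ≤ Const·ε/φ(δ)` step of App. B (p.32
L88–96) with constants from quantitative data. Let `η ∈ C¹(ℝ²)` have partial derivatives
`∂₁η, ∂₂η` that are `M`-Lipschitz for the sup metric on the box `B = [a, a+ns] × [c, c+ms]`,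
tiled into `n·m` squares of side `s` with `M s ≤ δ₁`, and let `A ⊆ B` be a region in which,
wherever `|f₀ + η| ≤ ε`, one of `|∂₁η|, |∂₂η|` is at least `2δ₁` (the regular region: away from
the set `E` where both partial derivatives, i.e. the Jacobian, degenerate). Then
`vol(A ∩ {|f₀ + η| ≤ ε}) ≤ n·m·s·(2ε/δ₁)` (`= 2|B|ε/(sδ₁)`): on every tile that meets
`A ∩ {|f₀ + η| ≤ ε}` the distinguished partial derivative keeps its sign and modulus `≥ δ₁`
(Lipschitz bound, `M s ≤ δ₁`), so the slice estimate `volume_rect_le_of_partialDeriv_ge` (or one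
of its reflections `θ₁ ↔ θ₂`, `η ↔ -η`) bounds that tile's share by `s·2ε/δ₁`; sum over the
tiles. [II] quotes this estimate from the Jacobian bound of [I, App. A]; the tiling replaces
that two-dimensional change of variables by slicing, with the same outcome linear in `ε` and a
constant depending only on `(|B|, M, δ₁)` — hence uniform over families `η(·, q)` sharing these
bounds. [cite: FeldmanSalmhoferTrubowitz1998, App. B (arXiv p.32 L88–96)] -/
theorem volume_regular_le_of_tiling (hη : ContDiff ℝ 1 η) {a c s M δ₁ ε : ℝ} {n m : ℕ}
    (hn : 0 < n) (hm : 0 < m) (hs : 0 < s) (hM : 0 ≤ M) (hδ₁ : 0 < δ₁) (hε : 0 ≤ ε)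
    (hMs : M * s ≤ δ₁)
    (hL₁ : ∀ p ∈ Icc a (a + n * s) ×ˢ Icc c (c + m * s), ∀ q ∈ Icc a (a + n * s) ×ˢ Icc c (c + m * s),
      |fderiv ℝ η p ((1 : ℝ), (0 : ℝ)) - fderiv ℝ η q ((1 : ℝ), (0 : ℝ))| ≤ M * dist p q)
    (hL₂ : ∀ p ∈ Icc a (a + n * s) ×ˢ Icc c (c + m * s), ∀ q ∈ Icc a (a + n * s) ×ˢ Icc c (c + m * s),
      |fderiv ℝ η p ((0 : ℝ), (1 : ℝ)) - fderiv ℝ η q ((0 : ℝ), (1 : ℝ))| ≤ M * dist p q)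
    {A : Set (ℝ × ℝ)} (hA : A ⊆ Icc a (a + n * s) ×ˢ Icc c (c + m * s)) (f₀ : ℝ)
    (hreg : ∀ p ∈ A, |f₀ + η p| ≤ ε →
      2 * δ₁ ≤ |fderiv ℝ η p ((1 : ℝ), (0 : ℝ))| ∨ 2 * δ₁ ≤ |fderiv ℝ η p ((0 : ℝ), (1 : ℝ))|) :
    volume (A ∩ {p : ℝ × ℝ | |f₀ + η p| ≤ ε}) ≤
      ENNReal.ofReal (n * m * (s * (2 * ε / δ₁))) := by
  set B := Icc a (a + n * s) ×ˢ Icc c (c + m * s) with hB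
  set W := {p : ℝ × ℝ | |f₀ + η p| ≤ ε} with hW
  set T : ℕ × ℕ → Set (ℝ × ℝ) := fun ij =>
    Icc (a + ij.1 * s) (a + (ij.1 + 1) * s) ×ˢ Icc (c + ij.2 * s) (c + (ij.2 + 1) * s) with hT
  set I := Finset.range n ×ˢ Finset.range m with hI
  have hcover : A ∩ W ⊆ ⋃ ij ∈ I, (T ij ∩ (A ∩ W)) := by
    rintro p ⟨hpA, hpW⟩
    have hpB := hA hpA
    obtain ⟨i, hi, hpi⟩ := mem_iUnion₂.1 (Icc_subset_iUnion_tiles (a := a) (s := s) hn hpB.1)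
    obtain ⟨j, hj, hpj⟩ := mem_iUnion₂.1 (Icc_subset_iUnion_tiles (a := c) (s := s) hm hpB.2)
    exact mem_iUnion₂.2 ⟨(i, j), Finset.mem_product.2 ⟨hi, hj⟩, ⟨hpi, hpj⟩, hpA, hpW⟩
  have htile : ∀ ij ∈ I, volume (T ij ∩ (A ∩ W)) ≤ ENNReal.ofReal (s * (2 * ε / δ₁)) := by
    intro ij hij
    obtain ⟨hi, hj⟩ := Finset.mem_product.1 hij
    rw [Finset.mem_range] at hi hj
    rcases (T ij ∩ (A ∩ W)).eq_empty_or_nonempty with h0 | ⟨p₀, hp₀T, hp₀A, hp₀W⟩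
    · rw [h0, measure_empty]; exact zero_le
    have hi' : (ij.1 : ℝ) + 1 ≤ n := by exact_mod_cast Nat.succ_le_of_lt hi
    have hj' : (ij.2 : ℝ) + 1 ≤ m := by exact_mod_cast Nat.succ_le_of_lt hj
    have hTB : T ij ⊆ B := by
      rintro p ⟨⟨h1, h2⟩, ⟨h3, h4⟩⟩
      have e1 : (0 : ℝ) ≤ ij.1 * s := by positivity
      have e2 : ((ij.1 : ℝ) + 1) * s ≤ n * s := by gcongr
      have e3 : (0 : ℝ) ≤ ij.2 * s := by positivity
      have e4 : ((ij.2 : ℝ) + 1) * s ≤ m * s := by gcongr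
      exact ⟨⟨by linarith, by linarith⟩, ⟨by linarith, by linarith⟩⟩
    have hdist : ∀ p ∈ T ij, dist p p₀ ≤ s := by
      intro p hp
      rw [Prod.dist_eq]
      refine max_le ?_ ?_
      · rw [Real.dist_eq]
        exact abs_sub_le_iff.2 ⟨by linarith [hp.1.2, hp₀T.1.1], by linarith [hp.1.1, hp₀T.1.2]⟩
      · rw [Real.dist_eq]
        exact abs_sub_le_iff.2 ⟨by linarith [hp.2.2, hp₀T.2.1], by linarith [hp.2.1, hp₀T.2.2]⟩
    have hMd : ∀ p ∈ T ij, M * dist p p₀ ≤ δ₁ := fun p hp =>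
      (mul_le_mul_of_nonneg_left (hdist p hp) hM).trans hMs
    have hside₁ : (a + ((ij.1 : ℝ) + 1) * s) - (a + ij.1 * s) = s := by ring
    have hside₂ : (c + ((ij.2 : ℝ) + 1) * s) - (c + ij.2 * s) = s := by ring
    have key : volume (T ij ∩ W) ≤ ENNReal.ofReal (s * (2 * ε / δ₁)) := by
      rcases hreg p₀ hp₀A hp₀W with h₁ | h₂
      · rcases le_abs'.1 h₁ with hneg | hpos
        · have h := volume_rect_le_of_fderiv_fst_le hη (a := a + ij.1 * s)
            (b := a + (ij.1 + 1) * s) (c := c + ij.2 * s) (d := c + (ij.2 + 1) * s) hδ₁ hε f₀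
            (fun p hp => by
              have hl := (abs_sub_le_iff.1 (hL₁ p (hTB hp) p₀ (hTB hp₀T))).1
              linarith [hMd p hp])
          rwa [hside₂] at h
        · have h := volume_rect_le_of_fderiv_fst_ge hη (a := a + ij.1 * s)
            (b := a + (ij.1 + 1) * s) (c := c + ij.2 * s) (d := c + (ij.2 + 1) * s) hδ₁ hε f₀
            (fun p hp => by
              have hl := (abs_sub_le_iff.1 (hL₁ p (hTB hp) p₀ (hTB hp₀T))).2
              linarith [hMd p hp])
          rwa [hside₂] at h
      · rcases le_abs'.1 h₂ with hneg | hpos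
        · have h := volume_rect_le_of_fderiv_snd_le hη (a := a + ij.1 * s)
            (b := a + (ij.1 + 1) * s) (c := c + ij.2 * s) (d := c + (ij.2 + 1) * s) hδ₁ hε f₀
            (fun p hp => by
              have hl := (abs_sub_le_iff.1 (hL₂ p (hTB hp) p₀ (hTB hp₀T))).1
              linarith [hMd p hp])
          rwa [hside₁] at h
        · have h := volume_rect_le_of_fderiv_snd_ge hη (a := a + ij.1 * s)
            (b := a + (ij.1 + 1) * s) (c := c + ij.2 * s) (d := c + (ij.2 + 1) * s) hδ₁ hε f₀
            (fun p hp => by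
              have hl := (abs_sub_le_iff.1 (hL₂ p (hTB hp) p₀ (hTB hp₀T))).2
              linarith [hMd p hp])
          rwa [hside₁] at h
    exact (measure_mono (inter_subset_inter_right _ inter_subset_right)).trans key
  calc volume (A ∩ W) ≤ volume (⋃ ij ∈ I, (T ij ∩ (A ∩ W))) := measure_mono hcover
    _ ≤ ∑ ij ∈ I, volume (T ij ∩ (A ∩ W)) := measure_biUnion_finset_le I _
    _ ≤ ∑ ij ∈ I, ENNReal.ofReal (s * (2 * ε / δ₁)) := Finset.sum_le_sum htile
    _ = ENNReal.ofReal (n * m * (s * (2 * ε / δ₁))) := by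
        rw [Finset.sum_const, hI, Finset.card_product, Finset.card_range, Finset.card_range,
          nsmul_eq_mul]
        rw [show (n : ℝ) * m * (s * (2 * ε / δ₁)) = ((n * m : ℕ) : ℝ) * (s * (2 * ε / δ₁)) by
          push_cast; ring]
        rw [ENNReal.ofReal_mul (by positivity : (0 : ℝ) ≤ ((n * m : ℕ) : ℝ)),
          ENNReal.ofReal_natCast]

/-- Mean value inequality for the partial derivatives of a `C²` function on a convex set: if
`‖D²η‖ ≤ M` on `B` then `p ↦ Dη(p) v` (`‖v‖ ≤ 1`) is `M`-Lipschitz on `B`. [folklore] -/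
private theorem abs_fderiv_sub_le_of_hessian_bound (hη : ContDiff ℝ 2 η) {B : Set (ℝ × ℝ)}
    (hB : Convex ℝ B) {M : ℝ} (hM : ∀ p ∈ B, ‖fderiv ℝ (fderiv ℝ η) p‖ ≤ M) {v : ℝ × ℝ}
    (hv : ‖v‖ ≤ 1) {p q : ℝ × ℝ} (hp : p ∈ B) (hq : q ∈ B) :
    |fderiv ℝ η p v - fderiv ℝ η q v| ≤ M * dist p q := by
  have hM0 : 0 ≤ M := le_trans (norm_nonneg (fderiv ℝ (fderiv ℝ η) p)) (hM p hp)
  have hdiff : ∀ x ∈ B, DifferentiableAt ℝ (fun q => fderiv ℝ η q v) x := fun x _ =>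
    (hasFDerivAt_partial_of_contDiff hη v x).differentiableAt
  have hbound : ∀ x ∈ B, ‖fderiv ℝ (fun q => fderiv ℝ η q v) x‖ ≤ M := by
    intro x hx
    rw [(hasFDerivAt_partial_of_contDiff hη v x).fderiv]
    calc ‖(fderiv ℝ (fderiv ℝ η) x).flip v‖
        ≤ ‖(fderiv ℝ (fderiv ℝ η) x).flip‖ * ‖v‖ := ContinuousLinearMap.le_opNorm _ _
      _ ≤ M * 1 := by
          rw [ContinuousLinearMap.opNorm_flip]
          exact mul_le_mul (hM x hx) hv (norm_nonneg _) hM0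
      _ = M := mul_one M
  have h := hB.norm_image_sub_le_of_norm_fderiv_le hdiff hbound hq hp
  rw [Real.norm_eq_abs, ← dist_eq_norm] at h
  exact h

/-- `volume_regular_le_of_tiling` for `η ∈ C²` with `‖D²η‖ ≤ M` on the box: the Lipschitz bounds
of `∂₁η, ∂₂η` then come from the mean value inequality (in App. B, `M` is controlled by `|e|₂`
and the `C²` size of the curve `θ ↦ p(0,θ)`, p.32 L50–60), so the regular-region constant
depends on `(|B|, M, δ₁)` only. [cite: FeldmanSalmhoferTrubowitz1998, App. B (arXiv p.32 L88–96)] -/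
theorem volume_regular_le_of_tiling_of_hessian_bound (hη : ContDiff ℝ 2 η) {a c s M δ₁ ε : ℝ}
    {n m : ℕ} (hn : 0 < n) (hm : 0 < m) (hs : 0 < s) (hδ₁ : 0 < δ₁) (hε : 0 ≤ ε)
    (hMs : M * s ≤ δ₁)
    (hM : ∀ p ∈ Icc a (a + n * s) ×ˢ Icc c (c + m * s), ‖fderiv ℝ (fderiv ℝ η) p‖ ≤ M)
    {A : Set (ℝ × ℝ)} (hA : A ⊆ Icc a (a + n * s) ×ˢ Icc c (c + m * s)) (f₀ : ℝ)
    (hreg : ∀ p ∈ A, |f₀ + η p| ≤ ε →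
      2 * δ₁ ≤ |fderiv ℝ η p ((1 : ℝ), (0 : ℝ))| ∨ 2 * δ₁ ≤ |fderiv ℝ η p ((0 : ℝ), (1 : ℝ))|) :
    volume (A ∩ {p : ℝ × ℝ | |f₀ + η p| ≤ ε}) ≤
      ENNReal.ofReal (n * m * (s * (2 * ε / δ₁))) := by
  have hne : (Icc a (a + n * s) ×ˢ Icc c (c + m * s)).Nonempty := by
    refine ⟨(a, c), ⟨le_rfl, ?_⟩, ⟨le_rfl, ?_⟩⟩
    · have : (0 : ℝ) ≤ n * s := by positivity
      linarith
    · have : (0 : ℝ) ≤ m * s := by positivity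
      linarith
  obtain ⟨p₁, hp₁⟩ := hne
  have hM0 : 0 ≤ M := le_trans (norm_nonneg (fderiv ℝ (fderiv ℝ η) p₁)) (hM p₁ hp₁)
  have hconv : Convex ℝ (Icc a (a + n * s) ×ˢ Icc c (c + m * s)) :=
    (convex_Icc _ _).prod (convex_Icc _ _)
  have hv₁ : ‖((1 : ℝ), (0 : ℝ))‖ ≤ 1 := by simp [Prod.norm_def]
  have hv₂ : ‖((0 : ℝ), (1 : ℝ))‖ ≤ 1 := by simp [Prod.norm_def]
  exact volume_regular_le_of_tiling (hη.of_le (by norm_num)) hn hm hs hM0 hδ₁ hε hMs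
    (fun p hp q hq => abs_fderiv_sub_le_of_hessian_bound hη hconv hM hv₁ hp hq)
    (fun p hp q hq => abs_fderiv_sub_le_of_hessian_bound hη hconv hM hv₂ hp hq) hA f₀ hreg

end RegularTiling

/-! ### Quantitative elliptic bounds from the Hessian at the critical point -/

section DefiniteHessian

variable {ν : ℝ × ℝ → ℝ}

/-- The sup norm of `ℝ × ℝ` versus the Euclidean square: `‖v‖² ≤ v₁² + v₂²`. [folklore] -/
private theorem norm_mul_norm_le_sq_add_sq (v : ℝ × ℝ) : ‖v‖ * ‖v‖ ≤ v.1 ^ 2 + v.2 ^ 2 := by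
  rw [Prod.norm_def, Real.norm_eq_abs, Real.norm_eq_abs]
  rcases le_total |v.1| |v.2| with h | h
  · rw [max_eq_right h, abs_mul_abs_self]; nlinarith [sq_nonneg v.1]
  · rw [max_eq_left h, abs_mul_abs_self]; nlinarith [sq_nonneg v.2]

/-- A positive definite symmetric form `[[a,b],[b,c]]` (`a > 0`, `ac - b² ≥ w > 0`,
`a + c ≤ 2K`) is bounded below by `(w/2K)·|v|²`:
`(a+c)(a x² + 2b x y + c y²) - (ac-b²)(x²+y²) = (a x + b y)² + (b x + c y)²`. [folklore] -/
private theorem quadForm_lower_bound {a b c w K x y : ℝ} (ha : 0 < a) (hw : 0 < w) (hK : 0 < K)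
    (hdet : w ≤ a * c - b ^ 2) (htr : a + c ≤ 2 * K) :
    w / (2 * K) * (x ^ 2 + y ^ 2) ≤ a * x ^ 2 + 2 * b * x * y + c * y ^ 2 := by
  have hid : (a + c) * (a * x ^ 2 + 2 * b * x * y + c * y ^ 2) - (a * c - b ^ 2) * (x ^ 2 + y ^ 2)
      = (a * x + b * y) ^ 2 + (b * x + c * y) ^ 2 := by ring
  have hc : 0 < c := by nlinarith [sq_nonneg b]
  have hac : 0 < a + c := by linarith
  have h1 : w * (x ^ 2 + y ^ 2) ≤ (a + c) * (a * x ^ 2 + 2 * b * x * y + c * y ^ 2) := by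
    nlinarith [sq_nonneg (a * x + b * y), sq_nonneg (b * x + c * y), sq_nonneg x, sq_nonneg y]
  have hQ : 0 ≤ a * x ^ 2 + 2 * b * x * y + c * y ^ 2 := by
    by_contra hneg
    push Not at hneg
    nlinarith [sq_nonneg x, sq_nonneg y]
  have h2 : w * (x ^ 2 + y ^ 2) ≤ 2 * K * (a * x ^ 2 + 2 * b * x * y + c * y ^ 2) := by
    nlinarith
  rw [div_mul_eq_mul_div, div_le_iff₀ (by positivity)]
  linarith

/-- **Quantitative elliptic bound from the Hessian at the critical point** (the elliptic case of
App. B, p.35 L99–104, with the normalisation p.35 L47–80 made quantitative): `ν ∈ C²(ℝ²)`,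
`Dν(p₀) = 0`, Hessian entries `a = ∂₁²ν(p₀) > 0`, `b = ∂₁∂₂ν(p₀)`, `c = ∂₂²ν(p₀)` with
`ac - b² ≥ w > 0` and `a + c ≤ 2K`, and `‖D²ν(p) - D²ν(p₀)‖ ≤ w/(4K)` on the ball `B_{r₀}(p₀)`
(sup norm). Then for every `f₀` and every `ε > 0`,
`vol{p ∈ B_{r₀/2}(p₀) : |f₀ + ν p| ≤ ε} ≤ 16 K π ε / w`: the form `D²ν(p₀)` is bounded below
by `(w/2K)|v|²` (`(a+c) D²ν(p₀)(v,v) - (ac-b²)|v|² = (a v₁ + b v₂)² + (b v₁ + c v₂)²`), so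
`D²ν(p) ≥ (w/4K)|v|²` on the ball and `volume_band_le_of_hessian_lower_bound_at` applies. The
constant and the radius depend only on `(w, K, r₀)`, i.e. on `|det D₀|`, `|e|₂` and a modulus
of continuity of `D` — the data App. B's "by continuity of `D`" (p.35 L45–47) refers to.
[cite: FeldmanSalmhoferTrubowitz1998, App. B (arXiv p.35 L45–104)] -/
theorem volume_band_le_of_posDef_hessian_at (hν : ContDiff ℝ 2 ν) (p₀ : ℝ × ℝ) {r₀ w K : ℝ}
    (hr₀ : 0 < r₀) (hw : 0 < w) (hK : 0 < K) (h1 : fderiv ℝ ν p₀ = 0)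
    (ha : 0 < fderiv ℝ (fderiv ℝ ν) p₀ ((1 : ℝ), (0 : ℝ)) ((1 : ℝ), (0 : ℝ)))
    (hdet : w ≤ fderiv ℝ (fderiv ℝ ν) p₀ ((1 : ℝ), (0 : ℝ)) ((1 : ℝ), (0 : ℝ)) *
        fderiv ℝ (fderiv ℝ ν) p₀ ((0 : ℝ), (1 : ℝ)) ((0 : ℝ), (1 : ℝ)) -
        (fderiv ℝ (fderiv ℝ ν) p₀ ((1 : ℝ), (0 : ℝ)) ((0 : ℝ), (1 : ℝ))) ^ 2)
    (htr : fderiv ℝ (fderiv ℝ ν) p₀ ((1 : ℝ), (0 : ℝ)) ((1 : ℝ), (0 : ℝ)) +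
        fderiv ℝ (fderiv ℝ ν) p₀ ((0 : ℝ), (1 : ℝ)) ((0 : ℝ), (1 : ℝ)) ≤ 2 * K)
    (hmod : ∀ p ∈ Metric.ball p₀ r₀,
      ‖fderiv ℝ (fderiv ℝ ν) p - fderiv ℝ (fderiv ℝ ν) p₀‖ ≤ w / (4 * K))
    (f₀ ε : ℝ) (hε : 0 < ε) :
    volume (Metric.ball p₀ (r₀ / 2) ∩ {p | |f₀ + ν p| ≤ ε}) ≤
      ENNReal.ofReal (16 * K * Real.pi * ε / w) := by
  set H := fderiv ℝ (fderiv ℝ ν) p₀ with hH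
  set a := H ((1 : ℝ), (0 : ℝ)) ((1 : ℝ), (0 : ℝ)) with ha'
  set b := H ((1 : ℝ), (0 : ℝ)) ((0 : ℝ), (1 : ℝ)) with hb'
  set c := H ((0 : ℝ), (1 : ℝ)) ((0 : ℝ), (1 : ℝ)) with hc'
  have hsymm : IsSymmSndFDerivAt ℝ ν p₀ := hν.contDiffAt.isSymmSndFDerivAt (by simp)
  have hba : H ((0 : ℝ), (1 : ℝ)) ((1 : ℝ), (0 : ℝ)) = b := hsymm _ _
  have hH0 : ∀ v : ℝ × ℝ, w / (2 * K) * (v.1 ^ 2 + v.2 ^ 2) ≤ H v v := by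
    intro v
    rw [bilin_apply_coord H v v, hba]
    have := quadForm_lower_bound (x := v.1) (y := v.2) (b := b) ha hw hK hdet htr
    convert this using 1
    ring
  have hlam : 0 < w / (4 * K) := by positivity
  have hHp : ∀ p ∈ Metric.ball p₀ r₀, ∀ v : ℝ × ℝ,
      w / (4 * K) * (v.1 ^ 2 + v.2 ^ 2) ≤ fderiv ℝ (fderiv ℝ ν) p v v := by
    intro p hp v
    have hdiff : |fderiv ℝ (fderiv ℝ ν) p v v - H v v| ≤ w / (4 * K) * (v.1 ^ 2 + v.2 ^ 2) := by
      have h1 : fderiv ℝ (fderiv ℝ ν) p v v - H v v = (fderiv ℝ (fderiv ℝ ν) p - H) v v := by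
        rw [sub_apply, sub_apply]
      rw [h1, ← Real.norm_eq_abs]
      calc ‖(fderiv ℝ (fderiv ℝ ν) p - H) v v‖
          ≤ ‖fderiv ℝ (fderiv ℝ ν) p - H‖ * ‖v‖ * ‖v‖ := ContinuousLinearMap.le_opNorm₂ _ _ _
        _ ≤ w / (4 * K) * (‖v‖ * ‖v‖) := by
            rw [mul_assoc]
            exact mul_le_mul_of_nonneg_right (hmod p hp) (by positivity)
        _ ≤ w / (4 * K) * (v.1 ^ 2 + v.2 ^ 2) :=
            mul_le_mul_of_nonneg_left (norm_mul_norm_le_sq_add_sq v) hlam.le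
    have h0 := hH0 v
    have := (abs_sub_le_iff.1 hdiff).2
    have hK2 : w / (2 * K) = 2 * (w / (4 * K)) := by field_simp; ring
    rw [hK2] at h0
    linarith
  have h := volume_band_le_of_hessian_lower_bound_at hν p₀ hr₀ hlam h1 hHp f₀ ε hε
  have heq : 4 * Real.pi * ε / (w / (4 * K)) = 16 * K * Real.pi * ε / w := by
    field_simp
    ring
  rwa [heq] at h

/-- The negative definite case of `volume_band_le_of_posDef_hessian_at` (`a < 0`, `ac - b² ≥ w`,
`-(a + c) ≤ 2K`), by passing to `-ν`. [cite: FeldmanSalmhoferTrubowitz1998, App. B (arXiv p.35 L45–104)] -/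
theorem volume_band_le_of_negDef_hessian_at (hν : ContDiff ℝ 2 ν) (p₀ : ℝ × ℝ) {r₀ w K : ℝ}
    (hr₀ : 0 < r₀) (hw : 0 < w) (hK : 0 < K) (h1 : fderiv ℝ ν p₀ = 0)
    (ha : fderiv ℝ (fderiv ℝ ν) p₀ ((1 : ℝ), (0 : ℝ)) ((1 : ℝ), (0 : ℝ)) < 0)
    (hdet : w ≤ fderiv ℝ (fderiv ℝ ν) p₀ ((1 : ℝ), (0 : ℝ)) ((1 : ℝ), (0 : ℝ)) *
        fderiv ℝ (fderiv ℝ ν) p₀ ((0 : ℝ), (1 : ℝ)) ((0 : ℝ), (1 : ℝ)) -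
        (fderiv ℝ (fderiv ℝ ν) p₀ ((1 : ℝ), (0 : ℝ)) ((0 : ℝ), (1 : ℝ))) ^ 2)
    (htr : -(fderiv ℝ (fderiv ℝ ν) p₀ ((1 : ℝ), (0 : ℝ)) ((1 : ℝ), (0 : ℝ)) +
        fderiv ℝ (fderiv ℝ ν) p₀ ((0 : ℝ), (1 : ℝ)) ((0 : ℝ), (1 : ℝ))) ≤ 2 * K)
    (hmod : ∀ p ∈ Metric.ball p₀ r₀,
      ‖fderiv ℝ (fderiv ℝ ν) p - fderiv ℝ (fderiv ℝ ν) p₀‖ ≤ w / (4 * K))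
    (f₀ ε : ℝ) (hε : 0 < ε) :
    volume (Metric.ball p₀ (r₀ / 2) ∩ {p | |f₀ + ν p| ≤ ε}) ≤
      ENNReal.ofReal (16 * K * Real.pi * ε / w) := by
  set μ : ℝ × ℝ → ℝ := fun p => -ν p with hμ
  have hμC : ContDiff ℝ 2 μ := hν.neg
  have hfd : fderiv ℝ μ = fun p => -fderiv ℝ ν p := by
    funext p; rw [hμ]; exact fderiv_neg
  have hfd2 : ∀ p, fderiv ℝ (fderiv ℝ μ) p = -fderiv ℝ (fderiv ℝ ν) p := by
    intro p; rw [hfd]; exact fderiv_neg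
  have hset : {p : ℝ × ℝ | |f₀ + ν p| ≤ ε} = {p : ℝ × ℝ | |-f₀ + μ p| ≤ ε} := by
    ext p
    simp only [mem_setOf_eq, hμ]
    rw [show -f₀ + -ν p = -(f₀ + ν p) by ring, abs_neg]
  rw [hset]
  refine volume_band_le_of_posDef_hessian_at hμC p₀ hr₀ hw hK (by rw [hfd]; simp [h1])
    ?_ ?_ ?_ ?_ (-f₀) ε hε
  · rw [hfd2, neg_apply, neg_apply]; linarith
  · simp only [hfd2, neg_apply]; nlinarith
  · simp only [hfd2, neg_apply]; linarith
  · intro p hp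
    rw [hfd2, hfd2, show -fderiv ℝ (fderiv ℝ ν) p - -fderiv ℝ (fderiv ℝ ν) p₀ =
      -(fderiv ℝ (fderiv ℝ ν) p - fderiv ℝ (fderiv ℝ ν) p₀) by abel, ContinuousLinearMap.opNorm_neg]
    exact hmod p hp

end DefiniteHessian

/-! ### The crude bound `𝓦(ε) ≤ L²(b-a)²` (finiteness; the large-`ε` range) -/

section LargeEps

variable {E : Type*} [NormedAddCommGroup E] [InnerProductSpace ℝ E]
  [MeasurableSpace E] [BorelSpace E]

/-- The crude bound behind the finiteness of `𝓦`: for a Lipschitz parametrisation as in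
`volW_le_of_lipschitz_param`, `volW cr e ε ≤ L²·(b - a)²` for EVERY `ε` (each angular integral
is at most the area `(b-a)²`). App. B proves its estimate for small `ε` ("we may assume
`ε < κ/2`", p.33 L60–62); this bound extends it to the typed range `0 < ε ≤ 1/2` by enlarging
the constant. [cite: FeldmanSalmhoferTrubowitz1998, App. B (arXiv p.33 L60–62)] -/
theorem volW_le_sq_of_lipschitz_param (cr : Crystal E) {e : E → ℝ} (he : Continuous e)
    (hd : Module.finrank ℝ E = 2) {γ : ℝ → E} {L : ℝ≥0} {a b : ℝ} (hγ : LipschitzWith L γ)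
    (hcov : cr.fermiSurfaceRep e ⊆ γ '' Icc a b) (ε : ℝ) :
    volW cr e ε ≤ (L : ℝ≥0∞) ^ 2 * ENNReal.ofReal ((b - a) ^ 2) := by
  refine (volW_le_of_lipschitz_param cr he hd hγ hcov ε).trans ?_
  gcongr
  refine iSup_le fun q => iSup_le fun v₁ => iSup_le fun _ => iSup_le fun v₂ =>
    iSup_le fun _ => ?_
  calc volume ((Icc a b ×ˢ Icc a b) ∩ {θ : ℝ × ℝ | |e (v₁ • γ θ.1 + v₂ • γ θ.2 + q)| ≤ ε})
      ≤ volume (Icc a b ×ˢ Icc a b) := measure_mono inter_subset_left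
    _ ≤ ENNReal.ofReal ((b - a) ^ 2) := by
        rw [Measure.volume_eq_prod, Measure.prod_prod, Real.volume_Icc]
        by_cases hab : a ≤ b
        · rw [← ENNReal.ofReal_mul (by linarith), sq]
        · have : b - a ≤ 0 := by linarith
          rw [ENNReal.ofReal_of_nonpos this, zero_mul]
          exact zero_le

end LargeEps

/-! ### Affine changes of variables; the saddle bound in arbitrary directions -/

section Transport

variable {ν : ℝ × ℝ → ℝ}

/-- The determinant of `(s,t) ↦ s•u + t•v` on `ℝ × ℝ`. [folklore] -/
private theorem det_smulRight_add (u v : ℝ × ℝ) :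
    LinearMap.det (((ContinuousLinearMap.fst ℝ ℝ ℝ).smulRight u +
      (ContinuousLinearMap.snd ℝ ℝ ℝ).smulRight v : (ℝ × ℝ) →L[ℝ] (ℝ × ℝ)) : (ℝ × ℝ) →ₗ[ℝ] (ℝ × ℝ))
      = u.1 * v.2 - u.2 * v.1 := by
  rw [← LinearMap.det_toMatrix (Module.Basis.finTwoProd ℝ), Matrix.det_fin_two]
  simp [LinearMap.toMatrix_apply]
  ring

/-- **Band volumes under an affine change of variables** (the measure-theoretic content of the
linear normalisation step of App. B, p.35 L47–80: "the Jacobian of this linear transformation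
is `|det D₀|^{-1/2}`"): for a linear `L` and a base point `p₀`,
`vol((p₀ + L·)''S ∩ {|f₀ + ν| ≤ ε}) = |det L| · vol(S ∩ {x : |f₀ + ν(p₀ + L x)| ≤ ε})`
(translation invariance and `Measure.addHaar_image_linearMap`; no invertibility needed).
[cite: FeldmanSalmhoferTrubowitz1998, App. B (arXiv p.35 L47–80)] -/
theorem volume_affine_image_inter_band (ν : ℝ × ℝ → ℝ) (L : (ℝ × ℝ) →L[ℝ] (ℝ × ℝ))
    (p₀ : ℝ × ℝ) (S : Set (ℝ × ℝ)) (f₀ ε : ℝ) :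
    volume ((fun x => p₀ + L x) '' S ∩ {p : ℝ × ℝ | |f₀ + ν p| ≤ ε}) =
      ENNReal.ofReal |LinearMap.det (L : (ℝ × ℝ) →ₗ[ℝ] (ℝ × ℝ))| *
        volume (S ∩ {x : ℝ × ℝ | |f₀ + ν (p₀ + L x)| ≤ ε}) := by
  have h1 : (fun x => p₀ + L x) '' S ∩ {p : ℝ × ℝ | |f₀ + ν p| ≤ ε} =
      (fun x => p₀ + L x) '' (S ∩ {x : ℝ × ℝ | |f₀ + ν (p₀ + L x)| ≤ ε}) := by
    rw [← image_inter_preimage]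
    rfl
  rw [h1, show (fun x => p₀ + L x) = (fun y => p₀ + y) ∘ (fun x => L x) from rfl, image_comp,
    image_add_left, measure_preimage_add]
  exact Measure.addHaar_image_linearMap volume (L : (ℝ × ℝ) →ₗ[ℝ] (ℝ × ℝ)) _

/-- Second derivatives of `ν ∘ (p₀ + A·)` in terms of those of `ν`. [folklore] -/
private theorem fderiv2_comp_affine (hν : ContDiff ℝ 2 ν) (p₀ : ℝ × ℝ) (A : (ℝ × ℝ) →L[ℝ] (ℝ × ℝ))
    (x w w' : ℝ × ℝ) :
    fderiv ℝ (fderiv ℝ (fun y => ν (p₀ + A y))) x w w' =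
      fderiv ℝ (fderiv ℝ ν) (p₀ + A x) (A w) (A w') := by
  set μ : ℝ × ℝ → ℝ := fun y => ν (p₀ + A y) with hμ
  have hμC : ContDiff ℝ 2 μ := hν.comp (contDiff_const.add A.contDiff)
  have hA : ∀ y : ℝ × ℝ, HasFDerivAt (fun y : ℝ × ℝ => p₀ + A y) A y := fun y =>
    A.hasFDerivAt.const_add p₀
  have hd1 : ∀ y, HasFDerivAt μ ((fderiv ℝ ν (p₀ + A y)).comp A) y := fun y =>
    ((hν.differentiable (by simp)) (p₀ + A y)).hasFDerivAt.comp y (hA y)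
  have hfd : fderiv ℝ μ = fun y => (fderiv ℝ ν (p₀ + A y)).comp A :=
    funext fun y => (hd1 y).fderiv
  have hdiff : DifferentiableAt ℝ (fderiv ℝ μ) x :=
    ((hμC.fderiv_right (m := 1) (by norm_num)).differentiable (by simp)) x
  have h2 : fderiv ℝ (fderiv ℝ μ) x w w' = fderiv ℝ (fun y => fderiv ℝ μ y w') x w := by
    rw [fderiv_clm_apply hdiff (differentiableAt_const w')]
    simp
  rw [h2]
  have h3 : (fun y => fderiv ℝ μ y w') = fun y => fderiv ℝ ν (p₀ + A y) (A w') := by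
    funext y; rw [hfd]; rfl
  rw [h3]
  have h4 : HasFDerivAt ((fun q : ℝ × ℝ => fderiv ℝ ν q (A w')) ∘ (fun y : ℝ × ℝ => p₀ + A y))
      (((fderiv ℝ (fderiv ℝ ν) (p₀ + A x)).flip (A w')).comp A) x :=
    (hasFDerivAt_partial_of_contDiff hν (A w') (p₀ + A x)).comp x (hA x)
  rw [show (fun y : ℝ × ℝ => fderiv ℝ ν (p₀ + A y) (A w')) =
      ((fun q : ℝ × ℝ => fderiv ℝ ν q (A w')) ∘ (fun y : ℝ × ℝ => p₀ + A y)) from rfl, h4.fderiv]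
  simp [ContinuousLinearMap.flip_apply]

/-- **The quantitative saddle bound in two arbitrary directions** (`volume_band_le_of_saddle`
transported by the affine map `(s,t) ↦ p₀ + s u + t v` — the linear normalisation step of
App. B, p.35 L47–80, kept explicit): if `D²ν(p)(v,v) ≥ λ` and `D²ν(p)(u,u) ≤ -λ` at every point
`p = p₀ + s u + t v`, `|s|,|t| ≤ σ`, of the parallelogram `P`, and `ν` oscillates by at most `Ω`
on `P`, then for every `f₀`, every `ε > 0` and every `K` with `Ω + ε ≤ 2ε·4^K`,
`vol(P ∩ {|f₀ + ν| ≤ ε}) ≤ |u₁v₂ - u₂v₁| · (32 + 48K) ε/λ`. The choice of the directions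
(eigen-directions of `D₀`, or the explicit congruence of `morseC2_nondegenerate_volume_le_at`)
is left to the user. [cite: FeldmanSalmhoferTrubowitz1998, App. B (arXiv p.35 L47–112)] -/
theorem volume_band_le_of_saddle_dir (hν : ContDiff ℝ 2 ν) (p₀ u v : ℝ × ℝ) {σ lam Ω : ℝ}
    (hσ : 0 < σ) (hlam : 0 < lam)
    (hvv : ∀ x ∈ Icc (-σ) σ ×ˢ Icc (-σ) σ,
      lam ≤ fderiv ℝ (fderiv ℝ ν) (p₀ + (x.1 • u + x.2 • v)) v v)
    (huu : ∀ x ∈ Icc (-σ) σ ×ˢ Icc (-σ) σ,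
      fderiv ℝ (fderiv ℝ ν) (p₀ + (x.1 • u + x.2 • v)) u u ≤ -lam)
    (hosc : ∀ x ∈ Icc (-σ) σ ×ˢ Icc (-σ) σ, ∀ y ∈ Icc (-σ) σ ×ˢ Icc (-σ) σ,
      ν (p₀ + (x.1 • u + x.2 • v)) - ν (p₀ + (y.1 • u + y.2 • v)) ≤ Ω)
    (f₀ ε : ℝ) (hε : 0 < ε) (K : ℕ) (hK : Ω + ε ≤ 2 * ε * 4 ^ K) :
    volume ((fun x : ℝ × ℝ => p₀ + (x.1 • u + x.2 • v)) '' (Icc (-σ) σ ×ˢ Icc (-σ) σ) ∩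
        {p : ℝ × ℝ | |f₀ + ν p| ≤ ε}) ≤
      ENNReal.ofReal (|u.1 * v.2 - u.2 * v.1| * ((32 + 48 * K) * ε / lam)) := by
  set A : (ℝ × ℝ) →L[ℝ] (ℝ × ℝ) := (ContinuousLinearMap.fst ℝ ℝ ℝ).smulRight u +
    (ContinuousLinearMap.snd ℝ ℝ ℝ).smulRight v with hAdef
  have hA : ∀ x : ℝ × ℝ, A x = x.1 • u + x.2 • v := fun x => by
    simp [hAdef]
  have hAu : A ((1 : ℝ), (0 : ℝ)) = u := by rw [hA]; simp
  have hAv : A ((0 : ℝ), (1 : ℝ)) = v := by rw [hA]; simp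
  have hfun : (fun x : ℝ × ℝ => p₀ + (x.1 • u + x.2 • v)) = fun x => p₀ + A x := by
    funext x; rw [hA]
  rw [hfun, volume_affine_image_inter_band ν A p₀ _ f₀ ε, hAdef, det_smulRight_add, ← hAdef,
    ENNReal.ofReal_mul (abs_nonneg _)]
  gcongr
  set μ : ℝ × ℝ → ℝ := fun y => ν (p₀ + A y) with hμ
  have hμC : ContDiff ℝ 2 μ := hν.comp (contDiff_const.add A.contDiff)
  have hyy : ∀ p ∈ Icc (-σ) σ ×ˢ Icc (-σ) σ,
      lam ≤ fderiv ℝ (fderiv ℝ μ) p ((0 : ℝ), (1 : ℝ)) ((0 : ℝ), (1 : ℝ)) := by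
    intro p hp
    rw [hμ, fderiv2_comp_affine hν p₀ A, hAv, hA]
    exact hvv p hp
  have hxx : ∀ p ∈ Icc (-σ) σ ×ˢ Icc (-σ) σ,
      fderiv ℝ (fderiv ℝ μ) p ((1 : ℝ), (0 : ℝ)) ((1 : ℝ), (0 : ℝ)) ≤ -lam := by
    intro p hp
    rw [hμ, fderiv2_comp_affine hν p₀ A, hAu, hA]
    exact huu p hp
  have hosc' : ∀ p ∈ Icc (-σ) σ ×ˢ Icc (-σ) σ, ∀ q ∈ Icc (-σ) σ ×ˢ Icc (-σ) σ, μ p - μ q ≤ Ω := by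
    intro p hp q hq
    simp only [hμ, hA]
    exact hosc p hp q hq
  have h := volume_band_le_of_saddle hμC hσ hlam hyy hxx hosc' f₀ ε hε K hK
  have hset : (Icc (-σ) σ ×ˢ Icc (-σ) σ) ∩ {x : ℝ × ℝ | |f₀ + ν (p₀ + A x)| ≤ ε} =
      (Icc (-σ) σ ×ˢ Icc (-σ) σ) ∩ {p : ℝ × ℝ | |f₀ + μ p| ≤ ε} := rfl
  rw [hset]
  exact h

/-- `volume_band_le_of_saddle_dir` in the `Q·ε(1+|log ε|)` shape (`volume_band_le_of_saddle_log`
transported): `vol(P ∩ {|f₀ + ν| ≤ ε}) ≤ |u₁v₂ - u₂v₁| · ((80 + 35 log(Ω+1))/λ) · ε · (1+|log ε|)`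
for `0 < ε ≤ 1/2`. [cite: FeldmanSalmhoferTrubowitz1998, App. B (arXiv p.35 L47–112)] -/
theorem volume_band_le_of_saddle_dir_log (hν : ContDiff ℝ 2 ν) (p₀ u v : ℝ × ℝ) {σ lam Ω : ℝ}
    (hσ : 0 < σ) (hlam : 0 < lam)
    (hvv : ∀ x ∈ Icc (-σ) σ ×ˢ Icc (-σ) σ,
      lam ≤ fderiv ℝ (fderiv ℝ ν) (p₀ + (x.1 • u + x.2 • v)) v v)
    (huu : ∀ x ∈ Icc (-σ) σ ×ˢ Icc (-σ) σ,
      fderiv ℝ (fderiv ℝ ν) (p₀ + (x.1 • u + x.2 • v)) u u ≤ -lam)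
    (hosc : ∀ x ∈ Icc (-σ) σ ×ˢ Icc (-σ) σ, ∀ y ∈ Icc (-σ) σ ×ˢ Icc (-σ) σ,
      ν (p₀ + (x.1 • u + x.2 • v)) - ν (p₀ + (y.1 • u + y.2 • v)) ≤ Ω)
    (f₀ ε : ℝ) (hε : 0 < ε) (hε2 : ε ≤ 1 / 2) :
    volume ((fun x : ℝ × ℝ => p₀ + (x.1 • u + x.2 • v)) '' (Icc (-σ) σ ×ˢ Icc (-σ) σ) ∩
        {p : ℝ × ℝ | |f₀ + ν p| ≤ ε}) ≤
      ENNReal.ofReal (|u.1 * v.2 - u.2 * v.1| *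
        ((80 + 35 * Real.log (Ω + 1)) / lam * ε * (1 + |Real.log ε|))) := by
  set A : (ℝ × ℝ) →L[ℝ] (ℝ × ℝ) := (ContinuousLinearMap.fst ℝ ℝ ℝ).smulRight u +
    (ContinuousLinearMap.snd ℝ ℝ ℝ).smulRight v with hAdef
  have hA : ∀ x : ℝ × ℝ, A x = x.1 • u + x.2 • v := fun x => by
    simp [hAdef]
  have hAu : A ((1 : ℝ), (0 : ℝ)) = u := by rw [hA]; simp
  have hAv : A ((0 : ℝ), (1 : ℝ)) = v := by rw [hA]; simp
  have hfun : (fun x : ℝ × ℝ => p₀ + (x.1 • u + x.2 • v)) = fun x => p₀ + A x := by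
    funext x; rw [hA]
  rw [hfun, volume_affine_image_inter_band ν A p₀ _ f₀ ε, hAdef, det_smulRight_add, ← hAdef,
    ENNReal.ofReal_mul (abs_nonneg _)]
  gcongr
  set μ : ℝ × ℝ → ℝ := fun y => ν (p₀ + A y) with hμ
  have hμC : ContDiff ℝ 2 μ := hν.comp (contDiff_const.add A.contDiff)
  have hyy : ∀ p ∈ Icc (-σ) σ ×ˢ Icc (-σ) σ,
      lam ≤ fderiv ℝ (fderiv ℝ μ) p ((0 : ℝ), (1 : ℝ)) ((0 : ℝ), (1 : ℝ)) := by
    intro p hp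
    rw [hμ, fderiv2_comp_affine hν p₀ A, hAv, hA]
    exact hvv p hp
  have hxx : ∀ p ∈ Icc (-σ) σ ×ˢ Icc (-σ) σ,
      fderiv ℝ (fderiv ℝ μ) p ((1 : ℝ), (0 : ℝ)) ((1 : ℝ), (0 : ℝ)) ≤ -lam := by
    intro p hp
    rw [hμ, fderiv2_comp_affine hν p₀ A, hAu, hA]
    exact huu p hp
  have hosc' : ∀ p ∈ Icc (-σ) σ ×ˢ Icc (-σ) σ, ∀ q ∈ Icc (-σ) σ ×ˢ Icc (-σ) σ, μ p - μ q ≤ Ω := by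
    intro p hp q hq
    simp only [hμ, hA]
    exact hosc p hp q hq
  have h := volume_band_le_of_saddle_log hμC hσ hlam hyy hxx hosc' f₀ ε hε hε2
  have hset : (Icc (-σ) σ ×ˢ Icc (-σ) σ) ∩ {x : ℝ × ℝ | |f₀ + ν (p₀ + A x)| ≤ ε} =
      (Icc (-σ) σ ×ˢ Icc (-σ) σ) ∩ {p : ℝ × ℝ | |f₀ + μ p| ≤ ε} := rfl
  rw [hset]
  exact h

/-- A sup-norm ball around `p₀` inside the parallelogram `p₀ + [-σ,σ]u + [-σ,σ]v`: radius `r`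
with `r (|u₁|+|u₂|+|v₁|+|v₂|) ≤ σ |u₁v₂ - u₂v₁|` suffices (Cramer's rule). [folklore] -/
private theorem ball_subset_image_parallelogram (p₀ u v : ℝ × ℝ) {σ r : ℝ}
    (hdet : u.1 * v.2 - u.2 * v.1 ≠ 0)
    (hr : r * (|u.1| + |u.2| + |v.1| + |v.2|) ≤ σ * |u.1 * v.2 - u.2 * v.1|) :
    Metric.ball p₀ r ⊆
      (fun x : ℝ × ℝ => p₀ + (x.1 • u + x.2 • v)) '' (Icc (-σ) σ ×ˢ Icc (-σ) σ) := by
  intro p hp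
  set D := u.1 * v.2 - u.2 * v.1 with hD
  set d := p - p₀ with hd
  have hd1 : |d.1| < r := by
    have h := hp; rw [Metric.mem_ball, dist_eq_norm, Prod.norm_def] at h
    exact lt_of_le_of_lt (le_max_left _ _) h
  have hd2 : |d.2| < r := by
    have h := hp; rw [Metric.mem_ball, dist_eq_norm, Prod.norm_def] at h
    exact lt_of_le_of_lt (le_max_right _ _) h
  have hr0 : 0 < r := lt_of_le_of_lt (abs_nonneg _) hd1
  have hDpos : 0 < |D| := abs_pos.2 hdet
  set s := (d.1 * v.2 - d.2 * v.1) / D with hs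
  set t := (u.1 * d.2 - u.2 * d.1) / D with ht
  have hsum : |u.1| + |u.2| + |v.1| + |v.2| ≥ 0 := by positivity
  -- |s| ≤ σ and |t| ≤ σ
  have hsb : |s| ≤ σ := by
    rw [hs, abs_div]
    rw [div_le_iff₀ hDpos]
    have h1 : |d.1 * v.2 - d.2 * v.1| ≤ |d.1| * |v.2| + |d.2| * |v.1| := by
      calc |d.1 * v.2 - d.2 * v.1| ≤ |d.1 * v.2| + |d.2 * v.1| := abs_sub _ _
        _ = |d.1| * |v.2| + |d.2| * |v.1| := by rw [abs_mul, abs_mul]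
    have h2 : |d.1| * |v.2| + |d.2| * |v.1| ≤ r * |v.2| + r * |v.1| := by
      gcongr
    nlinarith [abs_nonneg u.1, abs_nonneg u.2, abs_nonneg v.1, abs_nonneg v.2]
  have htb : |t| ≤ σ := by
    rw [ht, abs_div]
    rw [div_le_iff₀ hDpos]
    have h1 : |u.1 * d.2 - u.2 * d.1| ≤ |u.1| * |d.2| + |u.2| * |d.1| := by
      calc |u.1 * d.2 - u.2 * d.1| ≤ |u.1 * d.2| + |u.2 * d.1| := abs_sub _ _
        _ = |u.1| * |d.2| + |u.2| * |d.1| := by rw [abs_mul, abs_mul]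
    have h2 : |u.1| * |d.2| + |u.2| * |d.1| ≤ |u.1| * r + |u.2| * r := by
      gcongr
    nlinarith [abs_nonneg u.1, abs_nonneg u.2, abs_nonneg v.1, abs_nonneg v.2]
  refine ⟨(s, t), ⟨abs_le.1 hsb, abs_le.1 htb⟩, ?_⟩
  have hp' : p = p₀ + d := by rw [hd]; abel
  rw [hp']
  simp only
  congr 1
  ext
  · simp only [Prod.fst_add, Prod.smul_fst, smul_eq_mul, hs, ht]
    field_simp
    ring
  · simp only [Prod.snd_add, Prod.smul_snd, smul_eq_mul, hs, ht]
    field_simp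
    ring

/-- `volume_band_le_of_saddle_dir_log` on a BALL around `p₀` (sup norm, radius `r` with
`r (|u₁|+|u₂|+|v₁|+|v₂|) ≤ σ |u₁v₂ - u₂v₁|`): the shape in which App. B uses the singular-region
estimate around each critical point (p.35 L81–112). [cite: FeldmanSalmhoferTrubowitz1998, App. B (arXiv p.35 L47–112)] -/
theorem volume_ball_band_le_of_saddle_dir_log (hν : ContDiff ℝ 2 ν) (p₀ u v : ℝ × ℝ)
    {σ lam Ω r : ℝ} (hσ : 0 < σ) (hlam : 0 < lam)
    (hdet : u.1 * v.2 - u.2 * v.1 ≠ 0)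
    (hr : r * (|u.1| + |u.2| + |v.1| + |v.2|) ≤ σ * |u.1 * v.2 - u.2 * v.1|)
    (hvv : ∀ x ∈ Icc (-σ) σ ×ˢ Icc (-σ) σ,
      lam ≤ fderiv ℝ (fderiv ℝ ν) (p₀ + (x.1 • u + x.2 • v)) v v)
    (huu : ∀ x ∈ Icc (-σ) σ ×ˢ Icc (-σ) σ,
      fderiv ℝ (fderiv ℝ ν) (p₀ + (x.1 • u + x.2 • v)) u u ≤ -lam)
    (hosc : ∀ x ∈ Icc (-σ) σ ×ˢ Icc (-σ) σ, ∀ y ∈ Icc (-σ) σ ×ˢ Icc (-σ) σ,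
      ν (p₀ + (x.1 • u + x.2 • v)) - ν (p₀ + (y.1 • u + y.2 • v)) ≤ Ω)
    (f₀ ε : ℝ) (hε : 0 < ε) (hε2 : ε ≤ 1 / 2) :
    volume (Metric.ball p₀ r ∩ {p : ℝ × ℝ | |f₀ + ν p| ≤ ε}) ≤
      ENNReal.ofReal (|u.1 * v.2 - u.2 * v.1| *
        ((80 + 35 * Real.log (Ω + 1)) / lam * ε * (1 + |Real.log ε|))) :=
  (measure_mono (inter_subset_inter_left _
    (ball_subset_image_parallelogram p₀ u v hdet hr))).trans
    (volume_band_le_of_saddle_dir_log hν p₀ u v hσ hlam hvv huu hosc f₀ ε hε hε2)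

end Transport

end Literature.MathematicalPhysics.QuantumLattice.FermiRG

end
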